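import Summits.QuantumFields.YangMills.Theorems.BalabanUVNodesN24K1R9ByNameOfOpenStubsGridGChildrenSplitSlot8Thm1AEPosAtGaussPinPrintedZYP
import Summits.QuantumFields.YangMills.Theorems.BalabanUVNodesN24K1R9ByNameSlot8Thm1AEInstPerKappaPrimeGuarded
import Summits.QuantumFields.YangMills.Theorems.BalabanUVNodesN05SubBP2DK2PerKappaSlotExistsOfBindersLettersPerDoorL
import Literature.MathematicalPhysics.QuantumFieldTheory.Balaban1983to89.B9Thm33BindersUniformZdPerNestedEta
import Literature.MathematicalPhysics.QuantumFieldTheory.Balaban1983to89.Node00.Record12NumericsFamilyFiniteDim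
import Summits.QuantumFields.YangMills.Theorems.BalabanUVNodesN06AtOpsYNuOfRecordV6EPairOY
import Literature.MathematicalPhysics.QuantumFieldTheory.Balaban1983to89.Node00.CarriersZSectE
import Summits.QuantumFields.YangMills.Theorems.BalabanUVNodesN08AlphaEq324RowACReMassedZSlot
import Literature.MathematicalPhysics.QuantumFieldTheory.Balaban1983to89.Node00.Record12NumericsFamilyTraceState

/-!
# NODE N24 (B2) — THE K1-FACE N06 ∕ N07 ∕ N08 LEAF JUNCTION, EDITION «Tr» (PRINT'S TRACE STATE OFF THE BILL): THE K1 FACE OF RECORD (p688041) WITH NODE N06's LEAF `B9LeafX (Y9OfRecordP 2 (stage3OfFamily F) M⋆ ops)` CONSUMED BY dag-n06-d's STAGE-11 CERTIFICATE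
# `N06AtOpsYNuOfRecordV6EPairOY.b9LeafXP10_opsYNuOfRecordV6E_pairOY` BY NAME — N06's OBJECT OF RECORD `ops := opsYNuOfRecordV4PE 2 (stage3OfFamily F) M⋆ 𝔯 (sectEYOfRecordV6 …) 𝔴 𝔈` PINNED, the certificate's ≈ 330 binders DISPLAYED VERBATIM
# (`N := 2`, `θ.toStage3Params := stage3OfFamily F`, Skolemised in `F`) IN PLACE OF `h06`; K1⁹ `StabilityBRunRowsAtRecordR13SepCoPHV` (stmt-QuantumFields-27364) BY ITS ROUTE NAME; everything else = p688041

TRACK A (YM-PLAN §2d, node N24 of 28 = binder B2), seat `pub-ymgap-dag-n24-c` (R134 s2; gen 16, INTENT-76).  Summits lane; count-neutral.  [4] = [Balaban1985BackgroundPropagators]; [B8] = [Balaban1985RegularSpaces];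
[V] = [Balaban1989LargeFieldII]; [III] = [Balaban1988Convergent]; [I] = [Balaban1987RG1].

WHY.  Every K1 face of this lineage (p650613 → … → p688041) displayed NODE N06 as the bare leaf `h06 : ∀ F, ∃ M⋆ ops, B9LeafX (Y9OfRecordP 2 (stage3OfFamily F) M⋆ ops)` — N06's OBJECT of record with
`ops` FREE.  dag-n06-d's certificate (edition `…N06AtOpsYNuOfRecordV6EPairOY` = edition 70 = THE CERTIFICATE OF RECORD since 06:52Z 2026-08-29, p703632 (ref-A READ-51 act (iv) PASS), the print-literal instantiation of edition 69 OX; successor of edition 66 OU consumed by this lineage's p701900 — binder diff vs OU: REMOVED hrgdH (ed. 67′, DERIVED by print's route p.421) and hL3131H (ed. 69, DERIVED), ADDED B43 δ43 hB43 h43Gp ρrg hρrg0 hbudrg hbud43 hδ₃rg hB₃rg (ed. 67′) and hbud43T (ed. 69); conclusion IDENTICAL; U8 GAP-STATED in the certificate's own docstring) proves `B9LeafX (Y9OfRecordP N θ.toStage3Params M⋆ (opsYNuOfRecordV4PE N θ.toStage3Params M⋆ 𝔯 (sectEYOfRecordV6 …) 𝔴 𝔈))` for EVERY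
admissible `θ : Stage11Params F N`, and — first-hand census of its signature — reads `θ` ONLY through `θ.toStage3Params` and the Stage-3 fields `θ.d₆ θ.ℓ₆ θ.hd' θ.hL' θ.b₀ θ.b₁` (plus
`hθ : θ.Admissible`, used in its proof, in no binder type).  KERNEL FACT (g14, `rfl`): the Stage-3 view of every member of the K0 witness family is the family dictionary,
`(theta13OfThm1CCMWZ F 2 j γ …).toStage3Params = stage3OfFamily F`; so at each door the certificate applies at the witness's Stage-11 view `(θZπ).toStage12Params.toStage11 F 2 p`
(admissible by `Node00.admissible_theta13OfThm1CCMWZ_of_le_half` and `Admissible.toStage12∕.toStage11`; the view's run-indexed weight binder `Wt` is read by no binder of the certificate, so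
the run `p` is immaterial — `⟨0, 0, 0⟩` here), and its hypotheses, keyed on Stage-3 data only, are ONE statement per `F` at `stage3OfFamily F`: door-free, letter-free.  THIS FILE is p688041
with `h06` REPLACED by those hypotheses — the certificate's binders after `(θ) (hθ)`, VERBATIM up to the three substitutions `N := 2`, `θ.toStage3Params ∕ θ.<Stage-3 field> := (stage3OfFamily F)…`,
and Skolemisation in `F` (each binder `(b : T)` becomes `(b : ∀ F : T4Family, T[earlier binders e ↦ e F])`; the certificate's five instance binders become the named binders `instN06_1…5`;
the inner walk indices `p q` of `near14₁ ∕ near14₂` are renamed `pᵢ qᵢ`, α-conversion only) — and CONSUMED in the proof by ONE term `⟨Mstar F, _, @b9LeafXP10_opsYNuOfRecordV6E_pairOY 2 _ F θ₁₁ hθ₁₁ (Mstar F) (𝔯 F) … ⟩` per door.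

N07 ∕ N08 (as INTENT-75 ∕ p701900).  The same face ALSO consumes NODE N07's leaf `h07 : ∀ F, ∃ ζ, B11Leaf (Z11OfRecord F 2 ζ)` through NODE 00's Sect.-E presentation of the [B11] group of record —
`Node00/CarriersZSectE.b11Leaf_Z11OfRecord_withSectE_of_parts` (node00-def-B11; n16-d's `B11LeafKnitSectE` + n07-b's `B11Prop6Concrete` inside) at print's letters `L := F.L`,
`η i := (F.P i.K).eta i.k` — displaying per `F` the presentation `E`, n16's bridges with their laws and capped existence leaves, the `famX` laws, the Sect. A law (14) below a threshold, the
printed sign∕size relations and THE SIX REMAINING PRINTED PARTS `Prop2Printed ∕ Prop3Printed ∕ Prop5Printed ∕ Prop8Printed ∕ SectFPrinted ∕ Prop9Printed` (p4, p6 are theorems inside); and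
NODE N08's slot `h08 : ∀ F, PrintedUV3V 2 F.L` through dag-n08-w4's `…N08AlphaEq324RowACReMassedZSlot.printedUV3V_at_slotOfRecord_of_coreLTAtAC_of_massBoundZAE_of_consts` at `N := 2`,
`L := F.L` — displaying per `F` N08's (α)-AC residual (R-AC-324⁷ reading): AC external inputs at print's averaging (`hav`, `hUk`), the numeric window, the EDITED (α)-AC rows
`RunAlphaEq324CoreLTAtAC` on the family, `0 ≤ c_m`, and the `dU`-a.e. history-extensive mass bound.  Both sockets farm-checked standalone first (SocketN07 ∕ SocketN08 ∕ Mini78, rc 0).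
The junk channel of N07's ∀-form (`ζ.R`, F8) is NOT closed by the presentation — said in `CarriersZSectE` and repeated here; N08's E6′ seam ∕ object gap are the n08 lanes' located items, displayed not resolved.

EDITION «Tr» (INTENT-77).  Every K1 face since p650613 displayed, inside the N05∕N06-slot binder `hN06`, a TRACE STATE on `(stage3OfFamily F).𝔸` as ∃-DATA: `(τ : 𝔸 →ₗ[ℂ] ℂ) (C_τ : ℝ)` with
(i) `a ≠ 0 → 0 < Re τ(a⋆a)`, (ii) `τ(ab) = τ(ba)`, (iii) `τ(a⋆) = conj (τ a)`, (iv) `|Re τ(x⋆y)| ≤ C_τ‖x‖‖y‖` — the hypotheses under which dag-n06-b's `binders_uniform` and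
dag-n05-d's ζ-L door are UNIFORM in `τ`.  At the RECORD-NONABELIAN dictionary `(stage3OfFamily F).𝔸 = Matrix (Fin 2) (Fin 2) ℂ` (`rfl`, `Record12NumericsColourTie.stage3OfFamily_𝔸`)
(i)–(iv) are THEOREMS for print's trace ([I] (0.2) p.252; [B8] p.76): NODE 00's `Record12NumericsFamilyTraceState.exists_traceState_stage3OfFamily F` (this seat, INTENT-77a).  THIS
EDITION removes `(τ, C_τ)` and clauses (i)–(iv) from `hN06` (47 → 43 conjuncts; `τ`∕`C_τ` occur in no other conjunct — census) and obtains them in the proof BY NAME; the slot proof is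
otherwise p705524's verbatim.  The slot's CONTENT — `β`, `len`, the seven numerics, [4]'s Hölder-pair operators per `IdxB8SubDPerκ`, the Landau operators per `IdxB8LanCκPer` — stays DISPLAYED.

WHAT THIS FILE PROVES (1 theorem, 0 `def`, 0 `sorry`; standard axioms).  ★★★★ `N24_stabilityBRunRowsAtRecordR13SepCoPHV_byName_of_openStubsGridG_of_n06TorusDataLettersLSlot8KappaPrime_n06CertificateOY_n07PartsSectE_n08ResidualAC_trM2_stage3DoorFree_n13LevelZero_atGaussPinPrintedZ_pinYP_of_runRowsCont`
= p688041's theorem with the binder `h06` replaced by the 316 Skolemised certificate binders, `h07` by `hN07`, `h08` by `hN08` `(Mstar : ∀ F, ℕ) (𝔯 : ∀ F, ResY 2 (stage3OfFamily F) (Mstar F)) … (hE : ∀ F, …)`; every other binder, the `Slot8` λ-term and the N05∕N06-slot proof BYTE-IDENTICAL to p688041.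

WHICH CHILD BLOCKS AT THE PRINTED-z GAUSS PIN AFTER THIS FILE (= its hypotheses): K0⁷ V21-G stubs 1-G‴ ∧ 3ᴬ′-G‴ (REGISTERED 0∕2); per `F` at `stage3OfFamily F`: N05∕N06 slot `hN06` = Hölder pair + [4]'s
letters `hLet`∕`SLetUB` (the trace state `(τ, C_τ)` is OFF the bill since edition «Tr»); **N06 = dag-n06-d's certificate binders VERBATIM** (the residual objects `𝔯 𝔢₀ 𝔴 𝔈`, the three∕two instance families, and every displayed letter schema over print's cube class
`(bg9YP … x).Reg335∕336 c35Y α₀ U` — rows 18–26, the (P2′)∕(P1) pins, FLAG №6 `hLIM`, FLAG №8 `hB`, O5 `hZ`, exactly as that edition's module docstring lists them); N10 `h10` (display-only; inhabited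
AS TYPED, p685841 — plan g90 WORD (a)); **N07 = the Sect.-E presentation + six printed parts + bridges∕laws (displayed, `hN07`)**; **N08 = the (α)-AC residual (displayed, `hN08`)**; per door: N09 `h09` + `h09T` (⚑ EPSBG), N11 `h11N` (FLAG №1), N13 `h13pos` + `hEfl`, NODE O `hrowsR`; `0 < ε`.  OFF the bill: N07's bare leaf (now `⟨ζ.withSectE E, …⟩` by name), N08's bare slot (now n08-w4's theorem by name),
N06's bare leaf `h06` and its free `ops` (now N06's operators of record), N13's level 0, `logz`, N05's content, N06's five N05-side binders.

FLAG №14 «RECORD-ABELIAN» (director-ym №256).  Like p688041, this face reads N05 ∕ N06 ∕ N10 at the family dictionary `stage3OfFamily F`, whose coefficient algebra is `𝔸 := ℂ`: the N05∕N06-SLOT display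
`hN06` (its `(stage3OfFamily F).𝔸`-valued objects, the instance `FiniteDimensional ℝ (stage3OfFamily F).𝔸` supplied by `ℂ`) is an ABELIAN-INSTANCE-WITNESS reading per №256 (1)(c) until the
RECORD-NONABELIAN re-key lands (then one generator pass re-keys this face).  The N06 CERTIFICATE binders displayed here read the dictionary's GEOMETRY only (`d₆ ℓ₆ hd' hL' b₀ b₁`; the certificate's
signature has 0 occurrences of `θ.𝔸`) over print's cube class with coefficients `Matrix (Fin 2) (Fin 2) ℂ` ∕ `specialUnitaryUnits (Fin 2)` — SU(2) AS TYPED; no K-display movement is claimed either way.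

HONEST FRAMING.  Composition BY NAME (one `have` = one anonymous-constructor term per door; one `refine`; p688041's N05∕N06-slot proof); NO estimate of Bałaban's proved here; every family
DISPLAYED as a hypothesis (CONDITIONAL, audit `proof.conditional`) — in particular EVERY letter schema of N06's certificate REMAINS a displayed hypothesis about the genuine operators over
print's class, now on the K1 face instead of inside N06's lane; `Efl`, `ε` FREE; NOT a claim that the printed-z member IS K1⁹'s witness; NO v10 ∕ V21-G stub proved or closed; **N06 NOT
discharged** (no N06 «DISCHARGE CLAIMED» line exists; FLAG №8 open; dag-n06-d's editions continue; the chair books discharges on referee reads, R417); N05's discharge is R467's; N07 ∕ N08 NOT discharged (their displayed parts∕rows are hypotheses); N10 ∕ N11 ∕ N13 NOT discharged; N24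
COMPOSITE — no count moved (typed 28∕28 · discharged 7∕27 · A 7∕28); K0⁷ «V21-G 0∕2 (+2′)» ∕ K1⁹ stmt-QuantumFields-27364 (DECIDING; v10 0∕6, HARD FREEZE respected — Theorems side only) ∕
K3⁸ OPEN; one finite 𝕋⁴ programme at fixed ε, Bałaban AS PRINTED; R4 = the conditional finite-𝕋⁴ rung `BalabanLadder.UV` only — NOT continuum ∕ ℝ⁴ ∕ OS ∕ mass gap ∕ Clay: the Yang–Mills
mass gap is NOT proved by any of this.  `FiniteDimensional ℝ (stage3OfFamily F).𝔸` BY NAME from node00-def-RR-2's `Node00.finiteDimensional_𝔸_stage3OfFamily` (FLAG №14 T0(a), re-key-neutral).  No `sorry`, `def`, `instance`, `notation`.  Elaboration options as the certificate's own (`maxHeartbeats 800000`, `synthInstance.maxSize 2048`, `maxRecDepth 8192`).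
-/

noncomputable section

open scoped Matrix.Norms.L2Operator BigOperators
open Filter Topology MeasureTheory

namespace Summit.QuantumFields.YangMills.BalabanUVNodes.N24K1FaceTrN06OYN07N08JunctionLSlot8KappaPrimeAtGaussPinPrintedZYP

open Literature.MathematicalPhysics.QuantumFieldTheory.Balaban1983to89
open Literature.MathematicalPhysics.QuantumFieldTheory.Balaban1983to89.Node00
open DagBinding T4Continuum T4DatumAssembly FlowStepRuns AveragingRT
open FlowStep (HBeta RGEqH prefixOf prefixOf_apply BetaLowerH BetaUpperH Box mem_box clampPrefix Y)
open Literature.MathematicalPhysics.QuantumFieldTheory.Balaban1983to89.B8LeafModelZd (ZdIdx)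
open Literature.MathematicalPhysics.QuantumFieldTheory.Balaban1983to89.B8TowerBondsPrinted (towerBondsP)
open Literature.MathematicalPhysics.QuantumFieldTheory.Balaban1983to89.B9SupplySockB9P3ZdSrcPer (SrcAtIPer SrcHolderAtIH2Per)
open Literature.MathematicalPhysics.QuantumFieldTheory.Balaban1983to89.B9SupplySockB9P3ZdLetters (OpsZd)
open Literature.MathematicalPhysics.QuantumFieldTheory.Balaban1983to89.B9Eq327GreenZdHermPer (InvAtHIPer)
open Literature.MathematicalPhysics.QuantumFieldTheory.Balaban1983to89.B9SupplySockB9P3ZdPer (GlobAtIPer)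
open Literature.MathematicalPhysics.QuantumFieldTheory.Balaban1983to89.B9SupplySockB9P3ZdH2Per (HolderAtIH2Per holderAtIH2Per_anti)
open Literature.MathematicalPhysics.QuantumFieldTheory.Balaban1983to89.B9SupplySockB9P3ZdAllLettersZdPer (opsAllZdPer)
open T4TermwiseTorus (IsPeriodic)
open MatrixLog B7Prop2Explicit B7Prop1Local B7Eq92Concrete
open B8Ineq132 (InAk covDerivFwd)
open B8Eq119TwistedAxial (bgT)
open B8Eq140Level (SideTouches)
open B8Eq138LandauZd (covLap QT)
open B7Eq78Linearization (zdBlocking QprimeIter)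
open B8Eq1117Concrete (XSpace)
open B8Prop5ContractionKLevel (Bd2)
open B8LambdaSpaceKLevel (wt)
open Summit.QuantumFields.YangMills.Theorems.K0V19Defs (Prop8StepCoPAt AbsBetaBoxAtThm1WitnessCCMGenAt)
open Summit.QuantumFields.YangMills.Theorems.BalabanUVNodesN11GaussianCertificateDefs (gaussPinH)
open Summit.QuantumFields.YangMills.Theorems.BalabanUVNodesN11Sect3SupplyChainDefs (Sect3Supplier)
open Summit.QuantumFields.YangMills.Theorems.BalabanUVNodesN11Sect3SupplyChainObligationsDefs (SupplierObligations OperandRowsAlongChain)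
open Summit.QuantumFields.YangMills.Theorems.BalabanUVNodesN11K1WitnessGaussPinHAtZ (provisos₁₃SepCoPH_gaussPinH_theta13OfThm1CCMWZ_door)
open Summit.QuantumFields.YangMills.BalabanUVNodes.N05SubBP2DK2PerKappaSlotExistsOfBindersLettersPerDoorL (exists_residB8_slot8κ'_of_bindersLettersPer_doorL)
open Summit.QuantumFields.YangMills.BalabanUVNodes.N24K1R9ByNameOfOpenStubsGridGChildrenSplitSlot8Thm1AEPosAtGaussPinPrintedZYP (N24_stabilityBRunRowsAtRecordR13SepCoPHV_byName_of_openStubsGridG_of_childrenSplitSlot8N11OperandRowsThm1AEPos_atGaussPinPrintedZ_pinYP_of_runRowsCont)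
open Literature.MathematicalPhysics.QuantumFieldTheory.Balaban1983to89.T4Continuum (T4Family) open Literature.MathematicalPhysics.QuantumFieldTheory.Balaban1983to89.B9PinMembersKLevelV1 (MemberY geo9Y bg9Y) open Literature.MathematicalPhysics.QuantumFieldTheory.Balaban1983to89.B9PinGeometryKLevelV1 (dOmegaY OmKY inΛY unitDistY c35Y) open Literature.MathematicalPhysics.QuantumFieldTheory.Balaban1983to89.B7Prop2SpecialUnitary (specialUnitaryUnits specialUnitaryUnits_le_unitaryUnits) open Literature.MathematicalPhysics.QuantumFieldTheory.Balaban1983to89.B9Ineq347GAAtLetters (hGA_opsYOfLetters) open Literature.MathematicalPhysics.QuantumFieldTheory.Balaban1983to89.B9Ineq344LocalPairHolds (hGp_opsYOfLetters_holds) open Literature.MathematicalPhysics.QuantumFieldTheory.Balaban1983to89.B9Cor35ComparisonsGAAtLetters (hGA_e_opsYOfLetters hGA_h1_opsYOfLetters hGA_e4_opsYOfLetters hGA_h2_opsYOfLetters hGA_l2_opsYOfLetters) open Literature.MathematicalPhysics.QuantumFieldTheory.Balaban1983to89.B9CoReadingCoordsHolderAdm (holderProbesKA bond_h1ReadsNbr_of_pinsA)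 open Literature.MathematicalPhysics.QuantumFieldTheory.Balaban1983to89.B9CoReadingCoordsHolderAdmReadings (bond_coReadsHHolderNbr_of_pinsA bond_inputReadsFam_of_pinsA) open Literature.MathematicalPhysics.QuantumFieldTheory.Balaban1983to89.B9CoReadingCoordsHolderSAdm (holderProbesSA site_h1ReadsNbr_of_pinsSA) open Literature.MathematicalPhysics.QuantumFieldTheory.Balaban1983to89.B9CoReadingCoordsHolderSAdmReadings (site_inputReadsFam_of_pinsSA) open Summit.QuantumFields.YangMills.BalabanUVNodes.N06DirKinematicsAtPinsR (h36HA_of_dir_pinsR h36_of_dirSq_pinsR h36A_of_dirSq_pinsR) open Summit.QuantumFields.YangMills.BalabanUVNodes.N06DirKinematics3AtPinsR (h36H_of_dir_pins₃R) open Literature.MathematicalPhysics.QuantumFieldTheory.Balaban1983to89.B9RWSums346MixedFactorAtRecordClosed (MRec aRec BRec δRec) open Summit.QuantumFields.YangMills.BalabanUVNodes.N06CurrentMajAtPinsIdPhys (hBJ_of_pins_P) open Summit.QuantumFields.YangMills.BalabanUVNodes.N06AtOpsYNuOfRecordV6EPairOX (b9LeafXPR_opsYNuOfRecordV6E_pairOX)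 open Summit.QuantumFields.YangMills.BalabanUVNodes.N06PrintClassAxioms (printClass_axioms) open Literature.MathematicalPhysics.QuantumFieldTheory.Balaban1983to89.B9BackgroundsKLevelV1Pb (regYPb335 regYPb336) open Literature.MathematicalPhysics.QuantumFieldTheory.Balaban1983to89.B9WalkLettersOps (opsWalkY dirOpsWalkY dirLettersWalkY kappaWalkY thetaWalkY KcWalkY agreeWalkY) open Literature.MathematicalPhysics.QuantumFieldTheory.Balaban1983to89.B9WalkLettersOpsFacts (staticOK_opsWalkY bounded_kappaWalkY) open Summit.QuantumFields.YangMills.BalabanUVNodes.N06WalkLettersAtRecordR (localityDir_opsWalkY_of_agree identities₂_opsWalkY_of_reg335R) open Summit.QuantumFields.YangMills.BalabanUVNodes.N06XdYdLegAtPinsPhysPU (hXd_of_pinsP_geo9Y pYDH_of_pinsP_geo9Y) open Summit.QuantumFields.YangMills.BalabanUVNodes.N06DgLegAtPinsPhysPU (hκ13_of_pinsP dgDH_dgDHd_of_pinsP_geo9Y)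
open Literature.MathematicalPhysics.QuantumFieldTheory.Balaban1983to89.B9SmoothHolderClassP (bHZPG bHZKP bHZKPG) open Summit.QuantumFields.YangMills.BalabanUVNodes.N06WELegAtPinsPhysPUB (hκX_of_pinsP hWE_of_pinsP_geo9Y_budget) open Summit.QuantumFields.YangMills.BalabanUVNodes.N06Letters13LegAtPinsPhysPU (hletters13_of_pinsP8_geo9Y) open Summit.QuantumFields.YangMills.BalabanUVNodes.N06RgdH43LegAtPinsPhysPU (hrgdH_of_pinsP43_geo9Y) open Summit.QuantumFields.YangMills.BalabanUVNodes.N06L3131HLegAtPinsPhysPU (hL3131H_of_pinsP43_geo9Y) open Literature.MathematicalPhysics.QuantumFieldTheory.Balaban1983to89.B9SmoothHolderClassPProducers (CTel) open Literature.MathematicalPhysics.QuantumFieldTheory.Balaban1983to89.B6RandomWalkHom (HasMajorantHom) open Literature.MathematicalPhysics.QuantumFieldTheory.Balaban1983to89.B9Ineq349SiteThresholdRateNamed (thrM349 cg349 cg349_pos fineEntryS_le_named) open Literature.MathematicalPhysics.QuantumFieldTheory.Balaban1983to89.B9Thm39ReadingAtLetters (basis39 κ39) open Literature.MathematicalPhysics.QuantumFieldTheory.Balaban1983to89.B9MultiscaleSmoothPartitionYNear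 (rNear) open Literature.MathematicalPhysics.QuantumFieldTheory.Balaban1983to89.B9Thm313WholeDvHolderAtPinsGraded (thetaL CJG) open Literature.MathematicalPhysics.QuantumFieldTheory.Balaban1983to89.B9PlaquetteBinderOfReg335Y (plaqV_binder_of_regYR_budget_SU budget_nonneg) open Literature.MathematicalPhysics.QuantumFieldTheory.Balaban1983to89.B9SectDSup (weightNorm) open Literature.MathematicalPhysics.QuantumFieldTheory.Balaban1983to89.B9MultiscaleSmoothPartitionYLip (CLip) open Literature.MathematicalPhysics.QuantumFieldTheory.Balaban1983to89.B9GradViaDivLettersTransported (taxiS taxiB) open Literature.MathematicalPhysics.QuantumFieldTheory.Balaban1983to89.B9OpsRTransport (ops312RY) open Literature.MathematicalPhysics.QuantumFieldTheory.Balaban1983to89.B9Ineq349SiteFacesAtLettersR (s349_site_of_t37_display348_of_R) open Literature.MathematicalPhysics.QuantumFieldTheory.Balaban1983to89.B9Eq3132FacesAtLettersR (s3132Nu_opsYSectE_of_step12_R_of_refinesY) open Literature.MathematicalPhysics.QuantumFieldTheory.Balaban1983to89.B9Thm314Thm315LayerR (thm314_pair_layerOfLettersR) open Literature.MathematicalPhysics.QuantumFieldTheory.Balaban1983to89.B9Eq335ClassBridgePV1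 (regY335_of_regYP335 regY336_of_regYP336) open Literature.MathematicalPhysics.QuantumFieldTheory.Balaban1983to89.B9BackgroundsKLevelV1P (bg9YP) open Summit.QuantumFields.YangMills.BalabanUVNodes.N06ProbeZeroAtPinsPhysR (hX0_of_pinsR) open Summit.QuantumFields.YangMills.BalabanUVNodes.N06MixedLegAtPinsPhysR (l2MixedLegs37_of_pinsR) open Summit.QuantumFields.YangMills.BalabanUVNodes.N06MixedFactorAtPinsPhysR (h36H_with_factor_of_pinsR) open Summit.QuantumFields.YangMills.BalabanUVNodes.N06SplitMajorantsAtPinsPhysR (split_majorants_of_letter_schemasR) open Summit.QuantumFields.YangMills.BalabanUVNodes.N06StepL2AtPinsPhysR (stepL2_of_letter_schemas_residualR)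
open Summit.QuantumFields.YangMills.BalabanUVNodes.N06HgVacuousRC (hg_obligation_vacuousRC) open Summit.QuantumFields.YangMills.BalabanUVNodes.N06Thm312313AtPinsPairMBCZcRCU (t312_t313_of_pins_pairMBCZc_physRCU) open Literature.MathematicalPhysics.QuantumFieldTheory.Balaban1983to89.B9Thm39FacesAtLettersRC (t39_hksum_oneCube_opsYOfLetters_FRC) open Literature.MathematicalPhysics.QuantumFieldTheory.Balaban1983to89.B9Thm39PureGaugeClassAtLettersR (oneCubeOps39YFR) open Literature.MathematicalPhysics.QuantumFieldTheory.Balaban1983to89.B9Thm311Thm315FacesAtLettersR (t311_of_pins_opsYOfLettersR t315_opsYSectE_of_3185_onR) open Literature.MathematicalPhysics.QuantumFieldTheory.Balaban1983to89.B9BackgroundsKLevelV1R (RegFamY MemOfFam mem_of_reg335R bg9YR regYP335 regYP336 regYP335_one kernelFamilyR kernelFamilyRY siteKernelR hKernelR rwExpansionR rwKernelExpansionR fineKernelR) open Literature.MathematicalPhysics.QuantumFieldTheory.Balaban1983to89.B9LeafXClassAntitone (ClassIncl residualGpAtOne_R residualGAGlobAtOne_R rwSumsYieldIneqs_R rwKernelSumYields_R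 thm37Printed_antitone cor38Printed_antitone thm39Printed_antitone thm310Printed_antitone thm311Printed_antitone thm312Printed_antitone thm313Printed_antitone thm314Printed_antitone thm315FullPrinted_antitone stmt349Printed_antitone stmt3132Printed_antitone thm314LocalPrinted_antitone) open Literature.MathematicalPhysics.QuantumFieldTheory.Balaban1983to89.B9PinCarriersKLevelV1R (b9LeafX_carriersYR b9LeafX_carriersYP_iff) open Literature.MathematicalPhysics.QuantumFieldTheory.Balaban1983to89.B9PinCarriersKLevelV1P (carriersYP) open Literature.MathematicalPhysics.QuantumFieldTheory.Balaban1983to89.B9PinGeometryKLevelV1B (c35B c35B_pos ten_L3_le_c35B ten_L4_le_c35B c35Y_le_ten) open Literature.MathematicalPhysics.QuantumFieldTheory.Balaban1983to89.DagBinding (B9LeafX) open Summit.QuantumFields.YangMills.BalabanUVNodes.N06Ids3152AtPinsPhys (ids3124_ids3152_of_hZ_pins) open Literature.MathematicalPhysics.QuantumFieldTheory.Balaban1983to89.Node00.OpsYNablaBridge (cf_mul_etaS_of_hcfk) open Literature.MathematicalPhysics.QuantumFieldTheory.Balaban1983to89.B9Cor35ComparisonsGpCAtLetters (hGp_e_opsYOfLetters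 hGp_h1_opsYOfLetters hC_opsYOfLetters) open Literature.MathematicalPhysics.QuantumFieldTheory.Balaban1983to89.B9Cor35ComparisonsEH (hE4_of_hGA_e4 hH2_of_hGA_h2) open Literature.MathematicalPhysics.QuantumFieldTheory.Balaban1983to89.B9GeoLemma21KLevelV1 (geo9Y_len_pos) open Literature.MathematicalPhysics.QuantumFieldTheory.Balaban1983to89.B9Thm311Whole (PosDefOfOps) open Literature.MathematicalPhysics.QuantumFieldTheory.Balaban1983to89.B9Thm39WholeBlk (Conv348Blk) open Literature.MathematicalPhysics.QuantumFieldTheory.Balaban1983to89.B9Thm39WholeBlkViaDatum (EK39OfOpsBlkVia) open Literature.MathematicalPhysics.QuantumFieldTheory.Balaban1983to89.B9Thm39ReadingFaithful (repSite39F)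
open Literature.MathematicalPhysics.QuantumFieldTheory.Balaban1983to89.B9Thm39OneCubeReadingAtLettersY (oneCubeOps39YF oneCubeReading39) open Literature.MathematicalPhysics.QuantumFieldTheory.Balaban1983to89.B9RowSum261DefiniteFaces (rowConst261) open Literature.MathematicalPhysics.QuantumFieldTheory.Balaban1983to89.B9Thm312Whole (GeoOK FormSmall HasRWExpOfOps HasRWExpHOfOps PosDefKOfOps cNorm PosDefEnd) open Literature.MathematicalPhysics.QuantumFieldTheory.Balaban1983to89.B11SectG (BlockNorm HasMaj) open Literature.MathematicalPhysics.QuantumFieldTheory.Balaban1983to89.B9GeoNormsKLevelV1 (geo9K_dist_nonneg) open Literature.MathematicalPhysics.QuantumFieldTheory.Balaban1983to89.B9GeoLemma21KLevelV1 (geo9Y_dist_triangle geo9Y_dist_comm) open Literature.MathematicalPhysics.QuantumFieldTheory.Balaban1983to89.B9GeoNormsKLevelModelSignsV1 (modelSignsOn_geo9K) open Literature.MathematicalPhysics.QuantumFieldTheory.Balaban1983to89.B9Thm34Ext (toB6) open Literature.MathematicalPhysics.QuantumFieldTheory.Balaban1983to89.B9CoRealizesRelAtLetters (RelB maj342_relB_left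 maj342_relB_right dist_eq_of_relB len_eq_of_relB relB_refl) open Literature.MathematicalPhysics.QuantumFieldTheory.Balaban1983to89.B9SectCDiffDict (maj342) open Literature.MathematicalPhysics.QuantumFieldTheory.Balaban1983to89.B6Ineq2142KLevelV1 (β) open Literature.MathematicalPhysics.QuantumFieldTheory.Balaban1983to89.B9CarrierBlockMultiplicity (card_sameCarrier_le_kIdx) open Literature.MathematicalPhysics.QuantumFieldTheory.Balaban1983to89.B9Thm311ReadingAtLetters (ops311Y) open Literature.MathematicalPhysics.QuantumFieldTheory.Balaban1983to89.B9Thm311ReadingCoords (PosDefTr) open Literature.MathematicalPhysics.QuantumFieldTheory.Balaban1983to89.B9PinGeometryKLevelV1 (kLab) open Literature.MathematicalPhysics.QuantumFieldTheory.Balaban1983to89.B9Thm314GpFlatTorusGeometry (tdistK OmegaC) open Literature.MathematicalPhysics.QuantumFieldTheory.Balaban1983to89.B9Thm314WholePinGeometry (locDataY) open Literature.MathematicalPhysics.QuantumFieldTheory.Balaban1983to89.B9Thm314WholePair (locData₂) open Literature.MathematicalPhysics.QuantumFieldTheory.Balaban1983to89.B9Thm314WholePairWalks (pairWalkSets) open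 Literature.MathematicalPhysics.QuantumFieldTheory.Balaban1983to89.B9Thm314WholeSummation (WalkSetsSpec WalkWeightsSummable) open Literature.MathematicalPhysics.QuantumFieldTheory.Balaban1983to89.B9SectCWalkTermsAllNorms (Thm310AllNormsPrinted) open Literature.MathematicalPhysics.QuantumFieldTheory.Balaban1983to89.B9Thm314WholeExpansionReads (ExpansionReads) open Literature.MathematicalPhysics.QuantumFieldTheory.Balaban1983to89.B9Thm314WholeCancellationLayer (pairOp) open Literature.MathematicalPhysics.QuantumFieldTheory.Balaban1983to89.B9Thm37Whole (Ops Sizes StaticOK Local342) open Literature.MathematicalPhysics.QuantumFieldTheory.Balaban1983to89.B9Cor38Whole (WalkReading)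
open Literature.MathematicalPhysics.QuantumFieldTheory.Balaban1983to89.B9Thm310Whole (Ops310 WalkReading310 Sizes310 StaticOK310 Locality310 Local342G) open Literature.MathematicalPhysics.QuantumFieldTheory.Balaban1983to89.B9Thm310WholeDir (DirLetters310 Identities310₂) open Literature.MathematicalPhysics.QuantumFieldTheory.Balaban1983to89.B9RWSumsDefinitePins (PinPrims) open Literature.MathematicalPhysics.QuantumFieldTheory.Balaban1983to89.B9RWSumsDefinitePinsPair (PairPrims) open Literature.MathematicalPhysics.QuantumFieldTheory.Balaban1983to89.B9RWSumsDefinitePinsPairM (MixedPrims E310YPairM) open Literature.MathematicalPhysics.QuantumFieldTheory.Balaban1983to89.B9RWSumsDefinitePinsPairMDir (E37YPairMDir) open Literature.MathematicalPhysics.QuantumFieldTheory.Balaban1983to89.B9RWSumsDefinitePinsPairMDir3Rows (rows131819_definite_geo9Y_pairM_dir₃) open Literature.MathematicalPhysics.QuantumFieldTheory.Balaban1983to89.B9Thm37WholeDir (DirLetters37 Identities₂) open Literature.MathematicalPhysics.QuantumFieldTheory.Balaban1983to89.B9Cor38WholeDir (LocalityDir) open Literature.MathematicalPhysics.QuantumFieldTheory.Balaban1983to89.B9Thm37KLetterDir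 (HolderV37Dir FactorsInputPair37Dir) open Literature.MathematicalPhysics.QuantumFieldTheory.Balaban1983to89.B9RWSums344InputFam (InputReadsFam sliceProbe) open Literature.MathematicalPhysics.QuantumFieldTheory.Balaban1983to89.B9RWSums344InputPair (InputLegsPair37 InputLegsPair310 FactorsInputPair310) open Literature.MathematicalPhysics.QuantumFieldTheory.Balaban1983to89.B9RWSums346MixedPair (L2MixedLegs310 FactorsL2Mixed310) open Literature.MathematicalPhysics.QuantumFieldTheory.Balaban1983to89.B9CoReadingCoordsTranspose (TrIdx trBasis isTransposePair_GcoK_trBasis isTransposePair_DcoK_GcoK_trBasis isTransposePair_GcoS_trBasis isTransposePair_DcoS_GcoS_trBasis) open Literature.MathematicalPhysics.QuantumFieldTheory.Balaban1983to89.B9Thm311SymmAtRecordV4 (symm0_parSymY symmG_parSymY) open Literature.MathematicalPhysics.QuantumFieldTheory.Balaban1983to89.B9Thm311AdjointPairs (GpY_isSymmTr) open Literature.MathematicalPhysics.QuantumFieldTheory.Balaban1983to89.B9RWSums346SecondDiff (familyOp DirOps310 L2SecondLegs310) open Literature.MathematicalPhysics.QuantumFieldTheory.Balaban1983to89.B9RWSums346SecondDiffGp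 (DirOps37 L2SecondLegs37) open Literature.MathematicalPhysics.QuantumFieldTheory.Balaban1983to89.B9Thm37Glue (IsTransposePair) open Literature.MathematicalPhysics.QuantumFieldTheory.Balaban1983to89.B9RWSumsReadsNbr (H1ReadsNbr) open Literature.MathematicalPhysics.QuantumFieldTheory.Balaban1983to89.B9RWSums346Two (L2TwoLegs310 FactorsL2_310) open Literature.MathematicalPhysics.QuantumFieldTheory.Balaban1983to89.B9RWSums343Holder (HolderProbes HolderLegs310 FactorsHolder310) open Literature.MathematicalPhysics.QuantumFieldTheory.Balaban1983to89.B9RWSums343HolderGp (HolderLegs37) open Literature.MathematicalPhysics.QuantumFieldTheory.Balaban1983to89.B9Thm39ReadingCoords (cR39)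
open Literature.MathematicalPhysics.QuantumFieldTheory.Balaban1983to89.B9CoReadingCoords (XBK evBK blkBK GcoK DcoK DscoK LcoK coordOpK cdBₗ cdsBₗ) open Literature.MathematicalPhysics.QuantumFieldTheory.Balaban1983to89.B9CoReadingCoordsS (XSK evSK blkSK sIK sIK_faithful GcoS DcoS DscoS LcoS) open Literature.MathematicalPhysics.QuantumFieldTheory.Balaban1983to89.B9CoReadingCoordsL2S (sIK_dist_le_one site_l2ReadsNbr012_of_pins site_l2ReadsNbr345_of_pins) open Literature.MathematicalPhysics.QuantumFieldTheory.Balaban1983to89.B9CoReadingCoordsL2Pair (bond_l2ReadsNbr345_of_pins) open Literature.MathematicalPhysics.QuantumFieldTheory.Balaban1983to89.B9Ineq349SiteComposite (cdSL cdsSL) open Literature.MathematicalPhysics.QuantumFieldTheory.Balaban1983to89.B9Thm312WholeL2 (StepL2) open Literature.MathematicalPhysics.QuantumFieldTheory.Balaban1983to89.B9Thm312WholeHHolderNbr (CoReadsHHolderNbr) open Literature.MathematicalPhysics.QuantumFieldTheory.Balaban1983to89.B9Thm311ReadingCoords (IsSymmTr) open Summit.QuantumFields.YangMills.BalabanUVNodes.N06CoReadingsOfPins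 (bond_coReadings3_of_pins bond_coReadingsLap_of_pins site_coReadings4_of_pins bond_l2ReadsNbr3_of_pins) open Literature.MathematicalPhysics.QuantumFieldTheory.Balaban1983to89.B6Geom246MultiLevelTorus (geomT) open Literature.MathematicalPhysics.QuantumFieldTheory.Balaban1983to89.B9Eq3132NuReading (opsYS349NuOfLetters) open Literature.MathematicalPhysics.QuantumFieldTheory.Balaban1983to89.B9GeoNbrCountKLevelV1 (nbrM₀Y nbrCountY hnbr_two_of_le) open Literature.MathematicalPhysics.QuantumFieldTheory.Balaban1983to89.B9CoReadingCoordsH (XHK blkHK HcoK) open Literature.MathematicalPhysics.QuantumFieldTheory.Balaban1983to89.B6GlobalChartV1 (blkV1) open Literature.MathematicalPhysics.QuantumFieldTheory.Balaban1983to89.B6Ineq2142KLevelV1 (lvl) open Literature.MathematicalPhysics.QuantumFieldTheory.Balaban1983to89.B9Thm315WholeSectERepOn (DecayMidOnY) open Literature.MathematicalPhysics.QuantumFieldTheory.Balaban1983to89.B9Thm314WholePinGeometry (locDataY_laws) open Literature.MathematicalPhysics.QuantumFieldTheory.Balaban1983to89.B9PinGeometryKLevelV1 (dOmegaY_nonneg)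 open scoped Matrix.Norms.L2Operator open Summit.QuantumFields.YangMills.BalabanUVNodes.N06Proj349AtPinsPhysRC (proj349Maj_of_t37_display348_rateR_ge cP349_nonneg) open B9Eq346GradGpDivAtPinsL2Closed (M46 a46 B46 δ46 M46_pos a46_pos B46_pos blockBd_DvGcoSDvs_memberY_at) open B9PerturbationL2Delta2 (D2coK constL2Pi constL2Pi_nonneg) open Literature.MathematicalPhysics.QuantumFieldTheory.Balaban1983to89.B9PerturbationL2Letters (constL2 constL2_nonneg) open Summit.QuantumFields.YangMills.BalabanUVNodes.N06SectDUnitsAtPinsPhys (isUnit_deltaPiAY_of_formSmall_phys isUnit_deltaOneY_of_formSmall_phys posDefEnd_S0coK_of_posDefTr_phys posDefTr_deltaOneY_of_formSmall_pins_phys identitiesDef_of_pins_phys isUnit_deltaAY_phys_of_posDefTr)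
open Literature.MathematicalPhysics.QuantumFieldTheory.Balaban1983to89.B9Thm313WholeLettersCut (Letters313HZc Letters313L2Pc) open Literature.MathematicalPhysics.QuantumFieldTheory.Balaban1983to89.B9Thm313WholeRgdFrom3152 (Ids3152) open Literature.MathematicalPhysics.QuantumFieldTheory.Balaban1983to89.B9Thm312WholeHZ (LettersHZ) open Literature.MathematicalPhysics.QuantumFieldTheory.Balaban1983to89.B9SectDSup (weightNorm) open Literature.MathematicalPhysics.QuantumFieldTheory.Balaban1983to89.B9Thm313WholeLeftZ (Letters313DZ) open Literature.MathematicalPhysics.QuantumFieldTheory.Balaban1983to89.B9Thm313WholeDirZ (Letters313DMZ) open Literature.MathematicalPhysics.QuantumFieldTheory.Balaban1983to89.B9Thm313WholeHolderZ (Letters313HZ) open Literature.MathematicalPhysics.QuantumFieldTheory.Balaban1983to89.B9Thm313WholeDirL2Z (Letters313L2MZ) open Literature.MathematicalPhysics.QuantumFieldTheory.Balaban1983to89.B9LettersHZAtOne (plateau_pos) open Literature.MathematicalPhysics.QuantumFieldTheory.Balaban1983to89.B9Thm313WholeDirInputBC (Letters313IMBC Letters313IML letters313IMBC_of_IML) open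 Literature.MathematicalPhysics.QuantumFieldTheory.Balaban1983to89.B9CoReadingCoordsInputLoc (vanishX_bHK_pins leX_bHK_pins) open Literature.MathematicalPhysics.QuantumFieldTheory.Balaban1983to89.B9Thm312WholeClasses (cNormR) open Literature.MathematicalPhysics.QuantumFieldTheory.Balaban1983to89.B9PerturbationSplitAtLetters (TaLcoK TbLcoKH Ta2LcoK Tb2LcoKH TaRcoK TbRcoKH Ta2RcoK Tb2RcoKH letters3131_of_pins_of_maj letters3131R_of_pins_of_maj) open Literature.MathematicalPhysics.QuantumFieldTheory.Balaban1983to89.B9CoReadingCoordsHolder (PK) open Literature.MathematicalPhysics.QuantumFieldTheory.Balaban1983to89.B9CoReadingCoordsInput (bHK) open Literature.MathematicalPhysics.QuantumFieldTheory.Balaban1983to89.B9CoReadingCoordsInputS (bHS) open Summit.QuantumFields.YangMills.BalabanUVNodes.N06G0LayerFromThm310GU (g0_layer_of_thm310_coreDir₃U) open Summit.QuantumFields.YangMills.BalabanUVNodes.N06StepDirLayerAtPinsBCZXDsU (stepDirB_layer_of_lettersCZXDsU) open Summit.QuantumFields.YangMills.BalabanUVNodes.N06DivLegAtPinsPhysR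 (hdivDs_of_pinsR) open Summit.QuantumFields.YangMills.BalabanUVNodes.N06HHLegAtPinsPhysRU (hLHH_of_pinsRU) open Summit.QuantumFields.YangMills.BalabanUVNodes.N06CutL2LettersAtPinsPhys (letters313L2MZ_mono_const) open Summit.QuantumFields.YangMills.BalabanUVNodes.N06CutL2LettersAtPinsPhysR (vDRDG_vGDRD_of_pinsR) open Literature.MathematicalPhysics.QuantumFieldTheory.Balaban1983to89.B9Thm313WholeLettersCutKept (Letters313L2Pk Letters313L2Pc.of_kept) open Summit.QuantumFields.YangMills.BalabanUVNodes.N06ProbeZeroAtPinsPhys (cX0_nonneg) open Summit.QuantumFields.YangMills.BalabanUVNodes.N06MixedLegAtPinsPhys (hcntM_of_walkCnt) open Summit.QuantumFields.YangMills.BalabanUVNodes.N06Row17FromRow19LettersDir (row17_of_row19_letters₂)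
open Literature.MathematicalPhysics.QuantumFieldTheory.Balaban1983to89.B9WalkLettersCoordsS (SblkY hWalkY gsqcoS walkCntM₀Y walkCntY nearBlkCntY) open Literature.MathematicalPhysics.QuantumFieldTheory.Balaban1983to89.B6Cover236MultiLevelBlocks (cubes) open Literature.MathematicalPhysics.QuantumFieldTheory.Balaban1983to89.B9Eq346MixedLegAtPinsL2Closed (MMix aMix BMix δMix) open Literature.MathematicalPhysics.QuantumFieldTheory.Balaban1983to89.B9Thm39ReadingCoords (coordBound39 basisBound39) open Literature.MathematicalPhysics.QuantumFieldTheory.Balaban1983to89.B9Thm31GpMajFromPinsPairMR (thm31GpMaj_of_t37_pairMR) open Literature.MathematicalPhysics.QuantumFieldTheory.Balaban1983to89.B9PerturbationMajorantLetters (const3131) open Literature.MathematicalPhysics.QuantumFieldTheory.Balaban1983to89.B9RowSum261DefiniteFaces (rowConst261) open Literature.MathematicalPhysics.QuantumFieldTheory.Balaban1983to89.B9Thm312WholeRightStepFrom3131 (Letters3131R) open Literature.MathematicalPhysics.QuantumFieldTheory.Balaban1983to89.B9Thm312WholeStepFrom3131 (Letters3131) open Literature.MathematicalPhysics.QuantumFieldTheory.Balaban1983to89.B9Thm312WholeLeftStepFrom3131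 (Letters3131H) open Literature.MathematicalPhysics.QuantumFieldTheory.Balaban1983to89.B9Thm312WholeIdentitiesSplit (Ids3124 identities_of_def_3124) open Literature.MathematicalPhysics.QuantumFieldTheory.Balaban1983to89.Node00.OpsYSectDCoords (S0coK TpicoK T2coK QcoKH QscoKH CcoK C1coK DvcoKH DvscoKH RcoK GcoK_GAY_mul_S0coK cR39_trBasis_pos) open Literature.MathematicalPhysics.QuantumFieldTheory.Balaban1983to89.B9Thm311ReadingCoords (isUnit_of_posDefTr)
open Summit.QuantumFields.YangMills.BalabanUVNodes.N06AtOpsYNuOfRecordV6EPairOY (b9LeafXP10_opsYNuOfRecordV6E_pairOY)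

set_option maxHeartbeats 800000 in set_option synthInstance.maxSize 2048 in set_option maxRecDepth 8192 in
/-- **★★★★ THE K1-FACE N06 LEAF JUNCTION, EDITION «Tr» (print's trace state `(τ, C_τ)` on `(stage3OfFamily F).𝔸 = M₂(ℂ)` OFF the displayed N05∕N06 slot — fed by NODE 00's `exists_traceState_stage3OfFamily` BY NAME) — K1⁹ `StabilityBRunRowsAtRecordR13SepCoPHV` (stmt-QuantumFields-27364) BY ITS ROUTE NAME on the V21-G ∕ Gauss-pin slot road at the witness slot
of record `Slot8κ′`, at the Z member with `logz := log z(g_j², ε)` ([I] (0.15), door-wise), N05 read through ζ-L BY NAME with N06's five N05-side binders consumed η-free (p688041 VERBATIM),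
AND NODE N06's LEAF CONSUMED BY dag-n06-d's STAGE-11 CERTIFICATE `b9LeafXP10_opsYNuOfRecordV6E_pairOY` BY NAME**: `h06` is REPLACED by the certificate's 316 binders (after `θ hθ`), VERBATIM with
`N := 2`, `θ.toStage3Params ∕ θ.d₆ ∕ θ.ℓ₆ ∕ θ.hd' ∕ θ.hL' ∕ θ.b₀ ∕ θ.b₁ ↦ (stage3OfFamily F)…`, Skolemised in `F` (instance binders named `instN06_1…5`; inner indices `p q ↦ pᵢ qᵢ` in
`near14₁∕₂`); at each door the leaf `∃ M⋆ ops, B9LeafX (Y9OfRecordP 2 (θZπ).toStage3Params M⋆ ops)` is the term `⟨Mstar F, _, @b9LeafXP10_opsYNuOfRecordV6E_pairOY 2 _ F θ₁₁ hθ₁₁ (Mstar F) …⟩` with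
`θ₁₁ := (θZπ).toStage12Params.toStage11 F 2 ⟨0, 0, 0⟩`, `hθ₁₁ := (admissible_theta13OfThm1CCMWZ_of_le_half …).toStage12.toStage11 _` (`(θZπ).toStage3Params = stage3OfFamily F` is `rfl`).
N06's operators `ops := opsYNuOfRecordV4PE 2 (stage3OfFamily F) (Mstar F) (𝔯 F) (sectEYOfRecordV6 2 (stage3OfFamily F) (Mstar F) (𝔢₀ F)) (𝔴 F) (𝔈 F)` are thereby PINNED to N06's record. ALSO (as p701900): `h07` is REPLACED by `hN07` (NODE 00's Sect.-E presentation of the [B11] group at print's letters + the six remaining printed parts + bridges∕laws, per `F`) and fed by `⟨ζ.withSectE E, CarriersZSectE.b11Leaf_Z11OfRecord_withSectE_of_parts …⟩`; `h08` is REPLACED by `hN08` (N08's (α)-AC residual per `F`) and fed by dag-n08-w4's `printedUV3V_at_slotOfRecord_of_coreLTAtAC_of_massBoundZAE_of_consts` at `N := 2, L := F.L`.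
CONDITIONAL (every family displayed; audit `proof.conditional`); not a closure; NO v10 ∕ V21-G stub used as proved or closed; N06 NOT discharged by this file (no N06 claim line exists;
the chair books, R417); N05's discharge is R467's; N10 ∕ N11 ∕ N13 NOT discharged; no count moved.
[cite: Balaban1985BackgroundPropagators, Thms 3.1–3.15 pp.397–432, (3.40)–(3.47) pp.397–398, (3.87)–(3.90) pp.408–409, (3.117)–(3.121) p.419; Balaban1985RegularSpaces, Lemma 1 p.79 – Thm 8 p.101, Prop. 5 p.94, Prop. 6 p.99; Balaban1989LargeFieldII, Thm 1 p.355, (0.1) pp.355–356, (0.15) p.360; Balaban1988Convergent, Theorem p.245, Cor. 3 (2.50) p.264, (3.16)–(3.25) pp.268–270; Balaban1987RG1, (0.14)–(0.17) pp.254–255, Thm 3 p.264, §1 pp.263–264; Balaban1988RG2Cluster, Lemmas 1–3 pp.9–20; Balaban1985Variational, Thm 1 p.279, Props 2–9 pp.281–309, Sect. E (111)–(121) pp.293–296; Balaban1985UV3, Thm 1 p.257, Thm 2 p.272, (41) p.266 (bookkeeping)] -/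
theorem N24_stabilityBRunRowsAtRecordR13SepCoPHV_byName_of_openStubsGridG_of_n06TorusDataLettersLSlot8KappaPrime_n06CertificateOY_n07PartsSectE_n08ResidualAC_trM2_stage3DoorFree_n13LevelZero_atGaussPinPrintedZ_pinYP_of_runRowsCont (M₁ R : ℕ) (hM₁ : 1 ≤ M₁) (ε : ℝ) (hεz : 0 < ε)
    (Efl : T4Family → ℕ → ℝ → ℝ → ℝ → ℝ → ℝ → ℝ → ℝ → B12.RunParams → ℕ → ℝ)
    (h1G3 : ∀ F : T4Family, ∃ (c c₀ c₁ : ℕ) (B₃ a₀ a₁ : ℝ), 2 * (F.L : ℝ) ^ 2 ≤ B₃ ∧ 0 < a₀ ∧ 0 < a₁ ∧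
      Prop8RegSepTopStepG F 2 (fun ν K Ω => suppDomOfRecord F ν K Ω) (fun ν M g K k _s => c ≤ ν.M₁ ∧ k + c₀ ≤ F.m + K ∧ F.L ^ c₁ ∣ M ∧
      ∀ i, 1 ≤ i → i ≤ k → dCubeSide (F.P K).L M (RkOfRecord (F.P K).L ν.r (g i)) i ∣ (F.P K).sitesPerDir 0) B₃ a₀ a₁)
    (h3A'G3 : ∀ F : T4Family, ∀ (j c c₀ c₁ : ℕ) (B₃ B₃' a₀ a₁ : ℝ), c ≤ F.L ^ j → c₀ ≤ j + 1 → c₁ ≤ j → 2 * (F.L : ℝ) ^ 2 ≤ B₃ → 0 < B₃' → 0 < a₀ → 0 < a₁ →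
      VariationalThm1RegSepCoP7MG F 2 (fun ν M g K k _s => c ≤ ν.M₁ ∧ k + c₀ ≤ F.m + K ∧ F.L ^ c₁ ∣ M ∧
      ∀ i, 1 ≤ i → i ≤ k → dCubeSide (F.P K).L M (RkOfRecord (F.P K).L ν.r (g i)) i ∣ (F.P K).sitesPerDir 0) B₃ a₀ a₁ →
      Gauge9RegSepTopStepG F 2 (fun ν K Ω => suppDomOfRecord F ν K Ω) (F.L ^ j) (fun ν M g K k _s => c ≤ ν.M₁ ∧ k + c₀ ≤ F.m + K ∧ F.L ^ c₁ ∣ M ∧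
      ∀ i, 1 ≤ i → i ≤ k → dCubeSide (F.P K).L M (RkOfRecord (F.P K).L ν.r (g i)) i ∣ (F.P K).sitesPerDir 0) B₃ B₃' a₀ a₁ →
      ∃ γ₀ ε₀ ε₂₉ β' : ℝ, 0 < γ₀ ∧ 0 < ε₀ ∧ 0 < ε₂₉ ∧
        BetaLowerH (-β') γ₀ (betaOfRecord₁₃ F 2 (theta13OfThm1CCM F 2 j ε₀ ε₂₉ B₃ B₃' a₀ a₁)) ∧
        BetaUpperH β' γ₀ (betaOfRecord₁₃ F 2 (theta13OfThm1CCM F 2 j ε₀ ε₂₉ B₃ B₃' a₀ a₁)))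
    -- N05∕N06 SLOT (per F): print's trace state `(τ, C_τ)` is OFF this display since edition «Tr» — a THEOREM at the record algebra `(stage3OfFamily F).𝔸 = M₂(ℂ)` (NODE 00 `Record12NumericsFamilyTraceState`), fed in the proof
    (hN06 : ∀ (F : T4Family) [FiniteDimensional ℝ (stage3OfFamily F).𝔸],
      ∃ (β : ℝ) (len : B7Prop1Explicit.Site (stage3OfFamily F).D → ℝ) (B₀'H B₂' BG BR cL : ℝ),
        0 ≤ β ∧ (∀ v : B7Prop1Explicit.Site (stage3OfFamily F).D, 0 < len v → 1 ≤ len v) ∧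
        0 < B₀'H ∧ 0 ≤ B₂' ∧ 0 ≤ BG ∧ 0 ≤ BR ∧ 0 < cL ∧
        (∀ a : IdxB8SubDPerκ (stage3OfFamily F) (M₁ * (stage3OfFamily F).L) M₁ R, ∀ α₀ : ℝ, 0 < α₀ → α₀ ≤ cL → ∀ U₀ : B7Prop1Explicit.Site (stage3OfFamily F).D → Fin (stage3OfFamily F).D → (stage3OfFamily F).𝔸ˣ, (∀ x κ, U₀ x κ ∈ unitaryUnits (stage3OfFamily F).𝔸) → IsPeriodic (M₁ * (stage3OfFamily F).L) U₀ →
      InAk (stage3OfFamily F).L a.toZdIdx.k a.toZdIdx.η α₀ a.toZdIdx.Ω U₀ → ∀ n, 1 ≤ n → n ≤ a.toZdIdx.k →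
      ∃ (g Δ : (B7Prop1Explicit.Site (stage3OfFamily F).D → (stage3OfFamily F).𝔸) →ₗ[ℂ] (B7Prop1Explicit.Site (stage3OfFamily F).D → (stage3OfFamily F).𝔸)) (q : (B7Prop1Explicit.Site (stage3OfFamily F).D → (stage3OfFamily F).𝔸) →ₗ[ℂ] (ℕ → B7Prop1Explicit.Site (stage3OfFamily F).D → (stage3OfFamily F).𝔸)) (qs : (ℕ → B7Prop1Explicit.Site (stage3OfFamily F).D → (stage3OfFamily F).𝔸) →ₗ[ℂ] (B7Prop1Explicit.Site (stage3OfFamily F).D → (stage3OfFamily F).𝔸))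
        (Aw c : (ℕ → B7Prop1Explicit.Site (stage3OfFamily F).D → (stage3OfFamily F).𝔸) →ₗ[ℂ] (ℕ → B7Prop1Explicit.Site (stage3OfFamily F).D → (stage3OfFamily F).𝔸)) (H' : XSpace (stage3OfFamily F).D n (stage3OfFamily F).𝔸 →ₗ[ℂ] (B7Prop1Explicit.Site (stage3OfFamily F).D → (stage3OfFamily F).𝔸)),
        (∀ x, (∀ (z : B7Prop1Explicit.Site (stage3OfFamily F).D) (i : Fin (stage3OfFamily F).D), x (z + ((M₁ * (stage3OfFamily F).L) : ℤ) • B7Prop1Explicit.e i) = x z) → ∀ y ∈ a.toZdIdx.Ω 0, (Δ (g x) + qs (Aw (q (g x)))) y = x y) ∧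
        (∀ f, (∀ (z : B7Prop1Explicit.Site (stage3OfFamily F).D) (i : Fin (stage3OfFamily F).D), f (z + ((M₁ * (stage3OfFamily F).L) : ℤ) • B7Prop1Explicit.e i) = f z) → q (g (g (qs (c (q f))))) = q f) ∧
        (∀ (f : B7Prop1Explicit.Site (stage3OfFamily F).D → (stage3OfFamily F).𝔸) (z : B7Prop1Explicit.Site (stage3OfFamily F).D) (i : Fin (stage3OfFamily F).D), g f (z + ((M₁ * (stage3OfFamily F).L) : ℤ) • B7Prop1Explicit.e i) = g f z) ∧
        (∀ f : B7Prop1Explicit.Site (stage3OfFamily F).D → (stage3OfFamily F).𝔸, (∀ (z : B7Prop1Explicit.Site (stage3OfFamily F).D) (i : Fin (stage3OfFamily F).D), f (z + ((M₁ * (stage3OfFamily F).L) : ℤ) • B7Prop1Explicit.e i) = f z) →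
      ∀ (z : B7Prop1Explicit.Site (stage3OfFamily F).D) (i : Fin (stage3OfFamily F).D), qs (c (q f)) (z + ((M₁ * (stage3OfFamily F).L) : ℤ) • B7Prop1Explicit.e i) = qs (c (q f)) z) ∧
        (∀ (f : B7Prop1Explicit.Site (stage3OfFamily F).D → (stage3OfFamily F).𝔸), ∀ x ∈ a.toZdIdx.Ω 0, Δ f x = covLap a.toZdIdx.η U₀ ((a.toZdIdx.Ω 0).indicator f) x) ∧
        (∀ (μ : ℕ → B7Prop1Explicit.Site (stage3OfFamily F).D → (stage3OfFamily F).𝔸), ∀ x ∈ a.toZdIdx.Ω 0, qs μ x = QT (stage3OfFamily F).L n (a.toZdIdx.Λs n) U₀ μ x) ∧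
        (∀ (f : B7Prop1Explicit.Site (stage3OfFamily F).D → (stage3OfFamily F).𝔸) (j : ℕ), j ≤ n → ∀ y ∈ a.toZdIdx.Λs n j, q f j y = QprimeIter (zdBlocking (stage3OfFamily F).D (stage3OfFamily F).L) (bgT (stage3OfFamily F).L U₀) j f y) ∧
        (∀ (X : XSpace (stage3OfFamily F).D n (stage3OfFamily F).𝔸) (x : B7Prop1Explicit.Site (stage3OfFamily F).D), ‖H' X x‖ ≤ B₀'H * ‖X‖) ∧
        (∀ j, j ≤ n → ∀ (X : XSpace (stage3OfFamily F).D n (stage3OfFamily F).𝔸), ∀ b ∈ {b : B7Prop1Explicit.Site (stage3OfFamily F).D × Fin (stage3OfFamily F).D | SideTouches (a.toZdIdx.Ω j) b.1 b.2},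
      wt (stage3OfFamily F).L a.toZdIdx.η j * ‖covDerivFwd a.toZdIdx.η U₀ b.2 (H' X) b.1‖ ≤ B₀'H * ‖X‖) ∧
        (∀ X : XSpace (stage3OfFamily F).D n (stage3OfFamily F).𝔸, Bd2 (stage3OfFamily F).L a.toZdIdx.η n a.toZdIdx.Ω (covLap a.toZdIdx.η U₀ (H' X)) (B₂' * ‖X‖)) ∧
        (∀ (X : XSpace (stage3OfFamily F).D n (stage3OfFamily F).𝔸) (x : B7Prop1Explicit.Site (stage3OfFamily F).D), x ∉ a.toZdIdx.Ω 0 → H' X x = 0) ∧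
        (∀ X Y : XSpace (stage3OfFamily F).D n (stage3OfFamily F).𝔸, (∀ b, Y b = -star (X b)) → ∀ x, H' Y x = -star (H' X x)) ∧
        (∀ X : XSpace (stage3OfFamily F).D n (stage3OfFamily F).𝔸, (∀ (b : Fin (n + 1) × B7Prop1Explicit.Site (stage3OfFamily F).D) (i : Fin (stage3OfFamily F).D), X (b.1, b.2 + (((M₁ * (stage3OfFamily F).L) : ℤ) / ((stage3OfFamily F).L : ℤ) ^ (b.1 : ℕ)) • B7Prop1Explicit.e i) = X b) →
      ∀ (z : B7Prop1Explicit.Site (stage3OfFamily F).D) (i : Fin (stage3OfFamily F).D), H' X (z + ((M₁ * (stage3OfFamily F).L) : ℤ) • B7Prop1Explicit.e i) = H' X z) ∧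
        (∀ (Y : XSpace (stage3OfFamily F).D n (stage3OfFamily F).𝔸), (∀ (b : Fin (n + 1) × B7Prop1Explicit.Site (stage3OfFamily F).D) (i : Fin (stage3OfFamily F).D), Y (b.1, b.2 + (((M₁ * (stage3OfFamily F).L) : ℤ) / ((stage3OfFamily F).L : ℤ) ^ (b.1 : ℕ)) • B7Prop1Explicit.e i) = Y b) →
      ∀ (j : ℕ) (hj : j ≤ n) (y : B7Prop1Explicit.Site (stage3OfFamily F).D), y ∈ a.toZdIdx.Λs n j →
      QprimeIter (zdBlocking (stage3OfFamily F).D (stage3OfFamily F).L) (bgT (stage3OfFamily F).L U₀) j (H' Y) y = Y (⟨j, Nat.lt_succ_of_le hj⟩, y)) ∧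
        (∀ (f : B7Prop1Explicit.Site (stage3OfFamily F).D → (stage3OfFamily F).𝔸) (r : ℝ), 0 ≤ r → Bd2 (stage3OfFamily F).L a.toZdIdx.η n a.toZdIdx.Ω f r →
      (∀ x, ‖g f x‖ ≤ BG * r) ∧ ∀ j, j ≤ n → ∀ b ∈ {b : B7Prop1Explicit.Site (stage3OfFamily F).D × Fin (stage3OfFamily F).D | SideTouches (a.toZdIdx.Ω j) b.1 b.2},
        wt (stage3OfFamily F).L a.toZdIdx.η j * ‖covDerivFwd a.toZdIdx.η U₀ b.2 (g f) b.1‖ ≤ BG * r) ∧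
        (∀ (f : B7Prop1Explicit.Site (stage3OfFamily F).D → (stage3OfFamily F).𝔸) (x : B7Prop1Explicit.Site (stage3OfFamily F).D), x ∉ a.toZdIdx.Ω 0 → g f x = 0) ∧
        (∀ f : B7Prop1Explicit.Site (stage3OfFamily F).D → (stage3OfFamily F).𝔸, (∀ j, j ≤ n → ∀ x ∈ a.toZdIdx.Ω j, IsSelfAdjoint (f x)) → ∀ x, IsSelfAdjoint (g f x)) ∧
        (∀ (f : B7Prop1Explicit.Site (stage3OfFamily F).D → (stage3OfFamily F).𝔸) (r : ℝ), 0 ≤ r → Bd2 (stage3OfFamily F).L a.toZdIdx.η n a.toZdIdx.Ω f r → Bd2 (stage3OfFamily F).L a.toZdIdx.η n a.toZdIdx.Ω (f - g (qs (c (q (g f))))) (BR * r)) ∧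
        (∀ f : B7Prop1Explicit.Site (stage3OfFamily F).D → (stage3OfFamily F).𝔸, (∀ j, j ≤ n → ∀ x ∈ a.toZdIdx.Ω j, IsSelfAdjoint (f x)) →
      ∀ j, j ≤ n → ∀ x ∈ a.toZdIdx.Ω j, IsSelfAdjoint ((f - g (qs (c (q (g f))))) x))) ∧
        (∀ a : IdxB8LanCκPer (stage3OfFamily F) (M₁ * (stage3OfFamily F).L) M₁ R, ∀ α₀ : ℝ, 0 < α₀ → α₀ ≤ cL → InAk (stage3OfFamily F).L a.toZdLanIdx.k a.toZdLanIdx.η α₀ a.toZdLanIdx.Ω a.toZdLanIdx.U₀ →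
      ∃ (g Δ : (B7Prop1Explicit.Site (stage3OfFamily F).D → (stage3OfFamily F).𝔸) →ₗ[ℂ] (B7Prop1Explicit.Site (stage3OfFamily F).D → (stage3OfFamily F).𝔸)) (q : (B7Prop1Explicit.Site (stage3OfFamily F).D → (stage3OfFamily F).𝔸) →ₗ[ℂ] (ℕ → B7Prop1Explicit.Site (stage3OfFamily F).D → (stage3OfFamily F).𝔸)) (qs : (ℕ → B7Prop1Explicit.Site (stage3OfFamily F).D → (stage3OfFamily F).𝔸) →ₗ[ℂ] (B7Prop1Explicit.Site (stage3OfFamily F).D → (stage3OfFamily F).𝔸))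
        (Aw c : (ℕ → B7Prop1Explicit.Site (stage3OfFamily F).D → (stage3OfFamily F).𝔸) →ₗ[ℂ] (ℕ → B7Prop1Explicit.Site (stage3OfFamily F).D → (stage3OfFamily F).𝔸)) (H' : XSpace (stage3OfFamily F).D a.toZdLanIdx.k (stage3OfFamily F).𝔸 →ₗ[ℂ] (B7Prop1Explicit.Site (stage3OfFamily F).D → (stage3OfFamily F).𝔸)),
        (∀ x : B7Prop1Explicit.Site (stage3OfFamily F).D → (stage3OfFamily F).𝔸, (∀ (z : B7Prop1Explicit.Site (stage3OfFamily F).D) (i : Fin (stage3OfFamily F).D), x (z + ((M₁ * (stage3OfFamily F).L) : ℤ) • B7Prop1Explicit.e i) = x z) → (∃ C : ℝ, ∀ y, ‖x y‖ ≤ C) →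
          g (Δ x + qs (Aw (q x))) = x) ∧
        (∀ φ : ℕ → B7Prop1Explicit.Site (stage3OfFamily F).D → (stage3OfFamily F).𝔸, (∀ n, n ≤ a.toZdLanIdx.k → ∀ (y : B7Prop1Explicit.Site (stage3OfFamily F).D) (i : Fin (stage3OfFamily F).D), φ n (y + (((M₁ * (stage3OfFamily F).L) : ℤ) / ((stage3OfFamily F).L : ℤ) ^ n) • B7Prop1Explicit.e i) = φ n y) →
          qs (c (q (g (g (qs φ))))) = qs φ) ∧
        (∀ (f : B7Prop1Explicit.Site (stage3OfFamily F).D → (stage3OfFamily F).𝔸), ∀ x ∈ a.toZdLanIdx.Ω 0, Δ f x = covLap a.toZdLanIdx.η a.toZdLanIdx.U₀ ((a.toZdLanIdx.Ω 0).indicator f) x) ∧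
        (∀ (μ : ℕ → B7Prop1Explicit.Site (stage3OfFamily F).D → (stage3OfFamily F).𝔸), ∀ x ∈ a.toZdLanIdx.Ω 0, qs μ x = QT (stage3OfFamily F).L a.toZdLanIdx.k a.toZdLanIdx.Λ a.toZdLanIdx.U₀ μ x) ∧
        (∀ (f : B7Prop1Explicit.Site (stage3OfFamily F).D → (stage3OfFamily F).𝔸) (n : ℕ), n ≤ a.toZdLanIdx.k → ∀ y ∈ a.toZdLanIdx.Λ n, q f n y = QprimeIter (zdBlocking (stage3OfFamily F).D (stage3OfFamily F).L) (bgT (stage3OfFamily F).L a.toZdLanIdx.U₀) n f y) ∧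
        (∀ (f : B7Prop1Explicit.Site (stage3OfFamily F).D → (stage3OfFamily F).𝔸) (n : ℕ) (y : B7Prop1Explicit.Site (stage3OfFamily F).D), ¬ (n ≤ a.toZdLanIdx.k ∧ y ∈ a.toZdLanIdx.Λ n) → q f n y = 0) ∧
        (∀ (f : B7Prop1Explicit.Site (stage3OfFamily F).D → (stage3OfFamily F).𝔸) (z : B7Prop1Explicit.Site (stage3OfFamily F).D) (i : Fin (stage3OfFamily F).D), g f (z + ((M₁ * (stage3OfFamily F).L) : ℤ) • B7Prop1Explicit.e i) = g f z) ∧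
        (∀ μ : ℕ → B7Prop1Explicit.Site (stage3OfFamily F).D → (stage3OfFamily F).𝔸, ∀ n, n ≤ a.toZdLanIdx.k → ∀ (y : B7Prop1Explicit.Site (stage3OfFamily F).D) (i : Fin (stage3OfFamily F).D), Aw μ n (y + (((M₁ * (stage3OfFamily F).L) : ℤ) / ((stage3OfFamily F).L : ℤ) ^ n) • B7Prop1Explicit.e i) = Aw μ n y) ∧
        (∀ (X : XSpace (stage3OfFamily F).D a.toZdLanIdx.k (stage3OfFamily F).𝔸) (x : B7Prop1Explicit.Site (stage3OfFamily F).D), ‖H' X x‖ ≤ B₀'H * ‖X‖) ∧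
        (∀ n, n ≤ a.toZdLanIdx.k → ∀ (X : XSpace (stage3OfFamily F).D a.toZdLanIdx.k (stage3OfFamily F).𝔸), ∀ b ∈ {b : B7Prop1Explicit.Site (stage3OfFamily F).D × Fin (stage3OfFamily F).D | SideTouches (a.toZdLanIdx.Ω n) b.1 b.2},
          wt (stage3OfFamily F).L a.toZdLanIdx.η n * ‖covDerivFwd a.toZdLanIdx.η a.toZdLanIdx.U₀ b.2 (H' X) b.1‖ ≤ B₀'H * ‖X‖) ∧
        (∀ X : XSpace (stage3OfFamily F).D a.toZdLanIdx.k (stage3OfFamily F).𝔸, Bd2 (stage3OfFamily F).L a.toZdLanIdx.η a.toZdLanIdx.k a.toZdLanIdx.Ω (covLap a.toZdLanIdx.η a.toZdLanIdx.U₀ (H' X)) (B₂' * ‖X‖)) ∧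
        (∀ X : XSpace (stage3OfFamily F).D a.toZdLanIdx.k (stage3OfFamily F).𝔸, (∀ (q : Fin (a.toZdLanIdx.k + 1) × B7Prop1Explicit.Site (stage3OfFamily F).D) (i : Fin (stage3OfFamily F).D), X (q.1, q.2 + (((M₁ * (stage3OfFamily F).L) : ℤ) / ((stage3OfFamily F).L : ℤ) ^ (q.1 : ℕ)) • B7Prop1Explicit.e i) = X q) →
          ∀ (z : B7Prop1Explicit.Site (stage3OfFamily F).D) (i : Fin (stage3OfFamily F).D), H' X (z + ((M₁ * (stage3OfFamily F).L) : ℤ) • B7Prop1Explicit.e i) = H' X z) ∧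
        (∀ (Y : XSpace (stage3OfFamily F).D a.toZdLanIdx.k (stage3OfFamily F).𝔸), (∀ (q : Fin (a.toZdLanIdx.k + 1) × B7Prop1Explicit.Site (stage3OfFamily F).D) (i : Fin (stage3OfFamily F).D), Y (q.1, q.2 + (((M₁ * (stage3OfFamily F).L) : ℤ) / ((stage3OfFamily F).L : ℤ) ^ (q.1 : ℕ)) • B7Prop1Explicit.e i) = Y q) →
          ∀ (n : ℕ) (hn : n ≤ a.toZdLanIdx.k) (y : B7Prop1Explicit.Site (stage3OfFamily F).D), y ∈ a.toZdLanIdx.Λ n →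
          QprimeIter (zdBlocking (stage3OfFamily F).D (stage3OfFamily F).L) (bgT (stage3OfFamily F).L a.toZdLanIdx.U₀) n (H' Y) y = Y (⟨n, Nat.lt_succ_of_le hn⟩, y)) ∧
        (∀ (f : B7Prop1Explicit.Site (stage3OfFamily F).D → (stage3OfFamily F).𝔸) (r : ℝ), 0 ≤ r → Bd2 (stage3OfFamily F).L a.toZdLanIdx.η a.toZdLanIdx.k a.toZdLanIdx.Ω f r →
          (∀ x, ‖g f x‖ ≤ BG * r) ∧ ∀ n, n ≤ a.toZdLanIdx.k → ∀ b ∈ {b : B7Prop1Explicit.Site (stage3OfFamily F).D × Fin (stage3OfFamily F).D | SideTouches (a.toZdLanIdx.Ω n) b.1 b.2},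
            wt (stage3OfFamily F).L a.toZdLanIdx.η n * ‖covDerivFwd a.toZdLanIdx.η a.toZdLanIdx.U₀ b.2 (g f) b.1‖ ≤ BG * r) ∧
        (∀ (f : B7Prop1Explicit.Site (stage3OfFamily F).D → (stage3OfFamily F).𝔸) (r : ℝ), 0 ≤ r → Bd2 (stage3OfFamily F).L a.toZdLanIdx.η a.toZdLanIdx.k a.toZdLanIdx.Ω f r →
          Bd2 (stage3OfFamily F).L a.toZdLanIdx.η a.toZdLanIdx.k a.toZdLanIdx.Ω (f - g (qs (c (q (g f))))) (BR * r))))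
    -- NODE N06's LEAF: dag-n06-d's Stage-11 certificate b9LeafXP10_opsYNuOfRecordV6E_pairOY — its binders VERBATIM (N := 2, θ.toStage3Params := stage3OfFamily F), Skolemised in F
    (Mstar : ∀ F : T4Family, ℕ) (𝔯 : ∀ F : T4Family, ResY 2 (stage3OfFamily F) (Mstar F)) (𝔢₀ : ∀ F : T4Family, SectEY 2 (stage3OfFamily F) (Mstar F)) (𝔴 : ∀ F : T4Family, RWEY 2 (stage3OfFamily F) (Mstar F)) (𝔈 : ∀ F : T4Family, ExpsY 2 (stage3OfFamily F) (Mstar F)) (instN06_1 : ∀ F : T4Family, ∀ x : MemberY (stage3OfFamily F).d₆ (stage3OfFamily F).ℓ₆ (stage3OfFamily F).hd' (stage3OfFamily F).hL' (stage3OfFamily F).b₀ (stage3OfFamily F).b₁ (Mstar F), Fintype (geo9Y x).Site) (instN06_2 : ∀ F : T4Family, ∀ x : MemberY (stage3OfFamily F).d₆ (stage3OfFamily F).ℓ₆ (stage3OfFamily F).hd' (stage3OfFamily F).hL' (stage3OfFamily F).b₀ (stage3OfFamily F).b₁ (Mstar F), DecidableEq (geo9Y x).Site) (instN06_3 : ∀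 F : T4Family, ∀ x : MemberY (stage3OfFamily F).d₆ (stage3OfFamily F).ℓ₆ (stage3OfFamily F).hd' (stage3OfFamily F).hL' (stage3OfFamily F).b₀ (stage3OfFamily F).b₁ (Mstar F), DecidableRel (RelB x.toKIdx)) (bI : ∀ F : T4Family, ∀ x : MemberY (stage3OfFamily F).d₆ (stage3OfFamily F).ℓ₆ (stage3OfFamily F).hd' (stage3OfFamily F).hL' (stage3OfFamily F).b₀ (stage3OfFamily F).b₁ (Mstar F), FBondY x.toKIdx → IBondY x.toKIdx) (hβI : ∀ F : T4Family, ∀ (x : MemberY (stage3OfFamily F).d₆ (stage3OfFamily F).ℓ₆ (stage3OfFamily F).hd' (stage3OfFamily F).hL' (stage3OfFamily F).b₀ (stage3OfFamily F).b₁ (Mstar F)) (f : FBondY x.toKIdx) (c : IBondY x.toKIdx), blkV1 x.hN x.D f = β x.hN x.D x.hk c → β x.hN x.D x.hk ((bI F) x f) = blkV1 x.hN x.D f) (hlev : ∀ F : T4Family, ∀ (x : MemberY (stage3OfFamily F).d₆ (stage3OfFamily F).ℓ₆ (stage3OfFamily F).hd' (stage3OfFamily F).hL' (stage3OfFamily F).b₀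 (stage3OfFamily F).b₁ (Mstar F)) (f : FBondY x.toKIdx), lvl x.hN x.D x.hk ((bI F) x f) = (blkV1 x.hN x.D f).1.1) (hβ1 : ∀ F : T4Family, ∀ (x : MemberY (stage3OfFamily F).d₆ (stage3OfFamily F).ℓ₆ (stage3OfFamily F).hd' (stage3OfFamily F).hL' (stage3OfFamily F).b₀ (stage3OfFamily F).b₁ (Mstar F)) (f : FBondY x.toKIdx), (geomT x.D).dist (β x.hN x.D x.hk ((bI F) x f)) (blkV1 x.hN x.D f) ≤ 1) (hbI0 : ∀ F : T4Family, ∀ (x : MemberY (stage3OfFamily F).d₆ (stage3OfFamily F).ℓ₆ (stage3OfFamily F).hd' (stage3OfFamily F).hL' (stage3OfFamily F).b₀ (stage3OfFamily F).b₁ (Mstar F)) (f : FBondY x.toKIdx), (bI F) x f = (bI F) x ⟨f.src, 0⟩)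
    (hB : ∀ F : T4Family, B9.SectBStepPrinted ((stage3OfFamily F).d₆ + 1) c35Y geo9Y (bg9YR (Matrix (Fin 2) (Fin 2) ℂ) (specialUnitaryUnits (Fin 2)) (regYP335 (Matrix (Fin 2) (Fin 2) ℂ) (specialUnitaryUnits (Fin 2))) (regYP336 (Matrix (Fin 2) (Fin 2) ℂ) (specialUnitaryUnits (Fin 2)))) (fun x => kernelFamilyR (regYP335 (Matrix (Fin 2) (Fin 2) ℂ) (specialUnitaryUnits (Fin 2))) (regYP336 (Matrix (Fin 2) (Fin 2) ℂ) (specialUnitaryUnits (Fin 2))) ((opsYNuOfRecordV4PE 2 (stage3OfFamily F) (Mstar F) (𝔯 F) (sectEYOfRecordV6 2 (stage3OfFamily F) (Mstar F) (𝔢₀ F)) (𝔴 F) (𝔈 F)) x).Gp) (fun x => kernelFamilyR (regYP335 (Matrix (Fin 2) (Fin 2) ℂ) (specialUnitaryUnits (Fin 2))) (regYP336 (Matrix (Fin 2) (Fin 2) ℂ) (specialUnitaryUnits (Fin 2))) ((opsYNuOfRecordV4PE 2 (stage3OfFamily F) (Mstar F) (𝔯 F) (sectEYOfRecordV6 2 (stage3OfFamily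 F) (Mstar F) (𝔢₀ F)) (𝔴 F) (𝔈 F)) x).GA) (fun x => siteKernelR (regYP335 (Matrix (Fin 2) (Fin 2) ℂ) (specialUnitaryUnits (Fin 2))) (regYP336 (Matrix (Fin 2) (Fin 2) ℂ) (specialUnitaryUnits (Fin 2))) ((opsYNuOfRecordV4PE 2 (stage3OfFamily F) (Mstar F) (𝔯 F) (sectEYOfRecordV6 2 (stage3OfFamily F) (Mstar F) (𝔢₀ F)) (𝔴 F) (𝔈 F)) x).Cinv) (fun x K => ((opsYNuOfRecordV4PE 2 (stage3OfFamily F) (Mstar F) (𝔯 F) (sectEYOfRecordV6 2 (stage3OfFamily F) (Mstar F) (𝔢₀ F)) (𝔴 F) (𝔈 F)) x).IsAnalyticExt (kernelFamilyRY K))) (α' r39 δ39 B39 a39 M39 : ∀ F : T4Family, ℝ) (hα'0 : ∀ F : T4Family, 0 < (α' F)) (hα'1 : ∀ F : T4Family, (α' F) < 1) (hr39 : ∀ F : T4Family, 0 < (r39 F)) (hrδ39 : ∀ F : T4Family, (r39 F) ≤ (δ39 F)) (hB39 : ∀ F : T4Family, 0 < (B39 F)) (ha39 : ∀ F : T4Family,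 0 < (a39 F)) (hM39 : ∀ F : T4Family, 0 < (M39 F)) (h348 : ∀ F : T4Family, ∀ x : MemberY (stage3OfFamily F).d₆ (stage3OfFamily F).ℓ₆ (stage3OfFamily F).hd' (stage3OfFamily F).hL' (stage3OfFamily F).b₀ (stage3OfFamily F).b₁ (Mstar F), (M39 F) ≤ (geo9Y x).M → ∀ α₀ : ℝ, 0 < α₀ → (c35B (stage3OfFamily F).ℓ₆) * (geo9Y x).M * α₀ ≤ (a39 F) → ∀ U : (bg9YP (Matrix (Fin 2) (Fin 2) ℂ) (specialUnitaryUnits (Fin 2)) x).Cfg, (bg9YP (Matrix (Fin 2) (Fin 2) ℂ) (specialUnitaryUnits (Fin 2)) x).Reg335 c35Y α₀ U → Conv348Blk (oneCubeOps39YF (stage3OfFamily F) (Mstar F) (lettersYOfRecordV4P 2 (stage3OfFamily F) (Mstar F) (𝔯 F)) (bI F) x) (B39 F) (δ39 F) U)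
    (hEK39 : ∀ F : T4Family, ∀ x : MemberY (stage3OfFamily F).d₆ (stage3OfFamily F).ℓ₆ (stage3OfFamily F).hd' (stage3OfFamily F).hL' (stage3OfFamily F).b₀ (stage3OfFamily F).b₁ (Mstar F), rwKernelExpansionR (regYPb335 (Matrix (Fin 2) (Fin 2) ℂ) (specialUnitaryUnits (Fin 2))) (regYPb336 (Matrix (Fin 2) (Fin 2) ℂ) (specialUnitaryUnits (Fin 2))) ((opsYNuOfRecordV4PE 2 (stage3OfFamily F) (Mstar F) (𝔯 F) (sectEYOfRecordV6 2 (stage3OfFamily F) (Mstar F) (𝔢₀ F)) (𝔴 F) (𝔈 F)) x).EK39 = EK39OfOpsBlkVia (oneCubeOps39YFR (stage3OfFamily F) (Mstar F) (lettersYOfRecordV4P 2 (stage3OfFamily F) (Mstar F) (𝔯 F)) (regYPb335 (Matrix (Fin 2) (Fin 2) ℂ) (specialUnitaryUnits (Fin 2))) (regYPb336 (Matrix (Fin 2) (Fin 2) ℂ) (specialUnitaryUnits (Fin 2))) (bI F) x) (oneCubeReading39 _) ((stage3OfFamily F).d₆ + 1) (2 * (1 * (B39 F)) * rowConst261 (geo9Y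 (d := (stage3OfFamily F).d₆) (ℓ := (stage3OfFamily F).ℓ₆) (hd := (stage3OfFamily F).hd') (hL := (stage3OfFamily F).hL') (b₀ := (stage3OfFamily F).b₀) (b₁ := (stage3OfFamily F).b₁) (Mstar := (Mstar F))) ((α' F) * (r39 F))) ((1 - (α' F)) * (r39 F)) (repSite39F x.toKIdx ((bI F) x))) (hPD : ∀ F : T4Family, ∀ x : MemberY (stage3OfFamily F).d₆ (stage3OfFamily F).ℓ₆ (stage3OfFamily F).hd' (stage3OfFamily F).hL' (stage3OfFamily F).b₀ (stage3OfFamily F).b₁ (Mstar F), ((opsYNuOfRecordV4PE 2 (stage3OfFamily F) (Mstar F) (𝔯 F) (sectEYOfRecordV6 2 (stage3OfFamily F) (Mstar F) (𝔢₀ F)) (𝔴 F) (𝔈 F)) x).PosDef = PosDefOfOps (ops311Y x (lettersYOfRecordV4P 2 (stage3OfFamily F) (Mstar F) (𝔯 F) x) (B9Thm311PosAtRecordV4.proofLettersGA (lettersYOfRecordV4P 2 (stage3OfFamily F) (Mstar F) (𝔯 F) x)))) (ιA AA : ∀ F : T4Family, MemberY (stage3OfFamily F).d₆ (stage3OfFamily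 F).ℓ₆ (stage3OfFamily F).hd' (stage3OfFamily F).hL' (stage3OfFamily F).b₀ (stage3OfFamily F).b₁ (Mstar F) → Type) (instN06_4 : ∀ F : T4Family, ∀ x, Fintype ((ιA F) x)) (instN06_5 : ∀ F : T4Family, ∀ x, Fintype ((AA F) x)) (p q : ∀ F : T4Family, PinPrims) (hp : ∀ F : T4Family, (p F).OK) (hq : ∀ F : T4Family, (q F).OK) (p3 q3 : ∀ F : T4Family, PairPrims) (hp3 : ∀ F : T4Family, (p3 F).OK) (hq3 : ∀ F : T4Family, (q3 F).OK) (pM qM : ∀ F : T4Family, MixedPrims) (hpM : ∀ F : T4Family, (pM F).OK) (hqM : ∀ F : T4Family, (qM F).OK)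
    (H : ∀ F : T4Family, MemberY (stage3OfFamily F).d₆ (stage3OfFamily F).ℓ₆ (stage3OfFamily F).hd' (stage3OfFamily F).hL' (stage3OfFamily F).b₀ (stage3OfFamily F).b₁ (Mstar F) → Prop) (hM₀ : ∀ F : T4Family, nbrM₀Y (stage3OfFamily F).d₆ (stage3OfFamily F).ℓ₆ (stage3OfFamily F).hd' (stage3OfFamily F).hL' (stage3OfFamily F).b₀ (stage3OfFamily F).b₁ 2 ≤ (Mstar F)) (hM₀' : ∀ F : T4Family, nbrM₀Y (stage3OfFamily F).d₆ (stage3OfFamily F).ℓ₆ (stage3OfFamily F).hd' (stage3OfFamily F).hL' (stage3OfFamily F).b₀ (stage3OfFamily F).b₁ (((stage3OfFamily F).ℓ₆ : ℝ) + 4) ≤ (Mstar F)) (rd : ∀ F : T4Family, ∀ x : MemberY (stage3OfFamily F).d₆ (stage3OfFamily F).ℓ₆ (stage3OfFamily F).hd' (stage3OfFamily F).hL' (stage3OfFamily F).b₀ (stage3OfFamily F).b₁ (Mstar F), WalkReading (geo9Y x) (bg9YR (Matrix (Fin 2) (Fin 2) ℂ) (specialUnitaryUnits (Fin 2)) (regYPb335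 (Matrix (Fin 2) (Fin 2) ℂ) (specialUnitaryUnits (Fin 2))) (regYPb336 (Matrix (Fin 2) (Fin 2) ℂ) (specialUnitaryUnits (Fin 2))) x) (XSK (TrIdx 2) x.toKIdx) ↥(cubes x.toKIdx.D.toDomains)) (𝔭 : ∀ F : T4Family, ∀ x : MemberY (stage3OfFamily F).d₆ (stage3OfFamily F).ℓ₆ (stage3OfFamily F).hd' (stage3OfFamily F).hL' (stage3OfFamily F).b₀ (stage3OfFamily F).b₁ (Mstar F), HolderProbes (geo9Y x) (bg9YR (Matrix (Fin 2) (Fin 2) ℂ) (specialUnitaryUnits (Fin 2)) (regYPb335 (Matrix (Fin 2) (Fin 2) ℂ) (specialUnitaryUnits (Fin 2))) (regYPb336 (Matrix (Fin 2) (Fin 2) ℂ) (specialUnitaryUnits (Fin 2))) x) (XSK (TrIdx 2) x.toKIdx) (XSK (TrIdx 2) x.toKIdx) (PK (SiteY x.toKIdx) (Fin ((stage3OfFamily F).d₆ + 1)) (TrIdx 2)) (PK (SiteY x.toKIdx) (Fin ((stage3OfFamily F).d₆ + 1)) (TrIdx 2))) (h𝔭 : ∀ F : T4Family, ∀ x :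 MemberY (stage3OfFamily F).d₆ (stage3OfFamily F).ℓ₆ (stage3OfFamily F).hd' (stage3OfFamily F).hL' (stage3OfFamily F).b₀ (stage3OfFamily F).b₁ (Mstar F), (𝔭 F) x = holderProbesSA x.toKIdx (trBasis 2) (bg9YR (Matrix (Fin 2) (Fin 2) ℂ) (specialUnitaryUnits (Fin 2)) (regYPb335 (Matrix (Fin 2) (Fin 2) ℂ) (specialUnitaryUnits (Fin 2))) (regYPb336 (Matrix (Fin 2) (Fin 2) ℂ) (specialUnitaryUnits (Fin 2))) x) (fun U => U) (lettersYOfRecordV4P 2 (stage3OfFamily F) (Mstar F) (𝔯 F) x).parS ((bI F) x))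
    (bHX : ∀ F : T4Family, ∀ x : MemberY (stage3OfFamily F).d₆ (stage3OfFamily F).ℓ₆ (stage3OfFamily F).hd' (stage3OfFamily F).hL' (stage3OfFamily F).b₀ (stage3OfFamily F).b₁ (Mstar F), ℝ → BlockNorm (toB6 (geo9Y x) 1 ((H F) x)) ((XSK (TrIdx 2) x.toKIdx) → ℝ)) (hbHX : ∀ F : T4Family, ∀ x : MemberY (stage3OfFamily F).d₆ (stage3OfFamily F).ℓ₆ (stage3OfFamily F).hd' (stage3OfFamily F).hL' (stage3OfFamily F).b₀ (stage3OfFamily F).b₁ (Mstar F), (bHX F) x = fun ε => letI : Fintype (B9GeoNormsKLevelV1.geo9K x.toKIdx).Site := (inferInstance : Fintype (geo9Y x).Site); bHS x.toKIdx (sIK x.toKIdx ((bI F) x)) ε) (SH S3 SI : ∀ F : T4Family, ∀ x : MemberY (stage3OfFamily F).d₆ (stage3OfFamily F).ℓ₆ (stage3OfFamily F).hd' (stage3OfFamily F).hL' (stage3OfFamily F).b₀ (stage3OfFamily F).b₁ (Mstar F), ↥(cubes x.toKIdx.D.toDomains) → Finset (geo9Y x).Site) (hrd : ∀ F : T4Family,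 ∀ x, ((rd F) x).OK (opsWalkY x (trBasis 2) (bg9YR (Matrix (Fin 2) (Fin 2) ℂ) (specialUnitaryUnits (Fin 2)) (regYPb335 (Matrix (Fin 2) (Fin 2) ℂ) (specialUnitaryUnits (Fin 2))) (regYPb336 (Matrix (Fin 2) (Fin 2) ℂ) (specialUnitaryUnits (Fin 2))) x) (fun U => U) (parSymY x.toKIdx) ((bI F) x)).blk) (hrdAg : ∀ F : T4Family, ∀ x : MemberY (stage3OfFamily F).d₆ (stage3OfFamily F).ℓ₆ (stage3OfFamily F).hd' (stage3OfFamily F).hL' (stage3OfFamily F).b₀ (stage3OfFamily F).b₁ (Mstar F), ((rd F) x).Agree = agreeWalkY x (bg9YR (Matrix (Fin 2) (Fin 2) ℂ) (specialUnitaryUnits (Fin 2)) (regYPb335 (Matrix (Fin 2) (Fin 2) ℂ) (specialUnitaryUnits (Fin 2))) (regYPb336 (Matrix (Fin 2) (Fin 2) ℂ) (specialUnitaryUnits (Fin 2))) x) (fun U => U) (parSymY x.toKIdx)) (h36 : ∀ F : T4Family, ∀ x, (p F).M₁ ≤ (geo9Y x).M → ∀ α₀ : ℝ, 0 < α₀ →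 (c35B (stage3OfFamily F).ℓ₆) * (geo9Y x).M * α₀ ≤ (p F).a₁ → ∀ U : (bg9YP (Matrix (Fin 2) (Fin 2) ℂ) (specialUnitaryUnits (Fin 2)) x).Cfg, (bg9YP (Matrix (Fin 2) (Fin 2) ℂ) (specialUnitaryUnits (Fin 2)) x).Reg335 c35Y α₀ U → Local342 (opsWalkY x (trBasis 2) (bg9YR (Matrix (Fin 2) (Fin 2) ℂ) (specialUnitaryUnits (Fin 2)) (regYPb335 (Matrix (Fin 2) (Fin 2) ℂ) (specialUnitaryUnits (Fin 2))) (regYPb336 (Matrix (Fin 2) (Fin 2) ℂ) (specialUnitaryUnits (Fin 2))) x) (fun U => U) (parSymY x.toKIdx) ((bI F) x)) 1 ((H F) x) (p F).B₀ (p F).δ₀ U)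
    (h36H : ∀ F : T4Family, ∀ x, (p F).M₁ ≤ (geo9Y x).M → ∀ α₀ : ℝ, 0 < α₀ → (c35B (stage3OfFamily F).ℓ₆) * (geo9Y x).M * α₀ ≤ (p F).a₁ → ∀ U : (bg9YP (Matrix (Fin 2) (Fin 2) ℂ) (specialUnitaryUnits (Fin 2)) x).Cfg, (bg9YP (Matrix (Fin 2) (Fin 2) ℂ) (specialUnitaryUnits (Fin 2)) x).Reg335 c35Y α₀ U → HolderLegs37 (opsWalkY x (trBasis 2) (bg9YR (Matrix (Fin 2) (Fin 2) ℂ) (specialUnitaryUnits (Fin 2)) (regYPb335 (Matrix (Fin 2) (Fin 2) ℂ) (specialUnitaryUnits (Fin 2))) (regYPb336 (Matrix (Fin 2) (Fin 2) ℂ) (specialUnitaryUnits (Fin 2))) x) (fun U => U) (parSymY x.toKIdx) ((bI F) x)) ((𝔭 F) x) 1 ((H F) x) ((SH F) x) (p F).Bl (p F).δ₀ U ∧ HolderV37Dir (opsWalkY x (trBasis 2) (bg9YR (Matrix (Fin 2) (Fin 2) ℂ) (specialUnitaryUnits (Fin 2)) (regYPb335 (Matrix (Fin 2) (Fin 2)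 ℂ) (specialUnitaryUnits (Fin 2))) (regYPb336 (Matrix (Fin 2) (Fin 2) ℂ) (specialUnitaryUnits (Fin 2))) x) (fun U => U) (parSymY x.toKIdx) ((bI F) x)) (dirOpsWalkY x (trBasis 2) (bg9YR (Matrix (Fin 2) (Fin 2) ℂ) (specialUnitaryUnits (Fin 2)) (regYPb335 (Matrix (Fin 2) (Fin 2) ℂ) (specialUnitaryUnits (Fin 2))) (regYPb336 (Matrix (Fin 2) (Fin 2) ℂ) (specialUnitaryUnits (Fin 2))) x) (fun U => U) (parSymY x.toKIdx) ((bI F) x)) (dirLettersWalkY x (trBasis 2) (bg9YR (Matrix (Fin 2) (Fin 2) ℂ) (specialUnitaryUnits (Fin 2)) (regYPb335 (Matrix (Fin 2) (Fin 2) ℂ) (specialUnitaryUnits (Fin 2))) (regYPb336 (Matrix (Fin 2) (Fin 2) ℂ) (specialUnitaryUnits (Fin 2))) x) (fun U => U) (parSymY x.toKIdx) ((bI F) x)) ((𝔭 F) x) 1 ((H F) x) (p F).Bt (p F).δ₀ U ∧ (L2SecondLegs37 (opsWalkY x (trBasis 2) (bg9YR (Matrix (Fin 2) (Fin 2) ℂ)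 (specialUnitaryUnits (Fin 2)) (regYPb335 (Matrix (Fin 2) (Fin 2) ℂ) (specialUnitaryUnits (Fin 2))) (regYPb336 (Matrix (Fin 2) (Fin 2) ℂ) (specialUnitaryUnits (Fin 2))) x) (fun U => U) (parSymY x.toKIdx) ((bI F) x)) (dirOpsWalkY x (trBasis 2) (bg9YR (Matrix (Fin 2) (Fin 2) ℂ) (specialUnitaryUnits (Fin 2)) (regYPb335 (Matrix (Fin 2) (Fin 2) ℂ) (specialUnitaryUnits (Fin 2))) (regYPb336 (Matrix (Fin 2) (Fin 2) ℂ) (specialUnitaryUnits (Fin 2))) x) (fun U => U) (parSymY x.toKIdx) ((bI F) x)) 1 ((H F) x) ((S3 F) x) (p3 F).B3 (p F).δ₀ U ∧ (∀ q' μ, IsTransposePair ((dirLettersWalkY x (trBasis 2) (bg9YR (Matrix (Fin 2) (Fin 2) ℂ) (specialUnitaryUnits (Fin 2)) (regYPb335 (Matrix (Fin 2) (Fin 2) ℂ) (specialUnitaryUnits (Fin 2))) (regYPb336 (Matrix (Fin 2) (Fin 2) ℂ) (specialUnitaryUnits (Fin 2))) x) (fun U => U) (parSymY x.toKIdx) ((bI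 F) x)).Pt U q' μ) ((dirLettersWalkY x (trBasis 2) (bg9YR (Matrix (Fin 2) (Fin 2) ℂ) (specialUnitaryUnits (Fin 2)) (regYPb335 (Matrix (Fin 2) (Fin 2) ℂ) (specialUnitaryUnits (Fin 2))) (regYPb336 (Matrix (Fin 2) (Fin 2) ℂ) (specialUnitaryUnits (Fin 2))) x) (fun U => U) (parSymY x.toKIdx) ((bI F) x)).P U q' μ)) ∧ (∀ q', IsTransposePair ((opsWalkY x (trBasis 2) (bg9YR (Matrix (Fin 2) (Fin 2) ℂ) (specialUnitaryUnits (Fin 2)) (regYPb335 (Matrix (Fin 2) (Fin 2) ℂ) (specialUnitaryUnits (Fin 2))) (regYPb336 (Matrix (Fin 2) (Fin 2) ℂ) (specialUnitaryUnits (Fin 2))) x) (fun U => U) (parSymY x.toKIdx) ((bI F) x)).Ct U q') ((opsWalkY x (trBasis 2) (bg9YR (Matrix (Fin 2) (Fin 2) ℂ) (specialUnitaryUnits (Fin 2)) (regYPb335 (Matrix (Fin 2) (Fin 2) ℂ) (specialUnitaryUnits (Fin 2))) (regYPb336 (Matrix (Fin 2) (Fin 2) ℂ) (specialUnitaryUnits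 (Fin 2))) x) (fun U => U) (parSymY x.toKIdx) ((bI F) x)).Cop U q'))) ∧ (InputLegsPair37 (opsWalkY x (trBasis 2) (bg9YR (Matrix (Fin 2) (Fin 2) ℂ) (specialUnitaryUnits (Fin 2)) (regYPb335 (Matrix (Fin 2) (Fin 2) ℂ) (specialUnitaryUnits (Fin 2))) (regYPb336 (Matrix (Fin 2) (Fin 2) ℂ) (specialUnitaryUnits (Fin 2))) x) (fun U => U) (parSymY x.toKIdx) ((bI F) x)) (dirOpsWalkY x (trBasis 2) (bg9YR (Matrix (Fin 2) (Fin 2) ℂ) (specialUnitaryUnits (Fin 2)) (regYPb335 (Matrix (Fin 2) (Fin 2) ℂ) (specialUnitaryUnits (Fin 2))) (regYPb336 (Matrix (Fin 2) (Fin 2) ℂ) (specialUnitaryUnits (Fin 2))) x) (fun U => U) (parSymY x.toKIdx) ((bI F) x)) ((𝔭 F) x) 1 ((H F) x) ((bHX F) x) ((SI F) x) (p F).BI (p F).BI2 (p F).δ₀ U ∧ FactorsInputPair37Dir (opsWalkY x (trBasis 2) (bg9YR (Matrix (Fin 2) (Fin 2) ℂ) (specialUnitaryUnits (Fin 2)) (regYPb335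 (Matrix (Fin 2) (Fin 2) ℂ) (specialUnitaryUnits (Fin 2))) (regYPb336 (Matrix (Fin 2) (Fin 2) ℂ) (specialUnitaryUnits (Fin 2))) x) (fun U => U) (parSymY x.toKIdx) ((bI F) x)) (dirOpsWalkY x (trBasis 2) (bg9YR (Matrix (Fin 2) (Fin 2) ℂ) (specialUnitaryUnits (Fin 2)) (regYPb335 (Matrix (Fin 2) (Fin 2) ℂ) (specialUnitaryUnits (Fin 2))) (regYPb336 (Matrix (Fin 2) (Fin 2) ℂ) (specialUnitaryUnits (Fin 2))) x) (fun U => U) (parSymY x.toKIdx) ((bI F) x)) (dirLettersWalkY x (trBasis 2) (bg9YR (Matrix (Fin 2) (Fin 2) ℂ) (specialUnitaryUnits (Fin 2)) (regYPb335 (Matrix (Fin 2) (Fin 2) ℂ) (specialUnitaryUnits (Fin 2))) (regYPb336 (Matrix (Fin 2) (Fin 2) ℂ) (specialUnitaryUnits (Fin 2))) x) (fun U => U) (parSymY x.toKIdx) ((bI F) x)) 1 ((H F) x) ((bHX F) x) (p F).θI (p F).δ₀ U))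
    (hM1mix : ∀ F : T4Family, MMix (stage3OfFamily F).d₆ (stage3OfFamily F).ℓ₆ (stage3OfFamily F).hd' (stage3OfFamily F).hL' (stage3OfFamily F).b₀ (stage3OfFamily F).b₁ (Mstar F) 2 (c35B (stage3OfFamily F).ℓ₆) (c35B_pos (stage3OfFamily F).ℓ₆) ≤ (p F).M₁) (ha1mix : ∀ F : T4Family, (p F).a₁ ≤ aMix (stage3OfFamily F).d₆ (stage3OfFamily F).ℓ₆ (stage3OfFamily F).hd' (stage3OfFamily F).hL' (stage3OfFamily F).b₀ (stage3OfFamily F).b₁ (Mstar F) 2 (c35B (stage3OfFamily F).ℓ₆) (c35B_pos (stage3OfFamily F).ℓ₆)) (hBMmix : ∀ F : T4Family, BMix (stage3OfFamily F).d₆ (stage3OfFamily F).ℓ₆ (stage3OfFamily F).hd' (stage3OfFamily F).hL' (stage3OfFamily F).b₀ (stage3OfFamily F).b₁ (Mstar F) 2 (c35B (stage3OfFamily F).ℓ₆) (c35B_pos (stage3OfFamily F).ℓ₆) ≤ (pM F).BM) (hδmix : ∀ F : T4Family, (p F).δ₀ ≤ δMix (stage3OfFamily F).d₆ (stage3OfFamily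 F).ℓ₆ (stage3OfFamily F).hd' (stage3OfFamily F).hL' (stage3OfFamily F).b₀ (stage3OfFamily F).b₁ (Mstar F) 2 (c35B (stage3OfFamily F).ℓ₆) (c35B_pos (stage3OfFamily F).ℓ₆)) (hM1fac : ∀ F : T4Family, MRec (stage3OfFamily F).d₆ (stage3OfFamily F).ℓ₆ (stage3OfFamily F).hd' (stage3OfFamily F).hL' (stage3OfFamily F).b₀ (stage3OfFamily F).b₁ (Mstar F) 2 (c35B (stage3OfFamily F).ℓ₆) (c35B_pos (stage3OfFamily F).ℓ₆) ≤ (p F).M₁) (ha1fac : ∀ F : T4Family, (p F).a₁ ≤ aRec (stage3OfFamily F).d₆ (stage3OfFamily F).ℓ₆ (stage3OfFamily F).hd' (stage3OfFamily F).hL' (stage3OfFamily F).b₀ (stage3OfFamily F).b₁ (Mstar F) 2 (c35B (stage3OfFamily F).ℓ₆) (c35B_pos (stage3OfFamily F).ℓ₆)) (hδfac : ∀ F : T4Family, (p F).δ₀ ≤ δRec (stage3OfFamily F).d₆ (stage3OfFamily F).ℓ₆ (stage3OfFamily F).hd' (stage3OfFamily F).hL' (stage3OfFamily F).b₀ (stage3OfFamily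 F).b₁ (Mstar F) 2 (c35B (stage3OfFamily F).ℓ₆) (c35B_pos (stage3OfFamily F).ℓ₆)) (hθfac : ∀ F : T4Family, (p F).θ₀ * Real.exp ((3 / 4 + (p F).δ₀) * (p F).ρ) * BRec (stage3OfFamily F).d₆ (stage3OfFamily F).ℓ₆ (stage3OfFamily F).hd' (stage3OfFamily F).hL' (stage3OfFamily F).b₀ (stage3OfFamily F).b₁ (Mstar F) 2 (c35B (stage3OfFamily F).ℓ₆) (c35B_pos (stage3OfFamily F).ℓ₆) ≤ (pM F).θM) (hcntH : ∀ F : T4Family, ∀ x (a : (geo9Y x).Site), (∑ c, if a ∈ (SH F) x c then (1 : ℝ) else 0) ≤ (p F).NH) (hcnt3 : ∀ F : T4Family, ∀ x (a : (geo9Y x).Site), (∑ c, if a ∈ (S3 F) x c then (1 : ℝ) else 0) ≤ (p3 F).N3) (hcntI : ∀ F : T4Family, ∀ x (a : (geo9Y x).Site), (∑ c, if a ∈ (SI F) x c then (1 : ℝ) else 0) ≤ (p F).NI)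
    (hMw : ∀ F : T4Family, ∀ x : MemberY (stage3OfFamily F).d₆ (stage3OfFamily F).ℓ₆ (stage3OfFamily F).hd' (stage3OfFamily F).hL' (stage3OfFamily F).b₀ (stage3OfFamily F).b₁ (Mstar F), walkCntM₀Y (stage3OfFamily F).d₆ (stage3OfFamily F).ℓ₆ (stage3OfFamily F).hd' (stage3OfFamily F).hL' (stage3OfFamily F).b₀ (stage3OfFamily F).b₁ (Mstar F) ≤ (geo9Y x).M) (hNMw : ∀ F : T4Family, walkCntY (stage3OfFamily F).d₆ (stage3OfFamily F).ℓ₆ (stage3OfFamily F).hd' (stage3OfFamily F).hL' (stage3OfFamily F).b₀ (stage3OfFamily F).b₁ (Mstar F) ≤ (pM F).NM) (hM3 : ∀ F : T4Family, nbrM₀Y (stage3OfFamily F).d₆ (stage3OfFamily F).ℓ₆ (stage3OfFamily F).hd' (stage3OfFamily F).hL' (stage3OfFamily F).b₀ (stage3OfFamily F).b₁ 3 ≤ (Mstar F)) (hρ3 : ∀ F : T4Family, 3 ≤ (p F).ρ) (hNc : ∀ F : T4Family, walkCntY (stage3OfFamily F).d₆ (stage3OfFamily F).ℓ₆ (stage3OfFamily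 F).hd' (stage3OfFamily F).hL' (stage3OfFamily F).b₀ (stage3OfFamily F).b₁ (Mstar F) ≤ (p F).Nc) (hN' : ∀ F : T4Family, walkCntY (stage3OfFamily F).d₆ (stage3OfFamily F).ℓ₆ (stage3OfFamily F).hd' (stage3OfFamily F).hL' (stage3OfFamily F).b₀ (stage3OfFamily F).b₁ (Mstar F) ≤ (p F).N') (hCℓ : ∀ F : T4Family, ((((stage3OfFamily F).ℓ₆ + 1 : ℕ) : ℝ)) ^ 2 ≤ (p F).Cℓ) (hKc : ∀ F : T4Family, KcWalkY (stage3OfFamily F).d₆ (stage3OfFamily F).ℓ₆ (stage3OfFamily F).hd' (stage3OfFamily F).hL' (stage3OfFamily F).b₀ (stage3OfFamily F).b₁ (trBasis 2) ≤ (p F).Kc) (hθ₀ : ∀ F : T4Family, thetaWalkY (stage3OfFamily F).d₆ (stage3OfFamily F).ℓ₆ (stage3OfFamily F).hd' (stage3OfFamily F).hL' (stage3OfFamily F).b₀ (stage3OfFamily F).b₁ (trBasis 2) (p F).Cℓ ≤ (p F).θ₀) (𝔬A : ∀ F : T4Family, ∀ x : MemberY (stage3OfFamily F).d₆ (stage3OfFamily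 F).ℓ₆ (stage3OfFamily F).hd' (stage3OfFamily F).hL' (stage3OfFamily F).b₀ (stage3OfFamily F).b₁ (Mstar F), Ops310 (geo9Y x) (bg9YR (Matrix (Fin 2) (Fin 2) ℂ) (specialUnitaryUnits (Fin 2)) (regYPb335 (Matrix (Fin 2) (Fin 2) ℂ) (specialUnitaryUnits (Fin 2))) (regYPb336 (Matrix (Fin 2) (Fin 2) ℂ) (specialUnitaryUnits (Fin 2))) x) (XBK (TrIdx 2) x.toKIdx) (XBK (TrIdx 2) x.toKIdx) ((ιA F) x) ((AA F) x))
    (rdA : ∀ F : T4Family, ∀ x : MemberY (stage3OfFamily F).d₆ (stage3OfFamily F).ℓ₆ (stage3OfFamily F).hd' (stage3OfFamily F).hL' (stage3OfFamily F).b₀ (stage3OfFamily F).b₁ (Mstar F), WalkReading310 (geo9Y x) (bg9YR (Matrix (Fin 2) (Fin 2) ℂ) (specialUnitaryUnits (Fin 2)) (regYPb335 (Matrix (Fin 2) (Fin 2) ℂ) (specialUnitaryUnits (Fin 2))) (regYPb336 (Matrix (Fin 2) (Fin 2) ℂ) (specialUnitaryUnits (Fin 2))) x) (XBK (TrIdx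 2) x.toKIdx) ((ιA F) x) ((AA F) x)) (𝔭A : ∀ F : T4Family, ∀ x : MemberY (stage3OfFamily F).d₆ (stage3OfFamily F).ℓ₆ (stage3OfFamily F).hd' (stage3OfFamily F).hL' (stage3OfFamily F).b₀ (stage3OfFamily F).b₁ (Mstar F), HolderProbes (geo9Y x) (bg9YR (Matrix (Fin 2) (Fin 2) ℂ) (specialUnitaryUnits (Fin 2)) (regYPb335 (Matrix (Fin 2) (Fin 2) ℂ) (specialUnitaryUnits (Fin 2))) (regYPb336 (Matrix (Fin 2) (Fin 2) ℂ) (specialUnitaryUnits (Fin 2))) x) (XBK (TrIdx 2) x.toKIdx) (XBK (TrIdx 2) x.toKIdx) (PK (FBondY x.toKIdx) (Fin ((stage3OfFamily F).d₆ + 1)) (TrIdx 2)) (PK (FBondY x.toKIdx) (Fin ((stage3OfFamily F).d₆ + 1)) (TrIdx 2))) (h𝔭A : ∀ F : T4Family, ∀ x : MemberY (stage3OfFamily F).d₆ (stage3OfFamily F).ℓ₆ (stage3OfFamily F).hd' (stage3OfFamily F).hL' (stage3OfFamily F).b₀ (stage3OfFamily F).b₁ (Mstar F), (𝔭A F) x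 = holderProbesKA x.toKIdx (trBasis 2) (bg9YR (Matrix (Fin 2) (Fin 2) ℂ) (specialUnitaryUnits (Fin 2)) (regYPb335 (Matrix (Fin 2) (Fin 2) ℂ) (specialUnitaryUnits (Fin 2))) (regYPb336 (Matrix (Fin 2) (Fin 2) ℂ) (specialUnitaryUnits (Fin 2))) x) (fun U => U) (lettersYOfRecordV4P 2 (stage3OfFamily F) (Mstar F) (𝔯 F) x).parB ((bI F) x)) (𝔡A : ∀ F : T4Family, ∀ x : MemberY (stage3OfFamily F).d₆ (stage3OfFamily F).ℓ₆ (stage3OfFamily F).hd' (stage3OfFamily F).hL' (stage3OfFamily F).b₀ (stage3OfFamily F).b₁ (Mstar F), DirOps310 ((𝔬A F) x) (Fin ((stage3OfFamily F).d₆ + 1))) (𝔩A : ∀ F : T4Family, ∀ x : MemberY (stage3OfFamily F).d₆ (stage3OfFamily F).ℓ₆ (stage3OfFamily F).hd' (stage3OfFamily F).hL' (stage3OfFamily F).b₀ (stage3OfFamily F).b₁ (Mstar F), DirLetters310 ((𝔬A F) x) (Fin ((stage3OfFamily F).d₆ + 1))) (bHXA : ∀ F : T4Family, ∀ x : MemberY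 (stage3OfFamily F).d₆ (stage3OfFamily F).ℓ₆ (stage3OfFamily F).hd' (stage3OfFamily F).hL' (stage3OfFamily F).b₀ (stage3OfFamily F).b₁ (Mstar F), ℝ → BlockNorm (toB6 (geo9Y x) 1 ((H F) x)) ((XBK (TrIdx 2) x.toKIdx) → ℝ))
    (κA : ∀ F : T4Family, MemberY (stage3OfFamily F).d₆ (stage3OfFamily F).ℓ₆ (stage3OfFamily F).hd' (stage3OfFamily F).hL' (stage3OfFamily F).b₀ (stage3OfFamily F).b₁ (Mstar F) → Sizes310) (SHA S3A SIA SMA S2A : ∀ F : T4Family, ∀ x : MemberY (stage3OfFamily F).d₆ (stage3OfFamily F).ℓ₆ (stage3OfFamily F).hd' (stage3OfFamily F).hL' (stage3OfFamily F).b₀ (stage3OfFamily F).b₁ (Mstar F), (ιA F) x → Finset (geo9Y x).Site) (hbHXA : ∀ F : T4Family, ∀ x : MemberY (stage3OfFamily F).d₆ (stage3OfFamily F).ℓ₆ (stage3OfFamily F).hd' (stage3OfFamily F).hL' (stage3OfFamily F).b₀ (stage3OfFamily F).b₁ (Mstar F), (bHXA F) x = fun ε => letI : Fintype (B9GeoNormsKLevelV1.geo9K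 x.toKIdx).Site := (inferInstance : Fintype (geo9Y x).Site); bHK x.toKIdx ((bI F) x) ε) (hstA : ∀ F : T4Family, ∀ x, StaticOK310 ((𝔬A F) x) (q F).ρ (q F).Nc (q F).N' (q F).NF (q F).Cℓ ((κA F) x)) (hκA : ∀ F : T4Family, ∀ x, ((κA F) x).Bounded (q F).Kc) (hrdA : ∀ F : T4Family, ∀ x, ((rdA F) x).OK ((𝔬A F) x).blk) (hlocA : ∀ F : T4Family, ∀ x, Locality310 ((𝔬A F) x) ((rdA F) x)) (h36A : ∀ F : T4Family, ∀ x, (q F).M₁ ≤ (geo9Y x).M → ∀ α₀ : ℝ, 0 < α₀ → (c35B (stage3OfFamily F).ℓ₆) * (geo9Y x).M * α₀ ≤ (q F).a₁ → ∀ U : (bg9YP (Matrix (Fin 2) (Fin 2) ℂ) (specialUnitaryUnits (Fin 2)) x).Cfg, (bg9YP (Matrix (Fin 2) (Fin 2) ℂ) (specialUnitaryUnits (Fin 2)) x).Reg335 c35Y α₀ U → Local342G ((𝔬A F) x) 1 ((H F) x) (q F).B₀ (q F).δ₀ U ∧ B9Thm310Whole.Factors389 ((𝔬A F) x) 1 ((H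 F) x) (q F).θ₀ (q F).δ₀ U ∧ Identities310₂ ((𝔬A F) x) ((𝔡A F) x) ((𝔩A F) x) 1 ((H F) x) U) (hGsqA : ∀ F : T4Family, ∀ x, (q F).M₁ ≤ (geo9Y x).M → ∀ α₀ : ℝ, 0 < α₀ → (c35B (stage3OfFamily F).ℓ₆) * (geo9Y x).M * α₀ ≤ (q F).a₁ → ∀ U : (bg9YP (Matrix (Fin 2) (Fin 2) ℂ) (specialUnitaryUnits (Fin 2)) x).Cfg, (bg9YP (Matrix (Fin 2) (Fin 2) ℂ) (specialUnitaryUnits (Fin 2)) x).Reg335 c35Y α₀ U → ∀ i, IsTransposePair (((𝔬A F) x).Gsq U i) (((𝔬A F) x).Gsq U i) ∧ ∀ v, 0 ≤ v ⬝ᵥ ((𝔬A F) x).Gsq U i v)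
    (h36HA : ∀ F : T4Family, ∀ x, (q F).M₁ ≤ (geo9Y x).M → ∀ α₀ : ℝ, 0 < α₀ → (c35B (stage3OfFamily F).ℓ₆) * (geo9Y x).M * α₀ ≤ (q F).a₁ → ∀ U : (bg9YP (Matrix (Fin 2) (Fin 2) ℂ) (specialUnitaryUnits (Fin 2)) x).Cfg, (bg9YP (Matrix (Fin 2) (Fin 2) ℂ) (specialUnitaryUnits (Fin 2)) x).Reg335 c35Y α₀ U → HolderLegs310 ((𝔬A F) x) ((𝔭A F) x) 1 ((H F) x) ((SHA F) x) (q F).Bl (q F).δ₀ U ∧ FactorsHolder310 ((𝔬A F) x) ((𝔭A F) x) 1 ((H F) x) (q F).Bt (q F).δ₀ U ∧ (L2SecondLegs310 ((𝔬A F) x) ((𝔡A F) x) 1 ((H F) x) ((S3A F) x) (q3 F).B3 (q F).δ₀ U ∧ ∀ a, IsTransposePair (((𝔬A F) x).Rt U a) (((𝔬A F) x).Rf U a)) ∧ (InputLegsPair310 ((𝔬A F) x) ((𝔡A F) x) ((𝔭A F) x) 1 ((H F) x) ((bHXA F) x) ((SIA F) x) (q F).BI (q F).BI2 (q F).δ₀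 U ∧ FactorsInputPair310 ((𝔬A F) x) ((𝔡A F) x) 1 ((H F) x) ((bHXA F) x) (q F).θI (q F).δ₀ U) ∧ (L2MixedLegs310 ((𝔬A F) x) ((𝔡A F) x) 1 ((H F) x) ((SMA F) x) (qM F).BM (q F).δ₀ U ∧ FactorsL2Mixed310 ((𝔬A F) x) ((𝔡A F) x) 1 ((H F) x) (qM F).θM (q F).δ₀ U)) (h36A2 : ∀ F : T4Family, ∀ x, (q F).M₁ ≤ (geo9Y x).M → ∀ α₀ : ℝ, 0 < α₀ → (c35B (stage3OfFamily F).ℓ₆) * (geo9Y x).M * α₀ ≤ (q F).a₁ → ∀ U : (bg9YP (Matrix (Fin 2) (Fin 2) ℂ) (specialUnitaryUnits (Fin 2)) x).Cfg, (bg9YP (Matrix (Fin 2) (Fin 2) ℂ) (specialUnitaryUnits (Fin 2)) x).Reg335 c35Y α₀ U → L2TwoLegs310 ((𝔬A F) x) 1 ((H F) x) ((S2A F) x) (q F).B2 (q F).δ₀ U ∧ FactorsL2_310 ((𝔬A F) x) 1 ((H F) x) (q F).θ2 (q F).δ₀ U) (hcntHA : ∀ F : T4Family, ∀ x (a : (geo9Y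 x).Site), (∑ c, if a ∈ (SHA F) x c then (1 : ℝ) else 0) ≤ (q F).NH) (hcnt3A : ∀ F : T4Family, ∀ x (a : (geo9Y x).Site), (∑ c, if a ∈ (S3A F) x c then (1 : ℝ) else 0) ≤ (q3 F).N3) (hcntIA : ∀ F : T4Family, ∀ x (a : (geo9Y x).Site), (∑ c, if a ∈ (SIA F) x c then (1 : ℝ) else 0) ≤ (q F).NI) (hcntMA : ∀ F : T4Family, ∀ x (a : (geo9Y x).Site), (∑ c, if a ∈ (SMA F) x c then (1 : ℝ) else 0) ≤ (qM F).NM) (hcnt2A : ∀ F : T4Family, ∀ x (a : (geo9Y x).Site), (∑ c, if a ∈ (S2A F) x c then (1 : ℝ) else 0) ≤ (q F).N2)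
    (hE37 : ∀ F : T4Family, ∀ x : MemberY (stage3OfFamily F).d₆ (stage3OfFamily F).ℓ₆ (stage3OfFamily F).hd' (stage3OfFamily F).hL' (stage3OfFamily F).b₀ (stage3OfFamily F).b₁ (Mstar F), rwExpansionR (regYPb335 (Matrix (Fin 2) (Fin 2) ℂ) (specialUnitaryUnits (Fin 2))) (regYPb336 (Matrix (Fin 2) (Fin 2) ℂ) (specialUnitaryUnits (Fin 2))) ((opsYNuOfRecordV4PE 2 (stage3OfFamily F) (Mstar F) (𝔯 F) (sectEYOfRecordV6 2 (stage3OfFamily F) (Mstar F) (𝔢₀ F)) (𝔴 F) (𝔈 F)) x).E37 = E37YPairMDir (bg := (bg9YR (Matrix (Fin 2) (Fin 2) ℂ) (specialUnitaryUnits (Fin 2)) (regYPb335 (Matrix (Fin 2) (Fin 2) ℂ) (specialUnitaryUnits (Fin 2))) (regYPb336 (Matrix (Fin 2) (Fin 2) ℂ) (specialUnitaryUnits (Fin 2))))) (2 * ((stage3OfFamily F).d₆ + 1)) (nbrCountY (stage3OfFamily F).d₆ (stage3OfFamily F).ℓ₆ (stage3OfFamily F).hd' (stage3OfFamily F).hL'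 (stage3OfFamily F).b₀ (stage3OfFamily F).b₁ 2) (Real.sqrt (((stage3OfFamily F).d₆ + 1) * Fintype.card (TrIdx 2))) (((stage3OfFamily F).d₆ + 1 : ℕ) : ℝ) (p F) (q F) (⟨(p3 F).N3, 2 * (p3 F).B3, 0⟩ : PairPrims) (⟨(q3 F).N3, 2 * (q3 F).B3, 0⟩ : PairPrims) (pM F) (qM F) (opsWalkY x (trBasis 2) (bg9YR (Matrix (Fin 2) (Fin 2) ℂ) (specialUnitaryUnits (Fin 2)) (regYPb335 (Matrix (Fin 2) (Fin 2) ℂ) (specialUnitaryUnits (Fin 2))) (regYPb336 (Matrix (Fin 2) (Fin 2) ℂ) (specialUnitaryUnits (Fin 2))) x) (fun U => U) (parSymY x.toKIdx) ((bI F) x)) (dirOpsWalkY x (trBasis 2) (bg9YR (Matrix (Fin 2) (Fin 2) ℂ) (specialUnitaryUnits (Fin 2)) (regYPb335 (Matrix (Fin 2) (Fin 2) ℂ) (specialUnitaryUnits (Fin 2))) (regYPb336 (Matrix (Fin 2) (Fin 2) ℂ) (specialUnitaryUnits (Fin 2))) x) (fun U => U) (parSymY x.toKIdx) ((bI F) x))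 (dirLettersWalkY x (trBasis 2) (bg9YR (Matrix (Fin 2) (Fin 2) ℂ) (specialUnitaryUnits (Fin 2)) (regYPb335 (Matrix (Fin 2) (Fin 2) ℂ) (specialUnitaryUnits (Fin 2))) (regYPb336 (Matrix (Fin 2) (Fin 2) ℂ) (specialUnitaryUnits (Fin 2))) x) (fun U => U) (parSymY x.toKIdx) ((bI F) x)) ((rd F) x) ((H F) x) (kernelFamilyR (regYPb335 (Matrix (Fin 2) (Fin 2) ℂ) (specialUnitaryUnits (Fin 2))) (regYPb336 (Matrix (Fin 2) (Fin 2) ℂ) (specialUnitaryUnits (Fin 2))) ((opsYNuOfRecordV4PE 2 (stage3OfFamily F) (Mstar F) (𝔯 F) (sectEYOfRecordV6 2 (stage3OfFamily F) (Mstar F) (𝔢₀ F)) (𝔴 F) (𝔈 F)) x).Gp))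
    (hE310 : ∀ F : T4Family, ∀ x : MemberY (stage3OfFamily F).d₆ (stage3OfFamily F).ℓ₆ (stage3OfFamily F).hd' (stage3OfFamily F).hL' (stage3OfFamily F).b₀ (stage3OfFamily F).b₁ (Mstar F), rwExpansionR (regYPb335 (Matrix (Fin 2) (Fin 2) ℂ) (specialUnitaryUnits (Fin 2))) (regYPb336 (Matrix (Fin 2) (Fin 2) ℂ) (specialUnitaryUnits (Fin 2))) ((opsYNuOfRecordV4PE 2 (stage3OfFamily F) (Mstar F) (𝔯 F) (sectEYOfRecordV6 2 (stage3OfFamily F) (Mstar F) (𝔢₀ F)) (𝔴 F) (𝔈 F)) x).E310 = E310YPairM (bg := (bg9YR (Matrix (Fin 2) (Fin 2) ℂ) (specialUnitaryUnits (Fin 2)) (regYPb335 (Matrix (Fin 2) (Fin 2) ℂ) (specialUnitaryUnits (Fin 2))) (regYPb336 (Matrix (Fin 2) (Fin 2) ℂ) (specialUnitaryUnits (Fin 2))))) (2 * ((stage3OfFamily F).d₆ + 1)) (nbrCountY (stage3OfFamily F).d₆ (stage3OfFamily F).ℓ₆ (stage3OfFamily F).hd' (stage3OfFamily F).hL' (stage3OfFamily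 F).b₀ (stage3OfFamily F).b₁ 2) (Real.sqrt (((stage3OfFamily F).d₆ + 1) * Fintype.card (TrIdx 2))) (((stage3OfFamily F).d₆ + 1 : ℕ) : ℝ) (p F) (q F) (⟨(p3 F).N3, 2 * (p3 F).B3, 0⟩ : PairPrims) (⟨(q3 F).N3, 2 * (q3 F).B3, 0⟩ : PairPrims) (pM F) (qM F) ((𝔬A F) x) ((rdA F) x) ((H F) x) (kernelFamilyR (regYPb335 (Matrix (Fin 2) (Fin 2) ℂ) (specialUnitaryUnits (Fin 2))) (regYPb336 (Matrix (Fin 2) (Fin 2) ℂ) (specialUnitaryUnits (Fin 2))) ((opsYNuOfRecordV4PE 2 (stage3OfFamily F) (Mstar F) (𝔯 F) (sectEYOfRecordV6 2 (stage3OfFamily F) (Mstar F) (𝔢₀ F)) (𝔴 F) (𝔈 F)) x).GA)) (hblkA : ∀ F : T4Family, ∀ x : MemberY (stage3OfFamily F).d₆ (stage3OfFamily F).ℓ₆ (stage3OfFamily F).hd' (stage3OfFamily F).hL' (stage3OfFamily F).b₀ (stage3OfFamily F).b₁ (Mstar F), ((𝔬A F) x).blk = blkBK x.toKIdx ((bI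 F) x)) (hblkYA : ∀ F : T4Family, ∀ x : MemberY (stage3OfFamily F).d₆ (stage3OfFamily F).ℓ₆ (stage3OfFamily F).hd' (stage3OfFamily F).hL' (stage3OfFamily F).b₀ (stage3OfFamily F).b₁ (Mstar F), ((𝔬A F) x).blkY = blkBK x.toKIdx ((bI F) x))
    (hGcoA : ∀ F : T4Family, ∀ (x : MemberY (stage3OfFamily F).d₆ (stage3OfFamily F).ℓ₆ (stage3OfFamily F).hd' (stage3OfFamily F).hL' (stage3OfFamily F).b₀ (stage3OfFamily F).b₁ (Mstar F)) (U : (bg9YP (Matrix (Fin 2) (Fin 2) ℂ) (specialUnitaryUnits (Fin 2)) x).Cfg), ((𝔬A F) x).G U = GcoK x.toKIdx (trBasis 2) (bg9YR (Matrix (Fin 2) (Fin 2) ℂ) (specialUnitaryUnits (Fin 2)) (regYPb335 (Matrix (Fin 2) (Fin 2) ℂ) (specialUnitaryUnits (Fin 2))) (regYPb336 (Matrix (Fin 2) (Fin 2) ℂ) (specialUnitaryUnits (Fin 2))) x) (fun U => U) (lettersYOfRecordV4P 2 (stage3OfFamily F) (Mstar F) (𝔯 F) x).GA U) (hDcoA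 : ∀ F : T4Family, ∀ (x : MemberY (stage3OfFamily F).d₆ (stage3OfFamily F).ℓ₆ (stage3OfFamily F).hd' (stage3OfFamily F).hL' (stage3OfFamily F).b₀ (stage3OfFamily F).b₁ (Mstar F)) (U : (bg9YP (Matrix (Fin 2) (Fin 2) ℂ) (specialUnitaryUnits (Fin 2)) x).Cfg), ((𝔬A F) x).D U = DcoK x.toKIdx (trBasis 2) (bg9YR (Matrix (Fin 2) (Fin 2) ℂ) (specialUnitaryUnits (Fin 2)) (regYPb335 (Matrix (Fin 2) (Fin 2) ℂ) (specialUnitaryUnits (Fin 2))) (regYPb336 (Matrix (Fin 2) (Fin 2) ℂ) (specialUnitaryUnits (Fin 2))) x) (fun U => U) U) (hDscoA : ∀ F : T4Family, ∀ (x : MemberY (stage3OfFamily F).d₆ (stage3OfFamily F).ℓ₆ (stage3OfFamily F).hd' (stage3OfFamily F).hL' (stage3OfFamily F).b₀ (stage3OfFamily F).b₁ (Mstar F)) (U : (bg9YP (Matrix (Fin 2) (Fin 2) ℂ) (specialUnitaryUnits (Fin 2)) x).Cfg), ((𝔬A F) x).Dstar U = DscoK x.toKIdx (trBasis 2) (bg9YR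 (Matrix (Fin 2) (Fin 2) ℂ) (specialUnitaryUnits (Fin 2)) (regYPb335 (Matrix (Fin 2) (Fin 2) ℂ) (specialUnitaryUnits (Fin 2))) (regYPb336 (Matrix (Fin 2) (Fin 2) ℂ) (specialUnitaryUnits (Fin 2))) x) (fun U => U) U) (hLcoA : ∀ F : T4Family, ∀ (x : MemberY (stage3OfFamily F).d₆ (stage3OfFamily F).ℓ₆ (stage3OfFamily F).hd' (stage3OfFamily F).hL' (stage3OfFamily F).b₀ (stage3OfFamily F).b₁ (Mstar F)) (U : (bg9YP (Matrix (Fin 2) (Fin 2) ℂ) (specialUnitaryUnits (Fin 2)) x).Cfg), ((𝔬A F) x).Lap U = LcoK x.toKIdx (trBasis 2) (bg9YR (Matrix (Fin 2) (Fin 2) ℂ) (specialUnitaryUnits (Fin 2)) (regYPb335 (Matrix (Fin 2) (Fin 2) ℂ) (specialUnitaryUnits (Fin 2))) (regYPb336 (Matrix (Fin 2) (Fin 2) ℂ) (specialUnitaryUnits (Fin 2))) x) (fun U => U) U)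
    (h𝔡Ad : ∀ F : T4Family, ∀ (x : MemberY (stage3OfFamily F).d₆ (stage3OfFamily F).ℓ₆ (stage3OfFamily F).hd' (stage3OfFamily F).hL' (stage3OfFamily F).b₀ (stage3OfFamily F).b₁ (Mstar F)) (U : (bg9YP (Matrix (Fin 2) (Fin 2) ℂ) (specialUnitaryUnits (Fin 2)) x).Cfg), ((𝔡A F) x).Dd U = fun μ => coordOpK (trBasis 2) (fun _ : Fin ((stage3OfFamily F).d₆ + 1) => cdBₗ x.toKIdx U μ)) (h𝔡As : ∀ F : T4Family, ∀ (x : MemberY (stage3OfFamily F).d₆ (stage3OfFamily F).ℓ₆ (stage3OfFamily F).hd' (stage3OfFamily F).hL' (stage3OfFamily F).b₀ (stage3OfFamily F).b₁ (Mstar F)) (U : (bg9YP (Matrix (Fin 2) (Fin 2) ℂ) (specialUnitaryUnits (Fin 2)) x).Cfg), ((𝔡A F) x).Dsd U = fun μ => coordOpK (trBasis 2) (fun _ : Fin ((stage3OfFamily F).d₆ + 1) => cdsBₗ x.toKIdx U μ)) (hGsqAS : ∀ F : T4Family, ∀ (x : MemberY (stage3OfFamily F).d₆ (stage3OfFamily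 F).ℓ₆ (stage3OfFamily F).hd' (stage3OfFamily F).hL' (stage3OfFamily F).b₀ (stage3OfFamily F).b₁ (Mstar F)) (U : (bg9YP (Matrix (Fin 2) (Fin 2) ℂ) (specialUnitaryUnits (Fin 2)) x).Cfg) (j : (ιA F) x), ∃ (r : ℝ) (G : (FBondY x.toKIdx → Matrix (Fin 2) (Fin 2) ℂ) →ₗ[ℝ] (FBondY x.toKIdx → Matrix (Fin 2) (Fin 2) ℂ)), ((𝔬A F) x).Gsq U j = r • coordOpK (trBasis 2) (fun _ : Fin ((stage3OfFamily F).d₆ + 1) => G)) (𝔬12 : ∀ F : T4Family, ∀ x : MemberY (stage3OfFamily F).d₆ (stage3OfFamily F).ℓ₆ (stage3OfFamily F).hd' (stage3OfFamily F).hL' (stage3OfFamily F).b₀ (stage3OfFamily F).b₁ (Mstar F), B9Thm312Whole.Ops (geo9Y x) (bg9YR (Matrix (Fin 2) (Fin 2) ℂ) (specialUnitaryUnits (Fin 2)) (regYPb335 (Matrix (Fin 2) (Fin 2) ℂ) (specialUnitaryUnits (Fin 2))) (regYPb336 (Matrix (Fin 2) (Fin 2) ℂ) (specialUnitaryUnits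 (Fin 2))) x) (XBK (TrIdx 2) x.toKIdx) (XBK (TrIdx 2) x.toKIdx) (XHK (TrIdx 2) x.toKIdx) (XSK (TrIdx 2) x.toKIdx)) (bH13 : ∀ F : T4Family, ∀ x : MemberY (stage3OfFamily F).d₆ (stage3OfFamily F).ℓ₆ (stage3OfFamily F).hd' (stage3OfFamily F).hL' (stage3OfFamily F).b₀ (stage3OfFamily F).b₁ (Mstar F), (bg9YP (Matrix (Fin 2) (Fin 2) ℂ) (specialUnitaryUnits (Fin 2)) x).Cfg → BlockNorm (toB6 (geo9Y x) 1 ((H F) x)) (XSK (TrIdx 2) x.toKIdx → ℝ)) (δ12₀ δK12 σ12 ρ12 a12 M12 B12₃ δ12₃ ρ13 α12 : ∀ F : T4Family, ℝ) (ρf12 : ∀ F : T4Family, ℝ) (Bq12 : ∀ F : T4Family, ℝ → ℝ) (hρf12 : ∀ F : T4Family, 0 < (ρf12 F)) (hρf1 : ∀ F : T4Family, (ρf12 F) + (σ12 F) ≤ (1 - (α12 F)) * (ρ12 F)) (hρf2 : ∀ F : T4Family, (ρf12 F) + 2 * (σ12 F) + (α12 F) * (ρ12 F) ≤ (ρ12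 F))
    (hBq12 : ∀ F : T4Family, ∀ β, 0 ≤ (Bq12 F) β) (hB12₃ : ∀ F : T4Family, 0 ≤ (B12₃ F)) (hσ12 : ∀ F : T4Family, 0 < (σ12 F)) (hρ12 : ∀ F : T4Family, 0 < (ρ12 F)) (hρS12 : ∀ F : T4Family, (ρ12 F) ≤ (δ12₀ F)) (hρδ12 : ∀ F : T4Family, (ρ12 F) + (σ12 F) ≤ (δK12 F)) (hρ₃12 : ∀ F : T4Family, (ρ12 F) + (σ12 F) ≤ (δ12₃ F)) (ha12 : ∀ F : T4Family, 0 < (a12 F)) (hM12 : ∀ F : T4Family, 0 < (M12 F)) (hα12 : ∀ F : T4Family, 0 < (α12 F)) (hα12' : ∀ F : T4Family, (α12 F) ≤ 1 / 2) (hδ₃₀ : ∀ F : T4Family, (δ12₃ F) ≤ (δ12₀ F)) (hδ12₀ : ∀ F : T4Family, (δ12₀ F) ≤ (1 - 3 * (q F).αF) * ((1 - 2 * (q F).α) * (q F).δ₀)) (t12 δT12 ρS σS : ∀ F : T4Family, ℝ) (ht12 : ∀ F : T4Family, 0 ≤ (t12 F)) (hσS : ∀ F : T4Family, 0 < (σS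 F)) (hρST : ∀ F : T4Family, (ρS F) ≤ (δT12 F)) (hρS₀ : ∀ F : T4Family, (ρS F) + (σS F) ≤ (δ12₀ F)) (hρS₃ : ∀ F : T4Family, (ρS F) + (σS F) ≤ (δ12₃ F)) (hδKS : ∀ F : T4Family, (δK12 F) + (q F).αF * ((1 - 2 * (q F).α) * (q F).δ₀) ≤ (ρS F)) (hσSK : ∀ F : T4Family, (σS F) ≤ (δK12 F)) (bXH : ∀ F : T4Family, ∀ x : MemberY (stage3OfFamily F).d₆ (stage3OfFamily F).ℓ₆ (stage3OfFamily F).hd' (stage3OfFamily F).hL' (stage3OfFamily F).b₀ (stage3OfFamily F).b₁ (Mstar F), (bg9YP (Matrix (Fin 2) (Fin 2) ℂ) (specialUnitaryUnits (Fin 2)) x).Cfg → BlockNorm (toB6 (geo9Y x) 1 ((H F) x)) (XBK (TrIdx 2) x.toKIdx → ℝ)) (w13 wX : ∀ F : T4Family, ℝ → ℝ) (hw13₀ : ∀ F : T4Family, ∀ s, 0 ≤ (w13 F) s) (hw13₁ : ∀ F : T4Family, ∀ s, (w13 F) s ≤ 1) (hwX₀ : ∀ F : T4Family, ∀ s, 0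 ≤ (wX F) s) (hwX₁ : ∀ F : T4Family, ∀ s, (wX F) s ≤ 1) (hbH13 : ∀ F : T4Family, ∀ (x : MemberY (stage3OfFamily F).d₆ (stage3OfFamily F).ℓ₆ (stage3OfFamily F).hd' (stage3OfFamily F).hL' (stage3OfFamily F).b₀ (stage3OfFamily F).b₁ (Mstar F)) (U : (bg9YP (Matrix (Fin 2) (Fin 2) ℂ) (specialUnitaryUnits (Fin 2)) x).Cfg), (bH13 F) x U = letI : Fintype (B9GeoNormsKLevelV1.geo9K x.toKIdx).Site := (inferInstance : Fintype (geo9Y x).Site); bHZPG (κ := TrIdx 2) x.toKIdx (trBasis 2) (taxiS x.toKIdx (bg9YR (Matrix (Fin 2) (Fin 2) ℂ) (specialUnitaryUnits (Fin 2)) (regYPb335 (Matrix (Fin 2) (Fin 2) ℂ) (specialUnitaryUnits (Fin 2))) (regYPb336 (Matrix (Fin 2) (Fin 2) ℂ) (specialUnitaryUnits (Fin 2))) x) (fun U => U) U) (R := (1 : ℝ)) (H := (H F) x) (w13 F) (hw13₀ F) (hw13₁ F))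
    (hbXH : ∀ F : T4Family, ∀ (x : MemberY (stage3OfFamily F).d₆ (stage3OfFamily F).ℓ₆ (stage3OfFamily F).hd' (stage3OfFamily F).hL' (stage3OfFamily F).b₀ (stage3OfFamily F).b₁ (Mstar F)) (U : (bg9YP (Matrix (Fin 2) (Fin 2) ℂ) (specialUnitaryUnits (Fin 2)) x).Cfg), (bXH F) x U = letI : Fintype (B9GeoNormsKLevelV1.geo9K x.toKIdx).Site := (inferInstance : Fintype (geo9Y x).Site); bHZKPG (κ := TrIdx 2) x.toKIdx (trBasis 2) (taxiB x.toKIdx (bg9YR (Matrix (Fin 2) (Fin 2) ℂ) (specialUnitaryUnits (Fin 2)) (regYPb335 (Matrix (Fin 2) (Fin 2) ℂ) (specialUnitaryUnits (Fin 2))) (regYPb336 (Matrix (Fin 2) (Fin 2) ℂ) (specialUnitaryUnits (Fin 2))) x) (fun U => U) U) (R := (1 : ℝ)) (H := (H F) x) (wX F) (hwX₀ F) (hwX₁ F)) (hρ13 : ∀ F : T4Family, 0 < (ρ13 F)) (hρ13ρ : ∀ F : T4Family, (ρ13 F) + 5 * (σ12 F) ≤ (ρ12 F)) (hσρ13 :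 ∀ F : T4Family, 3 * (σ12 F) < (1 - (α12 F)) * (ρ13 F)) (B13₄ : ∀ F : T4Family, ℝ) (θV13 Br13 Bx13 Bd13 : ∀ F : T4Family, ℝ → ℝ) (Bd2₁₃ : ∀ F : T4Family, ℝ → ℝ → ℝ) (hθV13 : ∀ F : T4Family, ∀ ε, 0 < ε → 0 ≤ (θV13 F) ε) (hB13₄ : ∀ F : T4Family, 0 ≤ (B13₄ F)) (hBr13 : ∀ F : T4Family, ∀ ε, 0 < ε → 0 ≤ (Br13 F) ε) (hBx13 : ∀ F : T4Family, ∀ β, 0 ≤ β → β < 1 → 0 ≤ (Bx13 F) β) (hBd13 : ∀ F : T4Family, ∀ ε, 0 < ε → ε ≤ 1 → 0 ≤ (Bd13 F) ε) (hBd2₁₃ : ∀ F : T4Family, ∀ ε β, 0 < ε → ε ≤ 1 → 0 ≤ β → β < 1 → 0 ≤ (Bd2₁₃ F) ε β)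
    (hta₂ : ∀ F : T4Family, ∀ x : MemberY (stage3OfFamily F).d₆ (stage3OfFamily F).ℓ₆ (stage3OfFamily F).hd' (stage3OfFamily F).hL' (stage3OfFamily F).b₀ (stage3OfFamily F).b₁ (Mstar F), (M12 F) ≤ (geo9Y x).M → ∀ α₀ : ℝ, 0 < α₀ → (geo9Y x).M * α₀ ≤ (a12 F) → ∀ U : (bg9YP (Matrix (Fin 2) (Fin 2) ℂ) (specialUnitaryUnits (Fin 2)) x).Cfg, (bg9YP (Matrix (Fin 2) (Fin 2) ℂ) (specialUnitaryUnits (Fin 2)) x).Reg335 c35Y α₀ U → (bg9YP (Matrix (Fin 2) (Fin 2) ℂ) (specialUnitaryUnits (Fin 2)) x).Reg336 c35Y α₀ U → HasMaj (cNorm 1 ((H F) x) ((𝔬12 F) x).blk (fun y => (geo9Y_len_pos x y).le) 2) (cNorm 1 ((H F) x) ((𝔬12 F) x).blk (fun y => (geo9Y_len_pos x y).le) 0) (Ta2LcoK x.toKIdx (trBasis 2) (bg9YR (Matrix (Fin 2) (Fin 2) ℂ) (specialUnitaryUnits (Fin 2)) (regYPb335 (Matrix (Fin 2) (Fin 2)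 ℂ) (specialUnitaryUnits (Fin 2))) (regYPb336 (Matrix (Fin 2) (Fin 2) ℂ) (specialUnitaryUnits (Fin 2))) x) (fun U => U) (parSymY x.toKIdx) (GpPhysY x.toKIdx (parSymY x.toKIdx)) ((𝔯 F) x).Δ2 U) (fun a a' => (t12 F) * ((geo9Y x).M * α₀) * Real.exp (-((δT12 F) * (geo9Y x).dist a a')))) (htb₂ : ∀ F : T4Family, ∀ x : MemberY (stage3OfFamily F).d₆ (stage3OfFamily F).ℓ₆ (stage3OfFamily F).hd' (stage3OfFamily F).hL' (stage3OfFamily F).b₀ (stage3OfFamily F).b₁ (Mstar F), (M12 F) ≤ (geo9Y x).M → ∀ α₀ : ℝ, 0 < α₀ → (geo9Y x).M * α₀ ≤ (a12 F) → ∀ U : (bg9YP (Matrix (Fin 2) (Fin 2) ℂ) (specialUnitaryUnits (Fin 2)) x).Cfg, (bg9YP (Matrix (Fin 2) (Fin 2) ℂ) (specialUnitaryUnits (Fin 2)) x).Reg335 c35Y α₀ U → (bg9YP (Matrix (Fin 2) (Fin 2) ℂ) (specialUnitaryUnits (Fin 2)) x).Reg336 c35Y α₀ U → HasMaj (cNorm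 1 ((H F) x) ((𝔬12 F) x).blk (fun y => (geo9Y_len_pos x y).le) 2) (cNorm 1 ((H F) x) ((𝔬12 F) x).blkW (fun y => (geo9Y_len_pos x y).le) 1) (Tb2LcoKH x.toKIdx (trBasis 2) (bg9YR (Matrix (Fin 2) (Fin 2) ℂ) (specialUnitaryUnits (Fin 2)) (regYPb335 (Matrix (Fin 2) (Fin 2) ℂ) (specialUnitaryUnits (Fin 2))) (regYPb336 (Matrix (Fin 2) (Fin 2) ℂ) (specialUnitaryUnits (Fin 2))) x) (fun U => U) (parSymY x.toKIdx) (GpPhysY x.toKIdx (parSymY x.toKIdx)) ((𝔯 F) x).Δ2 U) (fun a a' => (t12 F) * ((geo9Y x).M * α₀) * Real.exp (-((δT12 F) * (geo9Y x).dist a a')))) (tJ δB rT : ∀ F : T4Family, ℝ) (ha1J : ∀ F : T4Family, 10 * (((stage3OfFamily F).ℓ₆ + 1 : ℕ) : ℝ) ^ 7 * (a12 F) ≤ 1)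
    (htJ : ∀ F : T4Family, 2 * (((stage3OfFamily F).d₆ : ℝ) + 1) * ((((stage3OfFamily F).ℓ₆ + 1 : ℕ) : ℝ)) ^ 3 * (2 : ℝ) * (10 ^ 4 * (((stage3OfFamily F).d₆ : ℝ) + 1) * (10 * (((stage3OfFamily F).ℓ₆ + 1 : ℕ) : ℝ) ^ 7)) * Real.exp (3 * (δB F)) ≤ (tJ F)) (hrTP : ∀ F : T4Family, (rT F) ≤ min ((1 - 2 * (p F).α) * (p F).δ₀) (δ39 F) / 8) (hrTB : ∀ F : T4Family, (rT F) ≤ (δB F)) (hδT12 : ∀ F : T4Family, 0 ≤ (δT12 F)) (hδTr : ∀ F : T4Family, (δT12 F) + 3 * (σS F) + 3 * ((q F).αF * ((1 - 2 * (q F).α) * (q F).δ₀)) ≤ (rT F)) (hta₂R : ∀ F : T4Family, ∀ x : MemberY (stage3OfFamily F).d₆ (stage3OfFamily F).ℓ₆ (stage3OfFamily F).hd' (stage3OfFamily F).hL' (stage3OfFamily F).b₀ (stage3OfFamily F).b₁ (Mstar F), (M12 F) ≤ (geo9Y x).M → ∀ α₀ : ℝ, 0 < α₀ → (geo9Y x).M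 * α₀ ≤ (a12 F) → ∀ U : (bg9YP (Matrix (Fin 2) (Fin 2) ℂ) (specialUnitaryUnits (Fin 2)) x).Cfg, (bg9YP (Matrix (Fin 2) (Fin 2) ℂ) (specialUnitaryUnits (Fin 2)) x).Reg335 c35Y α₀ U → (bg9YP (Matrix (Fin 2) (Fin 2) ℂ) (specialUnitaryUnits (Fin 2)) x).Reg336 c35Y α₀ U → HasMaj (cNorm 1 ((H F) x) ((𝔬12 F) x).blk (fun y => (geo9Y_len_pos x y).le) 2) (cNorm 1 ((H F) x) ((𝔬12 F) x).blk (fun y => (geo9Y_len_pos x y).le) 0) (Ta2RcoK x.toKIdx (trBasis 2) (bg9YR (Matrix (Fin 2) (Fin 2) ℂ) (specialUnitaryUnits (Fin 2)) (regYPb335 (Matrix (Fin 2) (Fin 2) ℂ) (specialUnitaryUnits (Fin 2))) (regYPb336 (Matrix (Fin 2) (Fin 2) ℂ) (specialUnitaryUnits (Fin 2))) x) (fun U => U) (parSymY x.toKIdx) (GpPhysY x.toKIdx (parSymY x.toKIdx)) ((𝔯 F) x).Δ2 U) (fun a a' => (t12 F) * ((geo9Y x).M * α₀) * Real.exp (-((δT12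 F) * (geo9Y x).dist a a'))))
    (htb₂R : ∀ F : T4Family, ∀ x : MemberY (stage3OfFamily F).d₆ (stage3OfFamily F).ℓ₆ (stage3OfFamily F).hd' (stage3OfFamily F).hL' (stage3OfFamily F).b₀ (stage3OfFamily F).b₁ (Mstar F), (M12 F) ≤ (geo9Y x).M → ∀ α₀ : ℝ, 0 < α₀ → (geo9Y x).M * α₀ ≤ (a12 F) → ∀ U : (bg9YP (Matrix (Fin 2) (Fin 2) ℂ) (specialUnitaryUnits (Fin 2)) x).Cfg, (bg9YP (Matrix (Fin 2) (Fin 2) ℂ) (specialUnitaryUnits (Fin 2)) x).Reg335 c35Y α₀ U → (bg9YP (Matrix (Fin 2) (Fin 2) ℂ) (specialUnitaryUnits (Fin 2)) x).Reg336 c35Y α₀ U → HasMaj (cNormR 1 ((H F) x) ((𝔬12 F) x).blkW (fun y => (geo9Y_len_pos x y).le) 0) (cNormR 1 ((H F) x) ((𝔬12 F) x).blk (fun y => (geo9Y_len_pos x y).le) 1) (Tb2RcoKH x.toKIdx (trBasis 2) (bg9YR (Matrix (Fin 2) (Fin 2) ℂ) (specialUnitaryUnits (Fin 2)) (regYPb335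 (Matrix (Fin 2) (Fin 2) ℂ) (specialUnitaryUnits (Fin 2))) (regYPb336 (Matrix (Fin 2) (Fin 2) ℂ) (specialUnitaryUnits (Fin 2))) x) (fun U => U) (parSymY x.toKIdx) (GpPhysY x.toKIdx (parSymY x.toKIdx)) ((𝔯 F) x).Δ2 U) (fun a a' => (t12 F) * ((geo9Y x).M * α₀) * Real.exp (-((δT12 F) * (geo9Y x).dist a a')))) (ϑF : ∀ F : T4Family, ℝ) (hϑF : ∀ F : T4Family, 2 * (10 * ((((stage3OfFamily F).ℓ₆ + 1 : ℕ) : ℝ)) * (a12 F)) * (1 + 10 * ((((stage3OfFamily F).ℓ₆ + 1 : ℕ) : ℝ)) * (a12 F)) * Real.exp (4 * (10 * ((((stage3OfFamily F).ℓ₆ + 1 : ℕ) : ℝ)) * (a12 F))) * ((((stage3OfFamily F).ℓ₆ + 1 : ℕ) : ℝ)) ≤ (ϑF F)) (sch : ∀ F : T4Family, ℝ → ℝ) (hsch0 : ∀ F : T4Family, ∀ β', 0 ≤ β' → β' < 1 → 0 < (sch F) β') (hsch1 : ∀ F : T4Family, ∀ β', 0 ≤ β' → β' < 1 → (sch F)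 β' < 1) (hwsch : ∀ F : T4Family, ∀ β', 0 ≤ β' → β' < 1 → 0 < (w13 F) ((sch F) β')) (δ45 : ∀ F : T4Family, ℝ) (hδ45 : ∀ F : T4Family, (δ12₃ F) < (δ45 F)) (BZ : ∀ F : T4Family, ℝ → ℝ) (hBZ : ∀ F : T4Family, ∀ β', 0 ≤ β' → β' < 1 → 0 ≤ (BZ F) β')
    (h45X : ∀ F : T4Family, ∀ x : MemberY (stage3OfFamily F).d₆ (stage3OfFamily F).ℓ₆ (stage3OfFamily F).hd' (stage3OfFamily F).hL' (stage3OfFamily F).b₀ (stage3OfFamily F).b₁ (Mstar F), letI : Fintype (B9GeoNormsKLevelV1.geo9K x.toKIdx).Site := (inferInstance : Fintype (geo9Y x).Site); (M12 F) ≤ (geo9Y x).M → ∀ α₀ : ℝ, 0 < α₀ → (geo9Y x).M * α₀ ≤ (a12 F) → ∀ U : (bg9YP (Matrix (Fin 2) (Fin 2) ℂ) (specialUnitaryUnits (Fin 2)) x).Cfg, (bg9YP (Matrix (Fin 2) (Fin 2) ℂ) (specialUnitaryUnits (Fin 2)) x).Reg335 c35Y α₀ U → (bg9YP (Matrix (Fin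 2) (Fin 2) ℂ) (specialUnitaryUnits (Fin 2)) x).Reg336 c35Y α₀ U → ∀ (ν μ : Fin ((stage3OfFamily F).d₆ + 1)) (β' : ℝ) (h0 : 0 ≤ β') (h1 : β' < 1), HasMaj (bHZKP (κ := TrIdx 2) x.toKIdx (trBasis 2) (taxiB x.toKIdx (bg9YR (Matrix (Fin 2) (Fin 2) ℂ) (specialUnitaryUnits (Fin 2)) (regYPb335 (Matrix (Fin 2) (Fin 2) ℂ) (specialUnitaryUnits (Fin 2))) (regYPb336 (Matrix (Fin 2) (Fin 2) ℂ) (specialUnitaryUnits (Fin 2))) x) (fun U => U) U) (R := (1 : ℝ)) (H := (H F) x) ((hsch0 F) β' h0 h1).le ((hsch1 F) β' h0 h1).le) (cNormR 1 ((H F) x) ((𝔭A F) x).blkPX (fun y => (geo9Y_len_pos x y).le) (β' - 1)) (((𝔭A F) x).ΦX U β' ∘ₗ (((𝔡A F) x).Dd U ν ∘ₗ (((𝔬12 F) x).G0 U ∘ₗ ((𝔡A F) x).Dsd U μ))) (fun a a' => (BZ F) β' * Real.exp (-((δ45 F) * (geo9Y x).dist a a')))) (hlettersH12 : ∀ F :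 T4Family, ∀ x : MemberY (stage3OfFamily F).d₆ (stage3OfFamily F).ℓ₆ (stage3OfFamily F).hd' (stage3OfFamily F).hL' (stage3OfFamily F).b₀ (stage3OfFamily F).b₁ (Mstar F), (M12 F) ≤ (geo9Y x).M → ∀ α₀ : ℝ, 0 < α₀ → (geo9Y x).M * α₀ ≤ (a12 F) → ∀ U : (bg9YP (Matrix (Fin 2) (Fin 2) ℂ) (specialUnitaryUnits (Fin 2)) x).Cfg, (bg9YP (Matrix (Fin 2) (Fin 2) ℂ) (specialUnitaryUnits (Fin 2)) x).Reg335 c35Y α₀ U → (bg9YP (Matrix (Fin 2) (Fin 2) ℂ) (specialUnitaryUnits (Fin 2)) x).Reg336 c35Y α₀ U → LettersHZ ((𝔬12 F) x) 1 ((H F) x) ⟨geo9Y_dist_triangle x, geo9Y_dist_comm x, geo9K_dist_nonneg x.toKIdx, geo9Y_len_pos x⟩ (weightNorm (BlockNorm.ofBlocks (toB6 (geo9Y x) 1 ((H F) x)) ((𝔬12 F) x).blkZ) (fun y => (((((stage3OfFamily F).ℓ₆ + 1 : ℕ) : ℝ) ^ ((stage3OfFamily F).d₆ + 1)) ^ lvl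 x.hN x.D x.hk y)⁻¹) (fun y => (plateau_pos x.toKIdx y).le)) (B12₃ F) (δ12₃ F) U)
    (hpinE : ∀ F : T4Family, ∀ x : MemberY (stage3OfFamily F).d₆ (stage3OfFamily F).ℓ₆ (stage3OfFamily F).hd' (stage3OfFamily F).hL' (stage3OfFamily F).b₀ (stage3OfFamily F).b₁ (Mstar F), ((opsYNuOfRecordV4PE 2 (stage3OfFamily F) (Mstar F) (𝔯 F) (sectEYOfRecordV6 2 (stage3OfFamily F) (Mstar F) (𝔢₀ F)) (𝔴 F) (𝔈 F)) x).HasRWExp = HasRWExpOfOps (ops312RY ((𝔬12 F) x))) (hpinH : ∀ F : T4Family, ∀ x : MemberY (stage3OfFamily F).d₆ (stage3OfFamily F).ℓ₆ (stage3OfFamily F).hd' (stage3OfFamily F).hL' (stage3OfFamily F).b₀ (stage3OfFamily F).b₁ (Mstar F), ((opsYNuOfRecordV4PE 2 (stage3OfFamily F) (Mstar F) (𝔯 F) (sectEYOfRecordV6 2 (stage3OfFamily F) (Mstar F) (𝔢₀ F)) (𝔴 F) (𝔈 F)) x).HasRWExpH = HasRWExpHOfOps (ops312RY ((𝔬12 F)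 x))) (hpinK : ∀ F : T4Family, ∀ x : MemberY (stage3OfFamily F).d₆ (stage3OfFamily F).ℓ₆ (stage3OfFamily F).hd' (stage3OfFamily F).hL' (stage3OfFamily F).b₀ (stage3OfFamily F).b₁ (Mstar F), ((opsYNuOfRecordV4PE 2 (stage3OfFamily F) (Mstar F) (𝔯 F) (sectEYOfRecordV6 2 (stage3OfFamily F) (Mstar F) (𝔢₀ F)) (𝔴 F) (𝔈 F)) x).PosDefK = PosDefKOfOps (ops312RY ((𝔬12 F) x))) (hblk12 : ∀ F : T4Family, ∀ x : MemberY (stage3OfFamily F).d₆ (stage3OfFamily F).ℓ₆ (stage3OfFamily F).hd' (stage3OfFamily F).hL' (stage3OfFamily F).b₀ (stage3OfFamily F).b₁ (Mstar F), ((𝔬12 F) x).blk = blkBK x.toKIdx ((bI F) x)) (hblkW12 : ∀ F : T4Family, ∀ x : MemberY (stage3OfFamily F).d₆ (stage3OfFamily F).ℓ₆ (stage3OfFamily F).hd' (stage3OfFamily F).hL' (stage3OfFamily F).b₀ (stage3OfFamily F).b₁ (Mstar F), ((𝔬12 F) x).blkW = blkSK x.toKIdx (sIK x.toKIdx ((bI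 F) x))) (hblkY12 : ∀ F : T4Family, ∀ x : MemberY (stage3OfFamily F).d₆ (stage3OfFamily F).ℓ₆ (stage3OfFamily F).hd' (stage3OfFamily F).hL' (stage3OfFamily F).b₀ (stage3OfFamily F).b₁ (Mstar F), ((𝔬12 F) x).blkY = blkBK x.toKIdx ((bI F) x)) (hG0co12 : ∀ F : T4Family, ∀ (x : MemberY (stage3OfFamily F).d₆ (stage3OfFamily F).ℓ₆ (stage3OfFamily F).hd' (stage3OfFamily F).hL' (stage3OfFamily F).b₀ (stage3OfFamily F).b₁ (Mstar F)) (U : (bg9YP (Matrix (Fin 2) (Fin 2) ℂ) (specialUnitaryUnits (Fin 2)) x).Cfg), ((𝔬12 F) x).G0 U = GcoK x.toKIdx (trBasis 2) (bg9YR (Matrix (Fin 2) (Fin 2) ℂ) (specialUnitaryUnits (Fin 2)) (regYPb335 (Matrix (Fin 2) (Fin 2) ℂ) (specialUnitaryUnits (Fin 2))) (regYPb336 (Matrix (Fin 2) (Fin 2) ℂ) (specialUnitaryUnits (Fin 2))) x) (fun U => U) (lettersYOfRecordV4P 2 (stage3OfFamily F) (Mstar F) (𝔯 F) x).GA U)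
    (hGco12 : ∀ F : T4Family, ∀ (x : MemberY (stage3OfFamily F).d₆ (stage3OfFamily F).ℓ₆ (stage3OfFamily F).hd' (stage3OfFamily F).hL' (stage3OfFamily F).b₀ (stage3OfFamily F).b₁ (Mstar F)) (U : (bg9YP (Matrix (Fin 2) (Fin 2) ℂ) (specialUnitaryUnits (Fin 2)) x).Cfg), ((𝔬12 F) x).G U = GcoK x.toKIdx (trBasis 2) (bg9YR (Matrix (Fin 2) (Fin 2) ℂ) (specialUnitaryUnits (Fin 2)) (regYPb335 (Matrix (Fin 2) (Fin 2) ℂ) (specialUnitaryUnits (Fin 2))) (regYPb336 (Matrix (Fin 2) (Fin 2) ℂ) (specialUnitaryUnits (Fin 2))) x) (fun U => U) (lettersYOfRecordV4P 2 (stage3OfFamily F) (Mstar F) (𝔯 F) x).GD U) (hG1co12 : ∀ F : T4Family, ∀ (x : MemberY (stage3OfFamily F).d₆ (stage3OfFamily F).ℓ₆ (stage3OfFamily F).hd' (stage3OfFamily F).hL' (stage3OfFamily F).b₀ (stage3OfFamily F).b₁ (Mstar F)) (U : (bg9YP (Matrix (Fin 2) (Fin 2) ℂ) (specialUnitaryUnits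 (Fin 2)) x).Cfg), ((𝔬12 F) x).G1 U = GcoK x.toKIdx (trBasis 2) (bg9YR (Matrix (Fin 2) (Fin 2) ℂ) (specialUnitaryUnits (Fin 2)) (regYPb335 (Matrix (Fin 2) (Fin 2) ℂ) (specialUnitaryUnits (Fin 2))) (regYPb336 (Matrix (Fin 2) (Fin 2) ℂ) (specialUnitaryUnits (Fin 2))) x) (fun U => U) (lettersYOfRecordV4P 2 (stage3OfFamily F) (Mstar F) (𝔯 F) x).G₁ U) (hGGco12 : ∀ F : T4Family, ∀ (x : MemberY (stage3OfFamily F).d₆ (stage3OfFamily F).ℓ₆ (stage3OfFamily F).hd' (stage3OfFamily F).hL' (stage3OfFamily F).b₀ (stage3OfFamily F).b₁ (Mstar F)) (U : (bg9YP (Matrix (Fin 2) (Fin 2) ℂ) (specialUnitaryUnits (Fin 2)) x).Cfg), ((𝔬12 F) x).GG U = GcoK x.toKIdx (trBasis 2) (bg9YR (Matrix (Fin 2) (Fin 2) ℂ) (specialUnitaryUnits (Fin 2)) (regYPb335 (Matrix (Fin 2) (Fin 2) ℂ) (specialUnitaryUnits (Fin 2))) (regYPb336 (Matrix (Fin 2)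 (Fin 2) ℂ) (specialUnitaryUnits (Fin 2))) x) (fun U => U) (lettersYOfRecordV4P 2 (stage3OfFamily F) (Mstar F) (𝔯 F) x).GG U) (hDco12 : ∀ F : T4Family, ∀ (x : MemberY (stage3OfFamily F).d₆ (stage3OfFamily F).ℓ₆ (stage3OfFamily F).hd' (stage3OfFamily F).hL' (stage3OfFamily F).b₀ (stage3OfFamily F).b₁ (Mstar F)) (U : (bg9YP (Matrix (Fin 2) (Fin 2) ℂ) (specialUnitaryUnits (Fin 2)) x).Cfg), ((𝔬12 F) x).D U = DcoK x.toKIdx (trBasis 2) (bg9YR (Matrix (Fin 2) (Fin 2) ℂ) (specialUnitaryUnits (Fin 2)) (regYPb335 (Matrix (Fin 2) (Fin 2) ℂ) (specialUnitaryUnits (Fin 2))) (regYPb336 (Matrix (Fin 2) (Fin 2) ℂ) (specialUnitaryUnits (Fin 2))) x) (fun U => U) U)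
    (hDsco12 : ∀ F : T4Family, ∀ (x : MemberY (stage3OfFamily F).d₆ (stage3OfFamily F).ℓ₆ (stage3OfFamily F).hd' (stage3OfFamily F).hL' (stage3OfFamily F).b₀ (stage3OfFamily F).b₁ (Mstar F)) (U : (bg9YP (Matrix (Fin 2) (Fin 2) ℂ) (specialUnitaryUnits (Fin 2)) x).Cfg), ((𝔬12 F) x).Dstar U = DscoK x.toKIdx (trBasis 2) (bg9YR (Matrix (Fin 2) (Fin 2) ℂ) (specialUnitaryUnits (Fin 2)) (regYPb335 (Matrix (Fin 2) (Fin 2) ℂ) (specialUnitaryUnits (Fin 2))) (regYPb336 (Matrix (Fin 2) (Fin 2) ℂ) (specialUnitaryUnits (Fin 2))) x) (fun U => U) U) (hblkZ12 : ∀ F : T4Family, ∀ x : MemberY (stage3OfFamily F).d₆ (stage3OfFamily F).ℓ₆ (stage3OfFamily F).hd' (stage3OfFamily F).hL' (stage3OfFamily F).b₀ (stage3OfFamily F).b₁ (Mstar F), ((𝔬12 F) x).blkZ = blkHK x.toKIdx) (hHm12 : ∀ F : T4Family, ∀ (x : MemberY (stage3OfFamily F).d₆ (stage3OfFamily F).ℓ₆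 (stage3OfFamily F).hd' (stage3OfFamily F).hL' (stage3OfFamily F).b₀ (stage3OfFamily F).b₁ (Mstar F)) (U : (bg9YP (Matrix (Fin 2) (Fin 2) ℂ) (specialUnitaryUnits (Fin 2)) x).Cfg), ((𝔬12 F) x).Hm U = HcoK x.toKIdx (trBasis 2) (bg9YR (Matrix (Fin 2) (Fin 2) ℂ) (specialUnitaryUnits (Fin 2)) (regYPb335 (Matrix (Fin 2) (Fin 2) ℂ) (specialUnitaryUnits (Fin 2))) (regYPb336 (Matrix (Fin 2) (Fin 2) ℂ) (specialUnitaryUnits (Fin 2))) x) (fun U => U) (lettersYOfRecordV4P 2 (stage3OfFamily F) (Mstar F) (𝔯 F) x).H U) (hH1m12 : ∀ F : T4Family, ∀ (x : MemberY (stage3OfFamily F).d₆ (stage3OfFamily F).ℓ₆ (stage3OfFamily F).hd' (stage3OfFamily F).hL' (stage3OfFamily F).b₀ (stage3OfFamily F).b₁ (Mstar F)) (U : (bg9YP (Matrix (Fin 2) (Fin 2) ℂ) (specialUnitaryUnits (Fin 2)) x).Cfg), ((𝔬12 F) x).H1m U = HcoK x.toKIdx (trBasis 2) (bg9YR (Matrix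 (Fin 2) (Fin 2) ℂ) (specialUnitaryUnits (Fin 2)) (regYPb335 (Matrix (Fin 2) (Fin 2) ℂ) (specialUnitaryUnits (Fin 2))) (regYPb336 (Matrix (Fin 2) (Fin 2) ℂ) (specialUnitaryUnits (Fin 2))) x) (fun U => U) (lettersYOfRecordV4P 2 (stage3OfFamily F) (Mstar F) (𝔯 F) x).H₁ U)
    (hS0co12 : ∀ F : T4Family, ∀ (x : MemberY (stage3OfFamily F).d₆ (stage3OfFamily F).ℓ₆ (stage3OfFamily F).hd' (stage3OfFamily F).hL' (stage3OfFamily F).b₀ (stage3OfFamily F).b₁ (Mstar F)) (U : (bg9YP (Matrix (Fin 2) (Fin 2) ℂ) (specialUnitaryUnits (Fin 2)) x).Cfg), ((𝔬12 F) x).S0 U = S0coK x.toKIdx (trBasis 2) (bg9YR (Matrix (Fin 2) (Fin 2) ℂ) (specialUnitaryUnits (Fin 2)) (regYPb335 (Matrix (Fin 2) (Fin 2) ℂ) (specialUnitaryUnits (Fin 2))) (regYPb336 (Matrix (Fin 2) (Fin 2) ℂ) (specialUnitaryUnits (Fin 2))) x) (fun U => U) (parSymY x.toKIdx) (parBY x.toKIdx)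 (GpPhysY x.toKIdx (parSymY x.toKIdx)) U) (hTpico12 : ∀ F : T4Family, ∀ (x : MemberY (stage3OfFamily F).d₆ (stage3OfFamily F).ℓ₆ (stage3OfFamily F).hd' (stage3OfFamily F).hL' (stage3OfFamily F).b₀ (stage3OfFamily F).b₁ (Mstar F)) (U : (bg9YP (Matrix (Fin 2) (Fin 2) ℂ) (specialUnitaryUnits (Fin 2)) x).Cfg), ((𝔬12 F) x).Tpi U = TpicoK x.toKIdx (trBasis 2) (bg9YR (Matrix (Fin 2) (Fin 2) ℂ) (specialUnitaryUnits (Fin 2)) (regYPb335 (Matrix (Fin 2) (Fin 2) ℂ) (specialUnitaryUnits (Fin 2))) (regYPb336 (Matrix (Fin 2) (Fin 2) ℂ) (specialUnitaryUnits (Fin 2))) x) (fun U => U) (parSymY x.toKIdx) (GpPhysY x.toKIdx (parSymY x.toKIdx)) U) (hT2co12 : ∀ F : T4Family, ∀ (x : MemberY (stage3OfFamily F).d₆ (stage3OfFamily F).ℓ₆ (stage3OfFamily F).hd' (stage3OfFamily F).hL' (stage3OfFamily F).b₀ (stage3OfFamily F).b₁ (Mstar F)) (U : (bg9YP (Matrix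 (Fin 2) (Fin 2) ℂ) (specialUnitaryUnits (Fin 2)) x).Cfg), ((𝔬12 F) x).T2 U = T2coK x.toKIdx (trBasis 2) (bg9YR (Matrix (Fin 2) (Fin 2) ℂ) (specialUnitaryUnits (Fin 2)) (regYPb335 (Matrix (Fin 2) (Fin 2) ℂ) (specialUnitaryUnits (Fin 2))) (regYPb336 (Matrix (Fin 2) (Fin 2) ℂ) (specialUnitaryUnits (Fin 2))) x) (fun U => U) (parSymY x.toKIdx) (GpPhysY x.toKIdx (parSymY x.toKIdx)) ((𝔯 F) x).Δ2 U) (hQco12 : ∀ F : T4Family, ∀ (x : MemberY (stage3OfFamily F).d₆ (stage3OfFamily F).ℓ₆ (stage3OfFamily F).hd' (stage3OfFamily F).hL' (stage3OfFamily F).b₀ (stage3OfFamily F).b₁ (Mstar F)) (U : (bg9YP (Matrix (Fin 2) (Fin 2) ℂ) (specialUnitaryUnits (Fin 2)) x).Cfg), ((𝔬12 F) x).Q U = QcoKH x.toKIdx (trBasis 2) (bg9YR (Matrix (Fin 2) (Fin 2) ℂ) (specialUnitaryUnits (Fin 2)) (regYPb335 (Matrix (Fin 2) (Fin 2) ℂ)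 (specialUnitaryUnits (Fin 2))) (regYPb336 (Matrix (Fin 2) (Fin 2) ℂ) (specialUnitaryUnits (Fin 2))) x) (fun U => U) (parBY x.toKIdx) U)
    (hQsco12 : ∀ F : T4Family, ∀ (x : MemberY (stage3OfFamily F).d₆ (stage3OfFamily F).ℓ₆ (stage3OfFamily F).hd' (stage3OfFamily F).hL' (stage3OfFamily F).b₀ (stage3OfFamily F).b₁ (Mstar F)) (U : (bg9YP (Matrix (Fin 2) (Fin 2) ℂ) (specialUnitaryUnits (Fin 2)) x).Cfg), ((𝔬12 F) x).Qstar U = QscoKH x.toKIdx (trBasis 2) (bg9YR (Matrix (Fin 2) (Fin 2) ℂ) (specialUnitaryUnits (Fin 2)) (regYPb335 (Matrix (Fin 2) (Fin 2) ℂ) (specialUnitaryUnits (Fin 2))) (regYPb336 (Matrix (Fin 2) (Fin 2) ℂ) (specialUnitaryUnits (Fin 2))) x) (fun U => U) (parBY x.toKIdx) U) (hCco12 : ∀ F : T4Family, ∀ (x : MemberY (stage3OfFamily F).d₆ (stage3OfFamily F).ℓ₆ (stage3OfFamily F).hd' (stage3OfFamily F).hL' (stage3OfFamily F).b₀ (stage3OfFamily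 F).b₁ (Mstar F)) (U : (bg9YP (Matrix (Fin 2) (Fin 2) ℂ) (specialUnitaryUnits (Fin 2)) x).Cfg), ((𝔬12 F) x).C U = CcoK x.toKIdx (trBasis 2) (bg9YR (Matrix (Fin 2) (Fin 2) ℂ) (specialUnitaryUnits (Fin 2)) (regYPb335 (Matrix (Fin 2) (Fin 2) ℂ) (specialUnitaryUnits (Fin 2))) (regYPb336 (Matrix (Fin 2) (Fin 2) ℂ) (specialUnitaryUnits (Fin 2))) x) (fun U => U) (parSymY x.toKIdx) (parBY x.toKIdx) (GpPhysY x.toKIdx (parSymY x.toKIdx)) U) (hC1co12 : ∀ F : T4Family, ∀ (x : MemberY (stage3OfFamily F).d₆ (stage3OfFamily F).ℓ₆ (stage3OfFamily F).hd' (stage3OfFamily F).hL' (stage3OfFamily F).b₀ (stage3OfFamily F).b₁ (Mstar F)) (U : (bg9YP (Matrix (Fin 2) (Fin 2) ℂ) (specialUnitaryUnits (Fin 2)) x).Cfg), ((𝔬12 F) x).C1 U = C1coK x.toKIdx (trBasis 2) (bg9YR (Matrix (Fin 2) (Fin 2) ℂ) (specialUnitaryUnits (Fin 2)) (regYPb335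 (Matrix (Fin 2) (Fin 2) ℂ) (specialUnitaryUnits (Fin 2))) (regYPb336 (Matrix (Fin 2) (Fin 2) ℂ) (specialUnitaryUnits (Fin 2))) x) (fun U => U) (parSymY x.toKIdx) (parBY x.toKIdx) (GpPhysY x.toKIdx (parSymY x.toKIdx)) ((𝔯 F) x).Δ2 U) (hDvco12 : ∀ F : T4Family, ∀ (x : MemberY (stage3OfFamily F).d₆ (stage3OfFamily F).ℓ₆ (stage3OfFamily F).hd' (stage3OfFamily F).hL' (stage3OfFamily F).b₀ (stage3OfFamily F).b₁ (Mstar F)) (U : (bg9YP (Matrix (Fin 2) (Fin 2) ℂ) (specialUnitaryUnits (Fin 2)) x).Cfg), ((𝔬12 F) x).Dv U = DvcoKH x.toKIdx (trBasis 2) (bg9YR (Matrix (Fin 2) (Fin 2) ℂ) (specialUnitaryUnits (Fin 2)) (regYPb335 (Matrix (Fin 2) (Fin 2) ℂ) (specialUnitaryUnits (Fin 2))) (regYPb336 (Matrix (Fin 2) (Fin 2) ℂ) (specialUnitaryUnits (Fin 2))) x) (fun U => U) U)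
    (hDvsco12 : ∀ F : T4Family, ∀ (x : MemberY (stage3OfFamily F).d₆ (stage3OfFamily F).ℓ₆ (stage3OfFamily F).hd' (stage3OfFamily F).hL' (stage3OfFamily F).b₀ (stage3OfFamily F).b₁ (Mstar F)) (U : (bg9YP (Matrix (Fin 2) (Fin 2) ℂ) (specialUnitaryUnits (Fin 2)) x).Cfg), ((𝔬12 F) x).Dvstar U = DvscoKH x.toKIdx (trBasis 2) (bg9YR (Matrix (Fin 2) (Fin 2) ℂ) (specialUnitaryUnits (Fin 2)) (regYPb335 (Matrix (Fin 2) (Fin 2) ℂ) (specialUnitaryUnits (Fin 2))) (regYPb336 (Matrix (Fin 2) (Fin 2) ℂ) (specialUnitaryUnits (Fin 2))) x) (fun U => U) U) (hRco12 : ∀ F : T4Family, ∀ (x : MemberY (stage3OfFamily F).d₆ (stage3OfFamily F).ℓ₆ (stage3OfFamily F).hd' (stage3OfFamily F).hL' (stage3OfFamily F).b₀ (stage3OfFamily F).b₁ (Mstar F)) (U : (bg9YP (Matrix (Fin 2) (Fin 2) ℂ) (specialUnitaryUnits (Fin 2)) x).Cfg), ((𝔬12 F) x).R U = RcoK x.toKIdx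 (trBasis 2) (bg9YR (Matrix (Fin 2) (Fin 2) ℂ) (specialUnitaryUnits (Fin 2)) (regYPb335 (Matrix (Fin 2) (Fin 2) ℂ) (specialUnitaryUnits (Fin 2))) (regYPb336 (Matrix (Fin 2) (Fin 2) ℂ) (specialUnitaryUnits (Fin 2))) x) (fun U => U) (parSymY x.toKIdx) (GpPhysY x.toKIdx (parSymY x.toKIdx)) U) (hΔ2 : ∀ F : T4Family, ∀ (x : MemberY (stage3OfFamily F).d₆ (stage3OfFamily F).ℓ₆ (stage3OfFamily F).hd' (stage3OfFamily F).hL' (stage3OfFamily F).b₀ (stage3OfFamily F).b₁ (Mstar F)) (U : (bg9YP (Matrix (Fin 2) (Fin 2) ℂ) (specialUnitaryUnits (Fin 2)) x).Cfg), (∀ μ z, U μ z ∈ specialUnitaryUnits (Fin 2)) → IsSymmTr (fun _ => (1 : ℝ)) (((𝔯 F) x).Δ2 U)) (θ₂ δ₂ : ∀ F : T4Family, ℝ) (hθ₂ : ∀ F : T4Family, 0 ≤ (θ₂ F)) (hrT4 : ∀ F : T4Family, (rT F) ≤ δ46 (stage3OfFamily F).d₆ (stage3OfFamily F).ℓ₆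 (stage3OfFamily F).hd' (stage3OfFamily F).hL' (stage3OfFamily F).b₀ (stage3OfFamily F).b₁ (Mstar F) 2 (c35B (stage3OfFamily F).ℓ₆) (c35B_pos (stage3OfFamily F).ℓ₆)) (hrT2 : ∀ F : T4Family, (rT F) ≤ (δ₂ F)) (hδ₃T : ∀ F : T4Family, (δ12₃ F) ≤ (1 - 2 * (q F).αF) * (rT F) - (σS F))
    (hD2sup : ∀ F : T4Family, ∀ x : MemberY (stage3OfFamily F).d₆ (stage3OfFamily F).ℓ₆ (stage3OfFamily F).hd' (stage3OfFamily F).hL' (stage3OfFamily F).b₀ (stage3OfFamily F).b₁ (Mstar F), (M12 F) ≤ (geo9Y x).M → ∀ α₀ : ℝ, 0 < α₀ → (geo9Y x).M * α₀ ≤ (a12 F) → ∀ U : (bg9YP (Matrix (Fin 2) (Fin 2) ℂ) (specialUnitaryUnits (Fin 2)) x).Cfg, (bg9YP (Matrix (Fin 2) (Fin 2) ℂ) (specialUnitaryUnits (Fin 2)) x).Reg335 c35Y α₀ U → (bg9YP (Matrix (Fin 2) (Fin 2) ℂ) (specialUnitaryUnits (Fin 2)) x).Reg336 c35Y α₀ U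 → B6RandomWalk.HasMajorant (g := toB6 (geo9Y x) 1 ((H F) x)) ((𝔬12 F) x).blk (D2coK x.toKIdx (trBasis 2) (bg9YR (Matrix (Fin 2) (Fin 2) ℂ) (specialUnitaryUnits (Fin 2)) (regYPb335 (Matrix (Fin 2) (Fin 2) ℂ) (specialUnitaryUnits (Fin 2))) (regYPb336 (Matrix (Fin 2) (Fin 2) ℂ) (specialUnitaryUnits (Fin 2))) x) (fun U => U) (((𝔯 F) x).Δ2) U) (fun (a b : (geo9Y x).Site) => (θ₂ F) * ((geo9Y x).M * α₀) * ((geo9Y x).len a ^ 2)⁻¹ * Real.exp (-((δ₂ F) * (geo9Y x).dist a b)))) (hpXDv : ∀ F : T4Family, ∀ x : MemberY (stage3OfFamily F).d₆ (stage3OfFamily F).ℓ₆ (stage3OfFamily F).hd' (stage3OfFamily F).hL' (stage3OfFamily F).b₀ (stage3OfFamily F).b₁ (Mstar F), (M12 F) ≤ (geo9Y x).M → ∀ α₀ : ℝ, 0 < α₀ → (geo9Y x).M * α₀ ≤ (a12 F) → ∀ U : (bg9YP (Matrix (Fin 2) (Fin 2) ℂ) (specialUnitaryUnits (Fin 2))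 x).Cfg, (bg9YP (Matrix (Fin 2) (Fin 2) ℂ) (specialUnitaryUnits (Fin 2)) x).Reg335 c35Y α₀ U → (bg9YP (Matrix (Fin 2) (Fin 2) ℂ) (specialUnitaryUnits (Fin 2)) x).Reg336 c35Y α₀ U → ∀ β : ℝ, 0 ≤ β → β < 1 → HasMaj (cNormR 1 ((H F) x) ((𝔬12 F) x).blkW (fun y => (geo9Y_len_pos x y).le) 0) (cNormR 1 ((H F) x) ((𝔭A F) x).blkPX (fun y => (geo9Y_len_pos x y).le) (β - 1)) ((((𝔭A F) x).ΦX U β ∘ₗ ((𝔬12 F) x).G0 U) ∘ₗ ((𝔬12 F) x).Dv U) (fun a b => (Bx13 F) β * Real.exp (-((δ12₃ F) * (geo9Y x).dist a b))))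
    (hpXQs : ∀ F : T4Family, ∀ x : MemberY (stage3OfFamily F).d₆ (stage3OfFamily F).ℓ₆ (stage3OfFamily F).hd' (stage3OfFamily F).hL' (stage3OfFamily F).b₀ (stage3OfFamily F).b₁ (Mstar F), (M12 F) ≤ (geo9Y x).M → ∀ α₀ : ℝ, 0 < α₀ → (geo9Y x).M * α₀ ≤ (a12 F) → ∀ U : (bg9YP (Matrix (Fin 2) (Fin 2) ℂ) (specialUnitaryUnits (Fin 2)) x).Cfg, (bg9YP (Matrix (Fin 2) (Fin 2) ℂ) (specialUnitaryUnits (Fin 2)) x).Reg335 c35Y α₀ U → (bg9YP (Matrix (Fin 2) (Fin 2) ℂ) (specialUnitaryUnits (Fin 2)) x).Reg336 c35Y α₀ U → ∀ β : ℝ, 0 ≤ β → β < 1 → HasMaj (weightNorm (BlockNorm.ofBlocks (toB6 (geo9Y x) 1 ((H F) x)) ((𝔬12 F) x).blkZ) (fun y => (geo9Y x).len y * (fun y => (((((stage3OfFamily F).ℓ₆ + 1 : ℕ) : ℝ) ^ ((stage3OfFamily F).d₆ + 1)) ^ lvl x.hN x.D x.hk y)⁻¹) y) (fun y => (mul_pos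 (geo9Y_len_pos x y) (plateau_pos x.toKIdx y)).le)) (cNormR 1 ((H F) x) ((𝔭A F) x).blkPX (fun y => (geo9Y_len_pos x y).le) (β - 1)) ((((𝔭A F) x).ΦX U β ∘ₗ ((𝔬12 F) x).G0 U) ∘ₗ ((𝔬12 F) x).Qstar U) (fun a b => (Bx13 F) β * Real.exp (-((δ12₃ F) * (geo9Y x).dist a b)))) (δ45Y : ∀ F : T4Family, ℝ) (hδ45Y : ∀ F : T4Family, (δ12₃ F) < (δ45Y F)) (BiY : ∀ F : T4Family, ℝ → ℝ) (hBiY : ∀ F : T4Family, ∀ β', 0 ≤ β' → β' < 1 → 0 ≤ (BiY F) β') (αW σW δFW : ∀ F : T4Family, ℝ) (hαW0 : ∀ F : T4Family, 0 < (αW F)) (hαW1 : ∀ F : T4Family, (αW F) < 1) (hσW : ∀ F : T4Family, 0 < (σW F)) (hδFW : ∀ F : T4Family, 0 < (δFW F)) (hδFP : ∀ F : T4Family, (δFW F) ≤ min ((1 - 2 * (p F).α) * (p F).δ₀) (δ39 F) / 8) (hbudW : ∀ F : T4Family, 0 ≤ (δFW F) - (αW F) * (δFW F) - 2 * (σW F))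 (hδ3W : ∀ F : T4Family, (δ12₃ F) ≤ (δFW F) - (αW F) * (δFW F) - 2 * (σW F)) (hwschX : ∀ F : T4Family, ∀ β', 0 ≤ β' → β' < 1 → 0 < (wX F) ((sch F) β')) (δ45W : ∀ F : T4Family, ℝ) (hδ45W : ∀ F : T4Family, (δFW F) - (αW F) * (δFW F) - 2 * (σW F) ≤ (δ45W F)) (B45W : ∀ F : T4Family, ℝ → ℝ) (hB45W : ∀ F : T4Family, ∀ β', 0 ≤ β' → β' < 1 → 0 ≤ (B45W F) β') (δhW : ∀ F : T4Family, ℝ) (hδhW : ∀ F : T4Family, (δFW F) - (αW F) * (δFW F) - (σW F) ≤ (δhW F)) (BhW : ∀ F : T4Family, ℝ → ℝ) (hBhW : ∀ F : T4Family, ∀ β', 0 ≤ β' → β' < 1 → 0 ≤ (BhW F) β')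
    (hp45W : ∀ F : T4Family, ∀ x : MemberY (stage3OfFamily F).d₆ (stage3OfFamily F).ℓ₆ (stage3OfFamily F).hd' (stage3OfFamily F).hL' (stage3OfFamily F).b₀ (stage3OfFamily F).b₁ (Mstar F), letI : Fintype (B9GeoNormsKLevelV1.geo9K x.toKIdx).Site := (inferInstance : Fintype (geo9Y x).Site); (M12 F) ≤ (geo9Y x).M → ∀ α₀ : ℝ, 0 < α₀ → (geo9Y x).M * α₀ ≤ (a12 F) → ∀ U : (bg9YP (Matrix (Fin 2) (Fin 2) ℂ) (specialUnitaryUnits (Fin 2)) x).Cfg, (bg9YP (Matrix (Fin 2) (Fin 2) ℂ) (specialUnitaryUnits (Fin 2)) x).Reg335 c35Y α₀ U → (bg9YP (Matrix (Fin 2) (Fin 2) ℂ) (specialUnitaryUnits (Fin 2)) x).Reg336 c35Y α₀ U → ∀ (β' : ℝ) (h0 : 0 ≤ β') (h1 : β' < 1), HasMaj (bHZKP (κ := TrIdx 2) x.toKIdx (trBasis 2) (taxiB x.toKIdx (bg9YR (Matrix (Fin 2) (Fin 2) ℂ) (specialUnitaryUnits (Fin 2)) (regYPb335 (Matrix (Fin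 2) (Fin 2) ℂ) (specialUnitaryUnits (Fin 2))) (regYPb336 (Matrix (Fin 2) (Fin 2) ℂ) (specialUnitaryUnits (Fin 2))) x) (fun U => U) U) (R := (1 : ℝ)) (H := (H F) x) ((hsch0 F) β' h0 h1).le ((hsch1 F) β' h0 h1).le) (cNormR 1 ((H F) x) ((𝔭A F) x).blkPX (fun y => (geo9Y_len_pos x y).le) (β' - 1)) (((𝔭A F) x).ΦX U β' ∘ₗ (((𝔬12 F) x).Dv U ∘ₗ GcoS x.toKIdx (trBasis 2) (bg9YR (Matrix (Fin 2) (Fin 2) ℂ) (specialUnitaryUnits (Fin 2)) (regYPb335 (Matrix (Fin 2) (Fin 2) ℂ) (specialUnitaryUnits (Fin 2))) (regYPb336 (Matrix (Fin 2) (Fin 2) ℂ) (specialUnitaryUnits (Fin 2))) x) (fun U => U) (GpY x.toKIdx (parSymY x.toKIdx)) U ∘ₗ ((𝔬12 F) x).Dvstar U)) (fun a b => (B45W F) β' * Real.exp (-((δ45W F) * (geo9Y x).dist a b))))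
    (hpDGW : ∀ F : T4Family, ∀ x : MemberY (stage3OfFamily F).d₆ (stage3OfFamily F).ℓ₆ (stage3OfFamily F).hd' (stage3OfFamily F).hL' (stage3OfFamily F).b₀ (stage3OfFamily F).b₁ (Mstar F), letI : Fintype (B9GeoNormsKLevelV1.geo9K x.toKIdx).Site := (inferInstance : Fintype (geo9Y x).Site); (M12 F) ≤ (geo9Y x).M → ∀ α₀ : ℝ, 0 < α₀ → (geo9Y x).M * α₀ ≤ (a12 F) → ∀ U : (bg9YP (Matrix (Fin 2) (Fin 2) ℂ) (specialUnitaryUnits (Fin 2)) x).Cfg, (bg9YP (Matrix (Fin 2) (Fin 2) ℂ) (specialUnitaryUnits (Fin 2)) x).Reg335 c35Y α₀ U → (bg9YP (Matrix (Fin 2) (Fin 2) ℂ) (specialUnitaryUnits (Fin 2)) x).Reg336 c35Y α₀ U → ∀ (β' : ℝ), 0 ≤ β' → β' < 1 → HasMaj (cNormR 1 ((H F) x) ((𝔬12 F) x).blkW (fun y => (geo9Y_len_pos x y).le) 0) (cNormR 1 ((H F) x) ((𝔭A F) x).blkPX (fun y => (geo9Y_len_pos x y).le) (β' - 1)) (((𝔭A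 F) x).ΦX U β' ∘ₗ ((𝔬12 F) x).Dv U ∘ₗ GcoS x.toKIdx (trBasis 2) (bg9YR (Matrix (Fin 2) (Fin 2) ℂ) (specialUnitaryUnits (Fin 2)) (regYPb335 (Matrix (Fin 2) (Fin 2) ℂ) (specialUnitaryUnits (Fin 2))) (regYPb336 (Matrix (Fin 2) (Fin 2) ℂ) (specialUnitaryUnits (Fin 2))) x) (fun U => U) (GpY x.toKIdx (parSymY x.toKIdx)) U) (fun a b => (BhW F) β' * Real.exp (-((δhW F) * (geo9Y x).dist a b)))) (CP : ∀ F : T4Family, ℝ)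
    (hCPge : ∀ F : T4Family, (((stage3OfFamily F).d₆ + 1 : ℕ) : ℝ) * (coordBound39 (trBasis 2) * basisBound39 (trBasis 2) * nearBlkCntY (stage3OfFamily F).d₆ (stage3OfFamily F).ℓ₆ (stage3OfFamily F).hd' (stage3OfFamily F).hL' (stage3OfFamily F).b₀ (stage3OfFamily F).b₁ (Mstar F) * ((max 1 (2 : ℝ) * ((nbrCountY (stage3OfFamily F).d₆ (stage3OfFamily F).ℓ₆ (stage3OfFamily F).hd' (stage3OfFamily F).hL' (stage3OfFamily F).b₀ (stage3OfFamily F).b₁ 2 : ℝ) * (p F).C (B9RWSums347DefiniteFaces.exp261 (@geo9Y (stage3OfFamily F).d₆ (stage3OfFamily F).ℓ₆ (stage3OfFamily F).hd' (stage3OfFamily F).hL' (stage3OfFamily F).b₀ (stage3OfFamily F).b₁ (Mstar F)) (p F).δ₀ (p F).α) * Real.exp (2 * ((1 - 2 * (p F).α) * (p F).δ₀)))) * (cR39 (basis39 (Matrix (Fin 2) (Fin 2) ℂ)) * Fintype.card (κ39 (Matrix (Fin 2) (Fin 2) ℂ)) * (B39 F) * Real.exp (2 * (δ39 F))) * (max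 1 (2 : ℝ) * ((nbrCountY (stage3OfFamily F).d₆ (stage3OfFamily F).ℓ₆ (stage3OfFamily F).hd' (stage3OfFamily F).hL' (stage3OfFamily F).b₀ (stage3OfFamily F).b₁ 2 : ℝ) * (p F).C (B9RWSums347DefiniteFaces.exp261 (@geo9Y (stage3OfFamily F).d₆ (stage3OfFamily F).ℓ₆ (stage3OfFamily F).hd' (stage3OfFamily F).hL' (stage3OfFamily F).b₀ (stage3OfFamily F).b₁ (Mstar F)) (p F).δ₀ (p F).α) * Real.exp (2 * ((1 - 2 * (p F).α) * (p F).δ₀)))) * cg349 (stage3OfFamily F).d₆ (stage3OfFamily F).ℓ₆ (stage3OfFamily F).hd' (stage3OfFamily F).hL' (stage3OfFamily F).b₀ (stage3OfFamily F).b₁ ((1 - 2 * (p F).α) * (p F).δ₀) (δ39 F)) * Real.exp (2 * (min ((1 - 2 * (p F).α) * (p F).δ₀) (δ39 F) / 8))) ≤ (CP F)) (hBxW : ∀ F : T4Family, ∀ β', 0 ≤ β' → β' < 1 → (cR39 (trBasis 2))⁻¹ * (((wX F) ((sch F) β'))⁻¹ * (B45W F) β' + (BhW F) β' * ((CP F)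 * ((((stage3OfFamily F).ℓ₆ + 1 : ℕ) : ℝ))) * (((wX F) ((sch F) β'))⁻¹ * (((((stage3OfFamily F).ℓ₆ + 1 : ℕ) : ℝ)) * Real.exp (((δFW F) - (αW F) * (δFW F) - (σW F)) * (rNear (stage3OfFamily F).d₆ (stage3OfFamily F).ℓ₆ + 1)))) * rowConst261 (@geo9Y (stage3OfFamily F).d₆ (stage3OfFamily F).ℓ₆ (stage3OfFamily F).hd' (stage3OfFamily F).hL' (stage3OfFamily F).b₀ (stage3OfFamily F).b₁ (Mstar F)) (σW F) * rowConst261 (@geo9Y (stage3OfFamily F).d₆ (stage3OfFamily F).ℓ₆ (stage3OfFamily F).hd' (stage3OfFamily F).hL' (stage3OfFamily F).b₀ (stage3OfFamily F).b₁ (Mstar F)) (σW F)) ≤ (Bx13 F) β')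
    (h45Y : ∀ F : T4Family, ∀ x : MemberY (stage3OfFamily F).d₆ (stage3OfFamily F).ℓ₆ (stage3OfFamily F).hd' (stage3OfFamily F).hL' (stage3OfFamily F).b₀ (stage3OfFamily F).b₁ (Mstar F), letI : Fintype (B9GeoNormsKLevelV1.geo9K x.toKIdx).Site := (inferInstance : Fintype (geo9Y x).Site); (M12 F) ≤ (geo9Y x).M → ∀ α₀ : ℝ, 0 < α₀ → (geo9Y x).M * α₀ ≤ (a12 F) → ∀ U : (bg9YP (Matrix (Fin 2) (Fin 2) ℂ) (specialUnitaryUnits (Fin 2)) x).Cfg, (bg9YP (Matrix (Fin 2) (Fin 2) ℂ) (specialUnitaryUnits (Fin 2)) x).Reg335 c35Y α₀ U → (bg9YP (Matrix (Fin 2) (Fin 2) ℂ) (specialUnitaryUnits (Fin 2)) x).Reg336 c35Y α₀ U → ∀ (β' : ℝ) (h0 : 0 ≤ β') (h1 : β' < 1) (μ : Fin ((stage3OfFamily F).d₆ + 1)), HasMaj (bHZKP (κ := TrIdx 2) x.toKIdx (trBasis 2) (taxiB x.toKIdx (bg9YR (Matrix (Fin 2) (Fin 2) ℂ) (specialUnitaryUnits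 (Fin 2)) (regYPb335 (Matrix (Fin 2) (Fin 2) ℂ) (specialUnitaryUnits (Fin 2))) (regYPb336 (Matrix (Fin 2) (Fin 2) ℂ) (specialUnitaryUnits (Fin 2))) x) (fun U => U) U) (R := (1 : ℝ)) (H := (H F) x) ((hsch0 F) β' h0 h1).le ((hsch1 F) β' h0 h1).le) (cNormR 1 ((H F) x) ((𝔭A F) x).blkPY (fun y => (geo9Y_len_pos x y).le) (β' - 1)) (((𝔭A F) x).ΦY U β' ∘ₗ (((𝔬12 F) x).D U ∘ₗ (((𝔬12 F) x).G0 U ∘ₗ ((𝔡A F) x).Dsd U μ))) (fun a a' => (BiY F) β' * Real.exp (-((δ45Y F) * (geo9Y x).dist a a')))) (hLL2 : ∀ F : T4Family, ∀ x : MemberY (stage3OfFamily F).d₆ (stage3OfFamily F).ℓ₆ (stage3OfFamily F).hd' (stage3OfFamily F).hL' (stage3OfFamily F).b₀ (stage3OfFamily F).b₁ (Mstar F), (M12 F) ≤ (geo9Y x).M → ∀ α₀ : ℝ, 0 < α₀ → (geo9Y x).M * α₀ ≤ (a12 F) → ∀ U : (bg9YP (Matrix (Fin 2) (Fin 2) ℂ)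 (specialUnitaryUnits (Fin 2)) x).Cfg, (bg9YP (Matrix (Fin 2) (Fin 2) ℂ) (specialUnitaryUnits (Fin 2)) x).Reg335 c35Y α₀ U → (bg9YP (Matrix (Fin 2) (Fin 2) ℂ) (specialUnitaryUnits (Fin 2)) x).Reg336 c35Y α₀ U → Letters313L2Pk ((𝔬12 F) x) ((𝔡A F) x).Dd ((𝔡A F) x).Dsd 1 ((H F) x) (B13₄ F) (δ12₃ F) (fun y => Real.sqrt (((((stage3OfFamily F).ℓ₆ + 1 : ℕ) : ℝ) ^ ((stage3OfFamily F).d₆ + 1)) ^ lvl x.hN x.D x.hk y)⁻¹) (fun y => Real.sqrt_pos.2 (plateau_pos x.toKIdx y)) U ∧ Letters313L2MZ ((𝔬12 F) x) ((𝔡A F) x).Dd ((𝔡A F) x).Dsd 1 ((H F) x) (B13₄ F) (δ12₃ F) (fun y => Real.sqrt (((((stage3OfFamily F).ℓ₆ + 1 : ℕ) : ℝ) ^ ((stage3OfFamily F).d₆ + 1)) ^ lvl x.hN x.D x.hk y)⁻¹) (fun y => Real.sqrt_pos.2 (plateau_pos x.toKIdx y)) U)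
    (hLIM : ∀ F : T4Family, ∀ x : MemberY (stage3OfFamily F).d₆ (stage3OfFamily F).ℓ₆ (stage3OfFamily F).hd' (stage3OfFamily F).hL' (stage3OfFamily F).b₀ (stage3OfFamily F).b₁ (Mstar F), (M12 F) ≤ (geo9Y x).M → ∀ α₀ : ℝ, 0 < α₀ → (geo9Y x).M * α₀ ≤ (a12 F) → ∀ U : (bg9YP (Matrix (Fin 2) (Fin 2) ℂ) (specialUnitaryUnits (Fin 2)) x).Cfg, (bg9YP (Matrix (Fin 2) (Fin 2) ℂ) (specialUnitaryUnits (Fin 2)) x).Reg335 c35Y α₀ U → (bg9YP (Matrix (Fin 2) (Fin 2) ℂ) (specialUnitaryUnits (Fin 2)) x).Reg336 c35Y α₀ U → Letters313IML ((𝔬12 F) x) ((𝔭A F) x) ((𝔡A F) x).Dd ((𝔡A F) x).Dsd 1 ((H F) x) (fun y => (geo9Y_len_pos x y).le) ((bHXA F) x) ((bHX F) x) (Br13 F) (fun ε => (θV13 F) ε * ((geo9Y x).M * α₀)) (Bd13 F) (Bd2₁₃ F) (δ12₃ F) (δK12 F) U) (hZ : ∀ F : T4Family, ∀ x : MemberY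 (stage3OfFamily F).d₆ (stage3OfFamily F).ℓ₆ (stage3OfFamily F).hd' (stage3OfFamily F).hL' (stage3OfFamily F).b₀ (stage3OfFamily F).b₁ (Mstar F), (M12 F) ≤ (geo9Y x).M → ∀ α₀ : ℝ, 0 < α₀ → (geo9Y x).M * α₀ ≤ (a12 F) → ∀ U : (bg9YP (Matrix (Fin 2) (Fin 2) ℂ) (specialUnitaryUnits (Fin 2)) x).Cfg, (bg9YP (Matrix (Fin 2) (Fin 2) ℂ) (specialUnitaryUnits (Fin 2)) x).Reg335 c35Y α₀ U → (bg9YP (Matrix (Fin 2) (Fin 2) ℂ) (specialUnitaryUnits (Fin 2)) x).Reg336 c35Y α₀ U → QY x.toKIdx (parBY x.toKIdx) U ∘ₗ gradY x.toKIdx U ∘ₗ GpPhysY x.toKIdx (parSymY x.toKIdx) U ∘ₗ RY x.toKIdx (parSymY x.toKIdx) (GpPhysY x.toKIdx (parSymY x.toKIdx)) U = 0) (hdgQs : ∀ F : T4Family, ∀ x : MemberY (stage3OfFamily F).d₆ (stage3OfFamily F).ℓ₆ (stage3OfFamily F).hd' (stage3OfFamily F).hL' (stage3OfFamily F).b₀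 (stage3OfFamily F).b₁ (Mstar F), (M12 F) ≤ (geo9Y x).M → ∀ α₀ : ℝ, 0 < α₀ → (geo9Y x).M * α₀ ≤ (a12 F) → ∀ U : (bg9YP (Matrix (Fin 2) (Fin 2) ℂ) (specialUnitaryUnits (Fin 2)) x).Cfg, (bg9YP (Matrix (Fin 2) (Fin 2) ℂ) (specialUnitaryUnits (Fin 2)) x).Reg335 c35Y α₀ U → (bg9YP (Matrix (Fin 2) (Fin 2) ℂ) (specialUnitaryUnits (Fin 2)) x).Reg336 c35Y α₀ U → HasMaj (weightNorm (BlockNorm.ofBlocks (toB6 (geo9Y x) 1 ((H F) x)) ((𝔬12 F) x).blkZ) (fun y => (((((stage3OfFamily F).ℓ₆ + 1 : ℕ) : ℝ) ^ ((stage3OfFamily F).d₆ + 1)) ^ lvl x.hN x.D x.hk y)⁻¹) (fun y => (plateau_pos x.toKIdx y).le)) (cNorm 1 ((H F) x) ((𝔬12 F) x).blkY (fun y => (geo9Y_len_pos x y).le) 1) (((𝔬12 F) x).D U ∘ₗ ((𝔬12 F) x).G0 U ∘ₗ ((𝔬12 F) x).Qstar U) (fun a b => (B12₃ F) * Real.exp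 (-((δ12₃ F) * (geo9Y x).dist a b))))
    (hdgQsd : ∀ F : T4Family, ∀ x : MemberY (stage3OfFamily F).d₆ (stage3OfFamily F).ℓ₆ (stage3OfFamily F).hd' (stage3OfFamily F).hL' (stage3OfFamily F).b₀ (stage3OfFamily F).b₁ (Mstar F), (M12 F) ≤ (geo9Y x).M → ∀ α₀ : ℝ, 0 < α₀ → (geo9Y x).M * α₀ ≤ (a12 F) → ∀ U : (bg9YP (Matrix (Fin 2) (Fin 2) ℂ) (specialUnitaryUnits (Fin 2)) x).Cfg, (bg9YP (Matrix (Fin 2) (Fin 2) ℂ) (specialUnitaryUnits (Fin 2)) x).Reg335 c35Y α₀ U → (bg9YP (Matrix (Fin 2) (Fin 2) ℂ) (specialUnitaryUnits (Fin 2)) x).Reg336 c35Y α₀ U → ∀ ν : Fin ((stage3OfFamily F).d₆ + 1), HasMaj (weightNorm (BlockNorm.ofBlocks (toB6 (geo9Y x) 1 ((H F) x)) ((𝔬12 F) x).blkZ) (fun y => (((((stage3OfFamily F).ℓ₆ + 1 : ℕ) : ℝ) ^ ((stage3OfFamily F).d₆ + 1)) ^ lvl x.hN x.D x.hk y)⁻¹)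 (fun y => (plateau_pos x.toKIdx y).le)) (cNorm 1 ((H F) x) ((𝔬12 F) x).blk (fun y => (geo9Y_len_pos x y).le) 1) (((𝔡A F) x).Dd U ν ∘ₗ ((𝔬12 F) x).G0 U ∘ₗ ((𝔬12 F) x).Qstar U) (fun a b => (B12₃ F) * Real.exp (-((δ12₃ F) * (geo9Y x).dist a b)))) (hpQd : ∀ F : T4Family, ∀ x : MemberY (stage3OfFamily F).d₆ (stage3OfFamily F).ℓ₆ (stage3OfFamily F).hd' (stage3OfFamily F).hL' (stage3OfFamily F).b₀ (stage3OfFamily F).b₁ (Mstar F), (M12 F) ≤ (geo9Y x).M → ∀ α₀ : ℝ, 0 < α₀ → (geo9Y x).M * α₀ ≤ (a12 F) → ∀ U : (bg9YP (Matrix (Fin 2) (Fin 2) ℂ) (specialUnitaryUnits (Fin 2)) x).Cfg, (bg9YP (Matrix (Fin 2) (Fin 2) ℂ) (specialUnitaryUnits (Fin 2)) x).Reg335 c35Y α₀ U → (bg9YP (Matrix (Fin 2) (Fin 2) ℂ) (specialUnitaryUnits (Fin 2)) x).Reg336 c35Y α₀ U → ∀ (ν : Fin ((stage3OfFamily F).d₆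 + 1)) (β : ℝ), 0 ≤ β → β < 1 → HasMaj (weightNorm (BlockNorm.ofBlocks (toB6 (geo9Y x) 1 ((H F) x)) ((𝔬12 F) x).blkZ) (fun y => (((((stage3OfFamily F).ℓ₆ + 1 : ℕ) : ℝ) ^ ((stage3OfFamily F).d₆ + 1)) ^ lvl x.hN x.D x.hk y)⁻¹) (fun y => (plateau_pos x.toKIdx y).le)) (cNormR 1 ((H F) x) ((𝔭A F) x).blkPX (fun y => (geo9Y_len_pos x y).le) (β - 1)) ((((𝔭A F) x).ΦX U β ∘ₗ ((𝔡A F) x).Dd U ν ∘ₗ ((𝔬12 F) x).G0 U) ∘ₗ ((𝔬12 F) x).Qstar U) (fun a b => (Bq12 F) β * Real.exp (-((δ12₃ F) * (geo9Y x).dist a b)))) (s44 : ∀ F : T4Family, ℝ) (hs440 : ∀ F : T4Family, 0 < (s44 F)) (hs441 : ∀ F : T4Family, (s44 F) < 1) (hws44 : ∀ F : T4Family, 0 < (w13 F) (s44 F)) (δ44 : ∀ F : T4Family, ℝ) (hδ44 : ∀ F : T4Family, (δ12₃ F) < (δ44 F)) (Bi44 : ∀ F : T4Family, ℝ) (hBi44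 : ∀ F : T4Family, 0 ≤ (Bi44 F))
    (hB12₃d : ∀ F : T4Family, (((stage3OfFamily F).d₆ : ℝ) + 1) * ((1 + CLip (stage3OfFamily F).d₆ (stage3OfFamily F).ℓ₆) * (Bi44 F) * (CJG (stage3OfFamily F).d₆ (stage3OfFamily F).ℓ₆ (trBasis 2) (s44 F) (thetaL (stage3OfFamily F).d₆ (stage3OfFamily F).ℓ₆ (ϑF F)) ((w13 F) (s44 F)) ((δ12₃ F) + 1 + 1 / 2 * ((δ44 F) - (δ12₃ F))) * ((((stage3OfFamily F).ℓ₆ + 1 : ℕ) : ℝ))) * rowConst261 (@geo9Y (stage3OfFamily F).d₆ (stage3OfFamily F).ℓ₆ (stage3OfFamily F).hd' (stage3OfFamily F).hL' (stage3OfFamily F).b₀ (stage3OfFamily F).b₁ (Mstar F)) 1) ≤ (B12₃ F)) (hB12₃p : ∀ F : T4Family, (((stage3OfFamily F).d₆ : ℝ) + 1) * (1 * ((((stage3OfFamily F).d₆ : ℝ) + 1) * ((1 + CLip (stage3OfFamily F).d₆ (stage3OfFamily F).ℓ₆) * (Bi44 F) * (CJG (stage3OfFamily F).d₆ (stage3OfFamily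 F).ℓ₆ (trBasis 2) (s44 F) (thetaL (stage3OfFamily F).d₆ (stage3OfFamily F).ℓ₆ (ϑF F)) ((w13 F) (s44 F)) ((δ12₃ F) + 1 + 1 / 2 * ((δ44 F) - (δ12₃ F))) * ((((stage3OfFamily F).ℓ₆ + 1 : ℕ) : ℝ))) * rowConst261 (@geo9Y (stage3OfFamily F).d₆ (stage3OfFamily F).ℓ₆ (stage3OfFamily F).hd' (stage3OfFamily F).hL' (stage3OfFamily F).b₀ (stage3OfFamily F).b₁ (Mstar F)) 1)) * rowConst261 (@geo9Y (stage3OfFamily F).d₆ (stage3OfFamily F).ℓ₆ (stage3OfFamily F).hd' (stage3OfFamily F).hL' (stage3OfFamily F).b₀ (stage3OfFamily F).b₁ (Mstar F)) 1) ≤ (B12₃ F))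
    (h44m : ∀ F : T4Family, ∀ x : MemberY (stage3OfFamily F).d₆ (stage3OfFamily F).ℓ₆ (stage3OfFamily F).hd' (stage3OfFamily F).hL' (stage3OfFamily F).b₀ (stage3OfFamily F).b₁ (Mstar F), letI : Fintype (B9GeoNormsKLevelV1.geo9K x.toKIdx).Site := (inferInstance : Fintype (geo9Y x).Site); (M12 F) ≤ (geo9Y x).M → ∀ α₀ : ℝ, 0 < α₀ → (geo9Y x).M * α₀ ≤ (a12 F) → ∀ U : (bg9YP (Matrix (Fin 2) (Fin 2) ℂ) (specialUnitaryUnits (Fin 2)) x).Cfg, (bg9YP (Matrix (Fin 2) (Fin 2) ℂ) (specialUnitaryUnits (Fin 2)) x).Reg335 c35Y α₀ U → (bg9YP (Matrix (Fin 2) (Fin 2) ℂ) (specialUnitaryUnits (Fin 2)) x).Reg336 c35Y α₀ U → ∀ ν μ : Fin ((stage3OfFamily F).d₆ + 1), HasMaj (bHZKP (κ := TrIdx 2) x.toKIdx (trBasis 2) (taxiB x.toKIdx (bg9YR (Matrix (Fin 2) (Fin 2) ℂ) (specialUnitaryUnits (Fin 2)) (regYPb335 (Matrix (Fin 2) (Fin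 2) ℂ) (specialUnitaryUnits (Fin 2))) (regYPb336 (Matrix (Fin 2) (Fin 2) ℂ) (specialUnitaryUnits (Fin 2))) x) (fun U => U) U) (R := (1 : ℝ)) (H := (H F) x) (hs440 F).le (hs441 F).le) (cNorm 1 ((H F) x) ((𝔬12 F) x).blk (fun y => (geo9Y_len_pos x y).le) 1) (((𝔡A F) x).Dd U ν ∘ₗ (((𝔬12 F) x).G0 U ∘ₗ ((𝔡A F) x).Dsd U μ)) (fun a a' => (Bi44 F) * Real.exp (-((δ44 F) * (geo9Y x).dist a a'))))
    (hZ8 : ∀ F : T4Family, ∀ x : MemberY (stage3OfFamily F).d₆ (stage3OfFamily F).ℓ₆ (stage3OfFamily F).hd' (stage3OfFamily F).hL' (stage3OfFamily F).b₀ (stage3OfFamily F).b₁ (Mstar F), letI : Fintype (B9GeoNormsKLevelV1.geo9K x.toKIdx).Site := (inferInstance : Fintype (geo9Y x).Site); (M12 F) ≤ (geo9Y x).M → ∀ α₀ : ℝ, 0 < α₀ → (geo9Y x).M * α₀ ≤ (a12 F) → ∀ U : (bg9YP (Matrix (Fin 2) (Fin 2) ℂ) (specialUnitaryUnits (Fin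 2)) x).Cfg, (bg9YP (Matrix (Fin 2) (Fin 2) ℂ) (specialUnitaryUnits (Fin 2)) x).Reg335 c35Y α₀ U → (bg9YP (Matrix (Fin 2) (Fin 2) ℂ) (specialUnitaryUnits (Fin 2)) x).Reg336 c35Y α₀ U → HasMaj (cNorm 1 ((H F) x) ((𝔬12 F) x).blkW (fun y => (geo9Y_len_pos x y).le) 1) (cNorm 1 ((H F) x) ((𝔬12 F) x).blk (fun y => (geo9Y_len_pos x y).le) 2) (((𝔬12 F) x).G0 U ∘ₗ ((𝔬12 F) x).Dv U) (fun a b => (B12₃ F) * Real.exp (-((δ12₃ F) * (geo9Y x).dist a b))) ∧ HasMaj (weightNorm (BlockNorm.ofBlocks (toB6 (geo9Y x) 1 ((H F) x)) ((𝔬12 F) x).blkZ) (fun y => (((((stage3OfFamily F).ℓ₆ + 1 : ℕ) : ℝ) ^ ((stage3OfFamily F).d₆ + 1)) ^ lvl x.hN x.D x.hk y)⁻¹) (fun y => (plateau_pos x.toKIdx y).le)) (cNorm 1 ((H F) x) ((𝔬12 F) x).blk (fun y => (geo9Y_len_pos x y).le) 2) (((𝔬12 F) x).G0 U ∘ₗ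 ((𝔬12 F) x).Qstar U) (fun a b => (B12₃ F) * Real.exp (-((δ12₃ F) * (geo9Y x).dist a b))) ∧ HasMaj (weightNorm (BlockNorm.ofBlocks (toB6 (geo9Y x) 1 ((H F) x)) ((𝔬12 F) x).blkZ) (fun y => (geo9Y x).len y * (fun y => (((((stage3OfFamily F).ℓ₆ + 1 : ℕ) : ℝ) ^ ((stage3OfFamily F).d₆ + 1)) ^ lvl x.hN x.D x.hk y)⁻¹) y) (fun y => (mul_pos (geo9Y_len_pos x y) (plateau_pos x.toKIdx y)).le)) (cNorm 1 ((H F) x) ((𝔬12 F) x).blk (fun y => (geo9Y_len_pos x y).le) 1) (((𝔬12 F) x).G0 U ∘ₗ ((𝔬12 F) x).Qstar U) (fun a b => (B12₃ F) * Real.exp (-((δ12₃ F) * (geo9Y x).dist a b))) ∧ HasMaj (cNorm 1 ((H F) x) ((𝔬12 F) x).blk (fun y => (geo9Y_len_pos x y).le) 0) (cNorm 1 ((H F) x) ((𝔬12 F) x).blkW (fun y => (geo9Y_len_pos x y).le) 1) (((𝔬12 F) x).R U ∘ₗ ((𝔬12 F) x).Dvstar U ∘ₗ ((𝔬12 F)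 x).G1 U ∘ₗ LinearMap.id) (fun a b => (B12₃ F) * Real.exp (-((δ12₃ F) * (geo9Y x).dist a b))) ∧ HasMaj (cNorm 1 ((H F) x) ((𝔬12 F) x).blkZ (fun y => (geo9Y_len_pos x y).le) 2) (weightNorm (BlockNorm.ofBlocks (toB6 (geo9Y x) 1 ((H F) x)) ((𝔬12 F) x).blkZ) (fun y => (((((stage3OfFamily F).ℓ₆ + 1 : ℕ) : ℝ) ^ ((stage3OfFamily F).d₆ + 1)) ^ lvl x.hN x.D x.hk y)⁻¹) (fun y => (plateau_pos x.toKIdx y).le)) (((𝔬12 F) x).C1 U) (fun a b => (B12₃ F) * Real.exp (-((δ12₃ F) * (geo9Y x).dist a b))) ∧ HasMaj (cNorm 1 ((H F) x) ((𝔬12 F) x).blkZ (fun y => (geo9Y_len_pos x y).le) 1) (weightNorm (BlockNorm.ofBlocks (toB6 (geo9Y x) 1 ((H F) x)) ((𝔬12 F) x).blkZ) (fun y => (geo9Y x).len y * (fun y => (((((stage3OfFamily F).ℓ₆ + 1 : ℕ) : ℝ) ^ ((stage3OfFamily F).d₆ + 1)) ^ lvl x.hN x.D x.hk y)⁻¹)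 y) (fun y => (mul_pos (geo9Y_len_pos x y) (plateau_pos x.toKIdx y)).le)) (((𝔬12 F) x).C1 U) (fun a b => (B12₃ F) * Real.exp (-((δ12₃ F) * (geo9Y x).dist a b))) ∧ HasMaj (cNorm 1 ((H F) x) ((𝔬12 F) x).blk (fun y => (geo9Y_len_pos x y).le) 2) (cNorm 1 ((H F) x) ((𝔬12 F) x).blkZ (fun y => (geo9Y_len_pos x y).le) 2) (((𝔬12 F) x).Q U) (fun a b => (B12₃ F) * Real.exp (-((δ12₃ F) * (geo9Y x).dist a b))) ∧ HasMaj (cNorm 1 ((H F) x) ((𝔬12 F) x).blk (fun y => (geo9Y_len_pos x y).le) 1) (cNorm 1 ((H F) x) ((𝔬12 F) x).blkZ (fun y => (geo9Y_len_pos x y).le) 1) (((𝔬12 F) x).Q U) (fun a b => (B12₃ F) * Real.exp (-((δ12₃ F) * (geo9Y x).dist a b))))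
    (hwX44 : ∀ F : T4Family, 0 < (wX F) (s44 F)) (B44G δ44G : ∀ F : T4Family, ℝ) (hB44G : ∀ F : T4Family, 0 ≤ (B44G F)) (hδ44G : ∀ F : T4Family, (δFW F) - (αW F) * (δFW F) - 2 * (σW F) ≤ (δ44G F)) (h44G : ∀ F : T4Family, ∀ x : MemberY (stage3OfFamily F).d₆ (stage3OfFamily F).ℓ₆ (stage3OfFamily F).hd' (stage3OfFamily F).hL' (stage3OfFamily F).b₀ (stage3OfFamily F).b₁ (Mstar F), letI : Fintype (B9GeoNormsKLevelV1.geo9K x.toKIdx).Site := (inferInstance : Fintype (geo9Y x).Site); (M12 F) ≤ (geo9Y x).M → ∀ α₀ : ℝ, 0 < α₀ → (geo9Y x).M * α₀ ≤ (a12 F) → ∀ U : (bg9YP (Matrix (Fin 2) (Fin 2) ℂ) (specialUnitaryUnits (Fin 2)) x).Cfg, (bg9YP (Matrix (Fin 2) (Fin 2) ℂ) (specialUnitaryUnits (Fin 2)) x).Reg335 c35Y α₀ U → (bg9YP (Matrix (Fin 2) (Fin 2) ℂ) (specialUnitaryUnits (Fin 2)) x).Reg336 c35Y α₀ U → HasMaj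 (bHZKP (κ := TrIdx 2) x.toKIdx (trBasis 2) (taxiB x.toKIdx (bg9YR (Matrix (Fin 2) (Fin 2) ℂ) (specialUnitaryUnits (Fin 2)) (regYPb335 (Matrix (Fin 2) (Fin 2) ℂ) (specialUnitaryUnits (Fin 2))) (regYPb336 (Matrix (Fin 2) (Fin 2) ℂ) (specialUnitaryUnits (Fin 2))) x) (fun U => U) U) (R := (1 : ℝ)) (H := (H F) x) (hs440 F).le (hs441 F).le) (cNorm 1 ((H F) x) ((𝔬12 F) x).blk (fun y => (geo9Y_len_pos x y).le) 1) (((𝔬12 F) x).Dv U ∘ₗ GcoS x.toKIdx (trBasis 2) (bg9YR (Matrix (Fin 2) (Fin 2) ℂ) (specialUnitaryUnits (Fin 2)) (regYPb335 (Matrix (Fin 2) (Fin 2) ℂ) (specialUnitaryUnits (Fin 2))) (regYPb336 (Matrix (Fin 2) (Fin 2) ℂ) (specialUnitaryUnits (Fin 2))) x) (fun U => U) (GpY x.toKIdx (parSymY x.toKIdx)) U ∘ₗ ((𝔬12 F) x).Dvstar U) (fun a b => (B44G F) * Real.exp (-((δ44G F) * (geo9Y x).dist a b))))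
    (hB₃wG : ∀ F : T4Family, (cR39 (trBasis 2))⁻¹ * (((wX F) (s44 F))⁻¹ * (B44G F) + ((((stage3OfFamily F).d₆ + 1 : ℕ) : ℝ) * (p F).C (B9RWSums347DefiniteFaces.exp261 (@geo9Y (stage3OfFamily F).d₆ (stage3OfFamily F).ℓ₆ (stage3OfFamily F).hd' (stage3OfFamily F).hL' (stage3OfFamily F).b₀ (stage3OfFamily F).b₁ (Mstar F)) (p F).δ₀ (p F).α)) * ((CP F) * ((((stage3OfFamily F).ℓ₆ + 1 : ℕ) : ℝ))) * (((wX F) (s44 F))⁻¹ * (((((stage3OfFamily F).ℓ₆ + 1 : ℕ) : ℝ)) * Real.exp (((δFW F) - (αW F) * (δFW F) - (σW F)) * (rNear (stage3OfFamily F).d₆ (stage3OfFamily F).ℓ₆ + 1)))) * rowConst261 (@geo9Y (stage3OfFamily F).d₆ (stage3OfFamily F).ℓ₆ (stage3OfFamily F).hd' (stage3OfFamily F).hL' (stage3OfFamily F).b₀ (stage3OfFamily F).b₁ (Mstar F)) (σW F) * rowConst261 (@geo9Y (stage3OfFamily F).d₆ (stage3OfFamily F).ℓ₆ (stage3OfFamily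 F).hd' (stage3OfFamily F).hL' (stage3OfFamily F).b₀ (stage3OfFamily F).b₁ (Mstar F)) (σW F)) ≤ (B12₃ F)) (θK δKG B₀G δ₀G ρG BHG : ∀ F : T4Family, ℝ) (BhG θHG : ∀ F : T4Family, ℝ → ℝ) (hθK : ∀ F : T4Family, 0 ≤ (θK F)) (hθHG : ∀ F : T4Family, ∀ s, 0 < s → s < 1 → 0 ≤ (θHG F) s) (hB₀G : ∀ F : T4Family, 0 ≤ (B₀G F)) (hBhG : ∀ F : T4Family, ∀ s, 0 < s → s < 1 → 0 ≤ (BhG F) s) (hBHG : ∀ F : T4Family, 0 ≤ (BHG F)) (hρG : ∀ F : T4Family, 0 ≤ (ρG F)) (hρSG : ∀ F : T4Family, (ρG F) ≤ (δ₀G F)) (hρδG : ∀ F : T4Family, (ρG F) + (σW F) ≤ (δKG F)) (hqG : ∀ F : T4Family, (θK F) * rowConst261 (@geo9Y (stage3OfFamily F).d₆ (stage3OfFamily F).ℓ₆ (stage3OfFamily F).hd' (stage3OfFamily F).hL' (stage3OfFamily F).b₀ (stage3OfFamily F).b₁ (Mstar F)) (σW F) < 1) (hwBG : ∀ F : T4Family,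 ∀ s, 0 < s → s < 1 → (wX F) s * ((BhG F) s + (θHG F) s * ((B₀G F) * (1 - (θK F) * rowConst261 (@geo9Y (stage3OfFamily F).d₆ (stage3OfFamily F).ℓ₆ (stage3OfFamily F).hd' (stage3OfFamily F).hL' (stage3OfFamily F).b₀ (stage3OfFamily F).b₁ (Mstar F)) (σW F))⁻¹) * rowConst261 (@geo9Y (stage3OfFamily F).d₆ (stage3OfFamily F).ℓ₆ (stage3OfFamily F).hd' (stage3OfFamily F).hL' (stage3OfFamily F).b₀ (stage3OfFamily F).b₁ (Mstar F)) (σW F)) ≤ (BHG F))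
    (hB₃g : ∀ F : T4Family, ((((stage3OfFamily F).ℓ₆ + 1 : ℕ) : ℝ)) * Real.exp ((ρG F) * (rNear (stage3OfFamily F).d₆ (stage3OfFamily F).ℓ₆ + 1)) * ((B₀G F) * (1 - (θK F) * rowConst261 (@geo9Y (stage3OfFamily F).d₆ (stage3OfFamily F).ℓ₆ (stage3OfFamily F).hd' (stage3OfFamily F).hL' (stage3OfFamily F).b₀ (stage3OfFamily F).b₁ (Mstar F)) (σW F))⁻¹ + (BHG F)) ≤ (B12₃ F)) (hδ₃g : ∀ F : T4Family, (δ12₃ F) ≤ (ρG F)) (hG0P : ∀ F : T4Family, ∀ x : MemberY (stage3OfFamily F).d₆ (stage3OfFamily F).ℓ₆ (stage3OfFamily F).hd' (stage3OfFamily F).hL' (stage3OfFamily F).b₀ (stage3OfFamily F).b₁ (Mstar F), letI : Fintype (B9GeoNormsKLevelV1.geo9K x.toKIdx).Site := (inferInstance : Fintype (geo9Y x).Site); (M12 F) ≤ (geo9Y x).M → ∀ α₀ : ℝ, 0 < α₀ → (geo9Y x).M * α₀ ≤ (a12 F) → ∀ U : (bg9YP (Matrix (Fin 2) (Fin 2)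 ℂ) (specialUnitaryUnits (Fin 2)) x).Cfg, (bg9YP (Matrix (Fin 2) (Fin 2) ℂ) (specialUnitaryUnits (Fin 2)) x).Reg335 c35Y α₀ U → (bg9YP (Matrix (Fin 2) (Fin 2) ℂ) (specialUnitaryUnits (Fin 2)) x).Reg336 c35Y α₀ U → HasMaj (cNorm 1 ((H F) x) ((𝔬12 F) x).blk (fun y => (geo9Y_len_pos x y).le) 1) (cNorm 1 ((H F) x) ((𝔬12 F) x).blk (fun y => (geo9Y_len_pos x y).le) 1) (((𝔬12 F) x).G0 U ∘ₗ (((𝔬12 F) x).Tpi U + ((𝔬12 F) x).T2 U)) (fun a b => (θK F) * Real.exp (-((δKG F) * (geo9Y x).dist a b))) ∧ HasMajorantHom (g := toB6 (geo9Y x) 1 ((H F) x)) ((𝔬12 F) x).blkY ((𝔬12 F) x).blk (((𝔬12 F) x).G0 U ∘ₗ ((𝔬12 F) x).Dstar U) (fun a b => (B₀G F) * (geo9Y x).len a * Real.exp (-((δ₀G F) * (geo9Y x).dist a b))) ∧ (∀ s' : ℝ, 0 < s' → s' < 1 → HasMajorantHom (g := toB6 (geo9Y x) 1 ((H F) x))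 ((𝔬12 F) x).blkY ((𝔭A F) x).blkPX (((𝔭A F) x).ΦX U s' ∘ₗ (((𝔬12 F) x).G0 U ∘ₗ ((𝔬12 F) x).Dstar U)) (fun (a b : (geo9Y x).Site) => (BhG F) s' * (geo9Y x).len a ^ (1 - s') * Real.exp (-((δ₀G F) * (geo9Y x).dist a b)))) ∧ (∀ s' : ℝ, 0 < s' → s' < 1 → HasMaj (cNormR 1 ((H F) x) ((𝔬12 F) x).blk (fun y => (geo9Y_len_pos x y).le) (-1)) (cNormR 1 ((H F) x) ((𝔭A F) x).blkPX (fun y => (geo9Y_len_pos x y).le) (s' - 1)) ((((𝔭A F) x).ΦX U s' ∘ₗ ((𝔬12 F) x).G0 U) ∘ₗ (((𝔬12 F) x).Tpi U + ((𝔬12 F) x).T2 U)) (fun a b => (θHG F) s' * Real.exp (-((δKG F) * (geo9Y x).dist a b))))) (B43 δ43 : ∀ F : T4Family, ℝ) (hB43 : ∀ F : T4Family, 0 ≤ (B43 F))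
    (h43Gp : ∀ F : T4Family, ∀ x : MemberY (stage3OfFamily F).d₆ (stage3OfFamily F).ℓ₆ (stage3OfFamily F).hd' (stage3OfFamily F).hL' (stage3OfFamily F).b₀ (stage3OfFamily F).b₁ (Mstar F), letI : Fintype (B9GeoNormsKLevelV1.geo9K x.toKIdx).Site := (inferInstance : Fintype (geo9Y x).Site); (M12 F) ≤ (geo9Y x).M → ∀ α₀ : ℝ, 0 < α₀ → (geo9Y x).M * α₀ ≤ (a12 F) → ∀ U : (bg9YP (Matrix (Fin 2) (Fin 2) ℂ) (specialUnitaryUnits (Fin 2)) x).Cfg, (bg9YP (Matrix (Fin 2) (Fin 2) ℂ) (specialUnitaryUnits (Fin 2)) x).Reg335 c35Y α₀ U → (bg9YP (Matrix (Fin 2) (Fin 2) ℂ) (specialUnitaryUnits (Fin 2)) x).Reg336 c35Y α₀ U → HasMaj (cNorm 1 ((H F) x) ((𝔬12 F) x).blk (fun y => (geo9Y_len_pos x y).le) 0) ((bH13 F) x U) (GcoS x.toKIdx (trBasis 2) (bg9YR (Matrix (Fin 2) (Fin 2) ℂ) (specialUnitaryUnits (Fin 2)) (regYPb335 (Matrix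 (Fin 2) (Fin 2) ℂ) (specialUnitaryUnits (Fin 2))) (regYPb336 (Matrix (Fin 2) (Fin 2) ℂ) (specialUnitaryUnits (Fin 2))) x) (fun U => U) (GpY x.toKIdx (parSymY x.toKIdx)) U ∘ₗ DvscoKH x.toKIdx (trBasis 2) (bg9YR (Matrix (Fin 2) (Fin 2) ℂ) (specialUnitaryUnits (Fin 2)) (regYPb335 (Matrix (Fin 2) (Fin 2) ℂ) (specialUnitaryUnits (Fin 2))) (regYPb336 (Matrix (Fin 2) (Fin 2) ℂ) (specialUnitaryUnits (Fin 2))) x) (fun U => U) U) (fun a b => (B43 F) * Real.exp (-((δ43 F) * (geo9Y x).dist a b)))) (ρrg : ∀ F : T4Family, ℝ) (hρrg0 : ∀ F : T4Family, 0 ≤ (ρrg F)) (hbudrg : ∀ F : T4Family, (ρrg F) + (σW F) + (αW F) * (δFW F) ≤ (δFW F)) (hbud43 : ∀ F : T4Family, (ρrg F) + (σW F) ≤ (δ43 F)) (hδ₃rg : ∀ F : T4Family, (δ12₃ F) ≤ (ρrg F)) (hbud43T : ∀ F : T4Family, (δT12 F) + (σS F) ≤ (δ43 F))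
    (hB₃rg : ∀ F : T4Family, (B43 F) * (cR39 (trBasis 2))⁻¹ * rowConst261 (@geo9Y (stage3OfFamily F).d₆ (stage3OfFamily F).ℓ₆ (stage3OfFamily F).hd' (stage3OfFamily F).hL' (stage3OfFamily F).b₀ (stage3OfFamily F).b₁ (Mstar F)) (σW F) + CTel (stage3OfFamily F).d₆ (stage3OfFamily F).ℓ₆ (trBasis 2) (ρrg F) ((CP F) * ((((stage3OfFamily F).ℓ₆ + 1 : ℕ) : ℝ)) * (((((stage3OfFamily F).d₆ + 1 : ℕ) : ℝ) * (p F).C (B9RWSums347DefiniteFaces.exp261 (@geo9Y (stage3OfFamily F).d₆ (stage3OfFamily F).ℓ₆ (stage3OfFamily F).hd' (stage3OfFamily F).hL' (stage3OfFamily F).b₀ (stage3OfFamily F).b₁ (Mstar F)) (p F).δ₀ (p F).α)) * (cR39 (trBasis 2))⁻¹ * rowConst261 (@geo9Y (stage3OfFamily F).d₆ (stage3OfFamily F).ℓ₆ (stage3OfFamily F).hd' (stage3OfFamily F).hL' (stage3OfFamily F).b₀ (stage3OfFamily F).b₁ (Mstar F)) (σW F)) * rowConst261 (@geo9Y (stage3OfFamily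 F).d₆ (stage3OfFamily F).ℓ₆ (stage3OfFamily F).hd' (stage3OfFamily F).hL' (stage3OfFamily F).b₀ (stage3OfFamily F).b₁ (Mstar F)) (σW F)) ((CP F) * ((((stage3OfFamily F).ℓ₆ + 1 : ℕ) : ℝ)) * (((((stage3OfFamily F).d₆ + 1 : ℕ) : ℝ) * (p F).C (B9RWSums347DefiniteFaces.exp261 (@geo9Y (stage3OfFamily F).d₆ (stage3OfFamily F).ℓ₆ (stage3OfFamily F).hd' (stage3OfFamily F).hL' (stage3OfFamily F).b₀ (stage3OfFamily F).b₁ (Mstar F)) (p F).δ₀ (p F).α)) * (cR39 (trBasis 2))⁻¹ * rowConst261 (@geo9Y (stage3OfFamily F).d₆ (stage3OfFamily F).ℓ₆ (stage3OfFamily F).hd' (stage3OfFamily F).hL' (stage3OfFamily F).b₀ (stage3OfFamily F).b₁ (Mstar F)) (σW F)) * rowConst261 (@geo9Y (stage3OfFamily F).d₆ (stage3OfFamily F).ℓ₆ (stage3OfFamily F).hd' (stage3OfFamily F).hL' (stage3OfFamily F).b₀ (stage3OfFamily F).b₁ (Mstar F)) (σW F)) ≤ (B12₃ F)) (E14₁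 E14₂ : ∀ F : T4Family, ∀ x : MemberY (stage3OfFamily F).d₆ (stage3OfFamily F).ℓ₆ (stage3OfFamily F).hd' (stage3OfFamily F).hL' (stage3OfFamily F).b₀ (stage3OfFamily F).b₁ (Mstar F), B9.RWExpansion (geo9Y x) (bg9YR (Matrix (Fin 2) (Fin 2) ℂ) (specialUnitaryUnits (Fin 2)) (regYPb335 (Matrix (Fin 2) (Fin 2) ℂ) (specialUnitaryUnits (Fin 2))) (regYPb336 (Matrix (Fin 2) (Fin 2) ℂ) (specialUnitaryUnits (Fin 2))) x)) (T14₁ : ∀ F : T4Family, ∀ x : MemberY (stage3OfFamily F).d₆ (stage3OfFamily F).ℓ₆ (stage3OfFamily F).hd' (stage3OfFamily F).hL' (stage3OfFamily F).b₀ (stage3OfFamily F).b₁ (Mstar F), ((E14₁ F) x).Walk → BondOpY (Matrix (Fin 2) (Fin 2) ℂ) x.toKIdx)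
    (T14₂ : ∀ F : T4Family, ∀ x : MemberY (stage3OfFamily F).d₆ (stage3OfFamily F).ℓ₆ (stage3OfFamily F).hd' (stage3OfFamily F).hL' (stage3OfFamily F).b₀ (stage3OfFamily F).b₁ (Mstar F), ((E14₂ F) x).Walk → BondOpY (Matrix (Fin 2) (Fin 2) ℂ) x.toKIdx) (X14₁ : ∀ F : T4Family, ∀ x : MemberY (stage3OfFamily F).d₆ (stage3OfFamily F).ℓ₆ (stage3OfFamily F).hd' (stage3OfFamily F).hL' (stage3OfFamily F).b₀ (stage3OfFamily F).b₁ (Mstar F), ((E14₁ F) x).Walk → ℕ → (geo9Y x).Site → Prop) (M14₁ : ∀ F : T4Family, ∀ x : MemberY (stage3OfFamily F).d₆ (stage3OfFamily F).ℓ₆ (stage3OfFamily F).hd' (stage3OfFamily F).hL' (stage3OfFamily F).b₀ (stage3OfFamily F).b₁ (Mstar F), ((E14₁ F) x).Walk → ℕ → Prop) (X14₂ : ∀ F : T4Family, ∀ x : MemberY (stage3OfFamily F).d₆ (stage3OfFamily F).ℓ₆ (stage3OfFamily F).hd' (stage3OfFamily F).hL' (stage3OfFamily F).b₀ (stage3OfFamily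 F).b₁ (Mstar F), ((E14₂ F) x).Walk → ℕ → (geo9Y x).Site → Prop) (M14₂ : ∀ F : T4Family, ∀ x : MemberY (stage3OfFamily F).d₆ (stage3OfFamily F).ℓ₆ (stage3OfFamily F).hd' (stage3OfFamily F).hL' (stage3OfFamily F).b₀ (stage3OfFamily F).b₁ (Mstar F), ((E14₂ F) x).Walk → ℕ → Prop) (diam14 : ∀ F : T4Family, MemberY (stage3OfFamily F).d₆ (stage3OfFamily F).ℓ₆ (stage3OfFamily F).hd' (stage3OfFamily F).hL' (stage3OfFamily F).b₀ (stage3OfFamily F).b₁ (Mstar F) → ℝ) (r14 : ∀ F : T4Family, ℝ) (hr14 : ∀ F : T4Family, ∀ x, (diam14 F) x ≤ (r14 F)) (near14₁ : ∀ F : T4Family, ∀ (x : MemberY (stage3OfFamily F).d₆ (stage3OfFamily F).ℓ₆ (stage3OfFamily F).hd' (stage3OfFamily F).hL' (stage3OfFamily F).b₀ (stage3OfFamily F).b₁ (Mstar F)) ω m pᵢ, (M14₁ F) x ω m → (X14₁ F) x ω m pᵢ → ∃ qᵢ, qᵢ ∈ OmegaC x.D x.D' ∧ tdistK (ℓ :=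 (stage3OfFamily F).ℓ₆) (Mh := x.Mh) (k := x.k) (P := x.P') (kLab x pᵢ) qᵢ ≤ (diam14 F) x) (first14₁ : ∀ F : T4Family, ∀ (x : MemberY (stage3OfFamily F).d₆ (stage3OfFamily F).ℓ₆ (stage3OfFamily F).hd' (stage3OfFamily F).hL' (stage3OfFamily F).b₀ (stage3OfFamily F).b₁ (Mstar F)) ω y, ((E14₁ F) x).first ω y → (X14₁ F) x ω 0 y)
    (chain14₁ : ∀ F : T4Family, ∀ (x : MemberY (stage3OfFamily F).d₆ (stage3OfFamily F).ℓ₆ (stage3OfFamily F).hd' (stage3OfFamily F).hL' (stage3OfFamily F).b₀ (stage3OfFamily F).b₁ (Mstar F)) ω y y', ((E14₁ F) x).first ω y → ((E14₁ F) x).last ω y' → ∃ l : List (geo9Y x).Site, l.length = ((E14₁ F) x).wlen ω ∧ (∀ (m : ℕ) (hm : m < l.length), (X14₁ F) x ω (m + 1) (l[m])) ∧ B9Thm314.chainSum (geo9Y x).dist y l y' ≤ ((E14₁ F) x).wdist ω y y') (near14₂ : ∀ F : T4Family, ∀ (x : MemberY (stage3OfFamily F).d₆ (stage3OfFamily F).ℓ₆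 (stage3OfFamily F).hd' (stage3OfFamily F).hL' (stage3OfFamily F).b₀ (stage3OfFamily F).b₁ (Mstar F)) ω m pᵢ, (M14₂ F) x ω m → (X14₂ F) x ω m pᵢ → ∃ qᵢ, qᵢ ∈ OmegaC x.D x.D' ∧ tdistK (ℓ := (stage3OfFamily F).ℓ₆) (Mh := x.Mh) (k := x.k) (P := x.P') (kLab x pᵢ) qᵢ ≤ (diam14 F) x) (first14₂ : ∀ F : T4Family, ∀ (x : MemberY (stage3OfFamily F).d₆ (stage3OfFamily F).ℓ₆ (stage3OfFamily F).hd' (stage3OfFamily F).hL' (stage3OfFamily F).b₀ (stage3OfFamily F).b₁ (Mstar F)) ω y, ((E14₂ F) x).first ω y → (X14₂ F) x ω 0 y) (chain14₂ : ∀ F : T4Family, ∀ (x : MemberY (stage3OfFamily F).d₆ (stage3OfFamily F).ℓ₆ (stage3OfFamily F).hd' (stage3OfFamily F).hL' (stage3OfFamily F).b₀ (stage3OfFamily F).b₁ (Mstar F)) ω y y', ((E14₂ F) x).first ω y → ((E14₂ F) x).last ω y' → ∃ l : List (geo9Y x).Site, l.length = ((E14₂ F) x).wlen ω ∧ (∀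 (m : ℕ) (hm : m < l.length), (X14₂ F) x ω (m + 1) (l[m])) ∧ B9Thm314.chainSum (geo9Y x).dist y l y' ≤ ((E14₂ F) x).wdist ω y y') (h14₁ : ∀ F : T4Family, Thm310AllNormsPrinted (c35B (stage3OfFamily F).ℓ₆) geo9Y (bg9YR (Matrix (Fin 2) (Fin 2) ℂ) (specialUnitaryUnits (Fin 2)) (regYPb335 (Matrix (Fin 2) (Fin 2) ℂ) (specialUnitaryUnits (Fin 2))) (regYPb336 (Matrix (Fin 2) (Fin 2) ℂ) (specialUnitaryUnits (Fin 2)))) (E14₁ F) (fun x ω => kernelFamilyB x.toKIdx (bg9YR (Matrix (Fin 2) (Fin 2) ℂ) (specialUnitaryUnits (Fin 2)) (regYPb335 (Matrix (Fin 2) (Fin 2) ℂ) (specialUnitaryUnits (Fin 2))) (regYPb336 (Matrix (Fin 2) (Fin 2) ℂ) (specialUnitaryUnits (Fin 2))) x) (fun U => U) ((T14₁ F) x ω) (lettersYOfRecordV4P 2 (stage3OfFamily F) (Mstar F) (𝔯 F) x).parB))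
    (h14₂ : ∀ F : T4Family, Thm310AllNormsPrinted (c35B (stage3OfFamily F).ℓ₆) geo9Y (bg9YR (Matrix (Fin 2) (Fin 2) ℂ) (specialUnitaryUnits (Fin 2)) (regYPb335 (Matrix (Fin 2) (Fin 2) ℂ) (specialUnitaryUnits (Fin 2))) (regYPb336 (Matrix (Fin 2) (Fin 2) ℂ) (specialUnitaryUnits (Fin 2)))) (E14₂ F) (fun x ω => kernelFamilyB x.toKIdx (bg9YR (Matrix (Fin 2) (Fin 2) ℂ) (specialUnitaryUnits (Fin 2)) (regYPb335 (Matrix (Fin 2) (Fin 2) ℂ) (specialUnitaryUnits (Fin 2))) (regYPb336 (Matrix (Fin 2) (Fin 2) ℂ) (specialUnitaryUnits (Fin 2))) x) (fun U => U) ((T14₂ F) x ω) (lettersYOfRecordV4P 2 (stage3OfFamily F) (Mstar F) (𝔯 F) x).parB)) (W14₁ : ∀ F : T4Family, ∀ x : MemberY (stage3OfFamily F).d₆ (stage3OfFamily F).ℓ₆ (stage3OfFamily F).hd' (stage3OfFamily F).hL' (stage3OfFamily F).b₀ (stage3OfFamily F).b₁ (Mstar F), ℕ → (geo9Y x).Site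 → (geo9Y x).Site → Finset ((E14₁ F) x).Walk) (W14₂ : ∀ F : T4Family, ∀ x : MemberY (stage3OfFamily F).d₆ (stage3OfFamily F).ℓ₆ (stage3OfFamily F).hd' (stage3OfFamily F).hL' (stage3OfFamily F).b₀ (stage3OfFamily F).b₁ (Mstar F), ℕ → (geo9Y x).Site → (geo9Y x).Site → Finset ((E14₂ F) x).Walk) (hW14₁ : ∀ F : T4Family, ∀ x, WalkSetsSpec ((E14₁ F) x) ((W14₁ F) x)) (hW14₂ : ∀ F : T4Family, ∀ x, WalkSetsSpec ((E14₂ F) x) ((W14₂ F) x)) (hcnt14₁ : ∀ F : T4Family, WalkWeightsSummable geo9Y (bg9YR (Matrix (Fin 2) (Fin 2) ℂ) (specialUnitaryUnits (Fin 2)) (regYPb335 (Matrix (Fin 2) (Fin 2) ℂ) (specialUnitaryUnits (Fin 2))) (regYPb336 (Matrix (Fin 2) (Fin 2) ℂ) (specialUnitaryUnits (Fin 2)))) (E14₁ F) (W14₁ F)) (hcnt14₂ : ∀ F : T4Family, WalkWeightsSummable geo9Y (bg9YR (Matrix (Fin 2) (Fin 2) ℂ) (specialUnitaryUnits (Fin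 2)) (regYPb335 (Matrix (Fin 2) (Fin 2) ℂ) (specialUnitaryUnits (Fin 2))) (regYPb336 (Matrix (Fin 2) (Fin 2) ℂ) (specialUnitaryUnits (Fin 2)))) (E14₂ F) (W14₂ F))
    (hexp14 : ∀ F : T4Family, ∀ (x : MemberY (stage3OfFamily F).d₆ (stage3OfFamily F).ℓ₆ (stage3OfFamily F).hd' (stage3OfFamily F).hL' (stage3OfFamily F).b₀ (stage3OfFamily F).b₁ (Mstar F)) (U : (bg9YP (Matrix (Fin 2) (Fin 2) ℂ) (specialUnitaryUnits (Fin 2)) x).Cfg), ((E14₁ F) x).Converges U ∧ ((E14₂ F) x).Converges U → ExpansionReads x.toKIdx (B := bg9YR (Matrix (Fin 2) (Fin 2) ℂ) (specialUnitaryUnits (Fin 2)) (regYPb335 (Matrix (Fin 2) (Fin 2) ℂ) (specialUnitaryUnits (Fin 2))) (regYPb336 (Matrix (Fin 2) (Fin 2) ℂ) (specialUnitaryUnits (Fin 2))) x) (fun U => U) (lettersYOfRecordV4P 2 (stage3OfFamily F) (Mstar F) (𝔯 F) x).Kdiff (pairOp (locDataY x ((E14₁ F) x) ((X14₁ F) x)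 ((M14₁ F) x) ((diam14 F) x)).Touches (locData₂ (locDataY x ((E14₁ F) x) ((X14₁ F) x) ((M14₁ F) x) ((diam14 F) x)) ((X14₂ F) x) ((M14₂ F) x)).Touches ((T14₁ F) x) ((T14₂ F) x)) (pairWalkSets ((W14₁ F) x) ((W14₂ F) x) (locDataY x ((E14₁ F) x) ((X14₁ F) x) ((M14₁ F) x) ((diam14 F) x)).Touches (locData₂ (locDataY x ((E14₁ F) x) ((X14₁ F) x) ((M14₁ F) x) ((diam14 F) x)) ((X14₂ F) x) ((M14₂ F) x)).Touches) U) (a₀E δ₁E B₁E : ∀ F : T4Family, ℝ) (ha₀E : ∀ F : T4Family, 0 < (a₀E F)) (hδ₁E : ∀ F : T4Family, 0 < (δ₁E F)) (hB₁E : ∀ F : T4Family, 0 < (B₁E F)) (hE : ∀ F : T4Family, ∀ (x : MemberY (stage3OfFamily F).d₆ (stage3OfFamily F).ℓ₆ (stage3OfFamily F).hd' (stage3OfFamily F).hL' (stage3OfFamily F).b₀ (stage3OfFamily F).b₁ (Mstar F)) (α₀ : ℝ), 0 < α₀ → (geo9Y x).M * α₀ ≤ (a₀E F) → ∀ U : (bg9YP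 (Matrix (Fin 2) (Fin 2) ℂ) (specialUnitaryUnits (Fin 2)) x).Cfg, (bg9YP (Matrix (Fin 2) (Fin 2) ℂ) (specialUnitaryUnits (Fin 2)) x).Reg335 c35Y α₀ U → (bg9YP (Matrix (Fin 2) (Fin 2) ℂ) (specialUnitaryUnits (Fin 2)) x).Reg336 c35Y α₀ U → givenBy3185Y x (lettersYOfRecordV4P 2 (stage3OfFamily F) (Mstar F) (𝔯 F) x) (sectEYOfRecordV6 2 (stage3OfFamily F) (Mstar F) (𝔢₀ F) x) U ∧ hasRWExpCY ((𝔴 F) x) U (δ₁E F) ∧ DecayMidOnY x (lettersYOfRecordV4P 2 (stage3OfFamily F) (Mstar F) (𝔯 F) x) (sectEYOfRecordV6 2 (stage3OfFamily F) (Mstar F) (𝔢₀ F) x) (B₁E F) U (δ₁E F))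
    -- NODE N07's LEAF from NODE 00's `CarriersZSectE.b11Leaf_Z11OfRecord_withSectE_of_parts` at print's letters `L := F.L`, `η i := (F.P i.K).eta i.k`: the six remaining printed parts of [B11] + n16's dictionary inputs, displayed per F
    (hN07 : ∀ F : T4Family, ∃ (β : ZIdx → Type) (_ : ∀ i, Fintype (β i)) (_ : Fact (0 < (F.L : ℝ))) (_ : ∀ i : ZIdx, Fact (0 < (F.P i.K).eta i.k))
      (ζ : ResidZ F 2) (E : SectEPres F 2 (F.L : ℝ) (fun i : ZIdx => (F.P i.K).eta i.k) β ζ)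
      (βr : ∀ i, B11Prop7Assembly.Bridge ((Z11OfRecord F 2 (ζ.withSectE E)).famX i) ((Z11OfRecord F 2 (ζ.withSectE E)).famLG i)) (O₁ O₂ e₅ a : ℝ),
      0 < E.C₄ ∧ 0 < E.a₃ ∧ 0 < E.α ∧
      (∀ i, (βr i).Laws ζ.C₁ ζ.B₃) ∧ (∀ i, B11Prop7Assembly.ExistenceLeavesCap (βr i) ζ.B₀ ζ.B₃ ζ.C₁ O₁ O₂ e₅) ∧
      (∀ i, ((Z11OfRecord F 2 (ζ.withSectE E)).famX i).Laws) ∧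
      0 < ζ.B₀ ∧ 0 < ζ.B₁ ∧ 1 ≤ ζ.B₃ ∧ 1 ≤ ζ.C₁ ∧ ζ.B₀ ≤ 4 * ζ.B₁ ∧ 0 < ζ.c₁ ∧ 0 < O₁ ∧ 0 < O₂ ∧ 0 < e₅ ∧ 0 < a ∧
      (∀ (i : ZIdx) (ε₁ : ℝ) (V : ((Z11OfRecord F 2 (ζ.withSectE E)).famX i).Bdry), 0 < ε₁ → ε₁ ≤ a →
        ((Z11OfRecord F 2 (ζ.withSectE E)).famX i).Reg7 ε₁ V →
          ∃ U₀ : ((Z11OfRecord F 2 (ζ.withSectE E)).famLG i).Cfg,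
            ((Z11OfRecord F 2 (ζ.withSectE E)).famLG i).Sat14 (ζ.C₁ * ζ.B₃ * ε₁) (ζ.C₁ * ε₁) ((βr i).bdry V) U₀) ∧
      B11.Prop2Printed ζ.B₁ ζ.B₃ ζ.C₁ ζ.c₁ (Z11OfRecord F 2 (ζ.withSectE E)).famLG ∧
      B11.Prop3Printed ζ.C₁ ζ.B₃ ζ.C₂ ζ.C₃ ζ.B₀ ζ.c1h ζ.c₄ ζ.δ₀ (Z11OfRecord F 2 (ζ.withSectE E)).famLG ∧
      B11.Prop5Printed ζ.B₁ ζ.B₃ ζ.C₁ (Z11OfRecord F 2 (ζ.withSectE E)).famLG ∧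
      B11.Prop8Printed ζ.B₃ (Z11OfRecord F 2 (ζ.withSectE E)).famX ∧ B11.SectFPrinted ζ.B₃ (Z11OfRecord F 2 (ζ.withSectE E)).famX ∧
      B11.Prop9Printed ζ.B₅ ζ.C₁ ζ.β₀ ζ.δ₀ ζ.famAn)
    -- NODE N08's SLOT from dag-n08-w4's `…N08AlphaEq324RowACReMassedZSlot.printedUV3V_at_slotOfRecord_of_coreLTAtAC_of_massBoundZAE_of_consts` at `N := 2, L := F.L`: N08's (α)-AC residual (R-AC-324⁷ reading), displayed per F
    (hN08 : ∀ F : T4Family, ∃ (𝔊 : Literature.MathematicalPhysics.QuantumFieldTheory.Balaban1985CMP102.Setting.GroupModel (SU 2)) (𝔠 : Summit.QuantumFields.Balaban3D.Proofs.Primitives.AlphaConsts F.L 𝔊.N) (εbg cm : ℝ)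
      (X : ∀ S : Literature.MathematicalPhysics.QuantumFieldTheory.Balaban1985CMP102.Setting.Scales F.L, Summit.QuantumFields.Balaban3D.Proofs.StandardAC.ExternalInputsAC S (SU 2))
      (𝔖 : ∀ (S : Literature.MathematicalPhysics.QuantumFieldTheory.Balaban1985CMP102.Setting.Scales F.L) (k : ℕ), Summit.QuantumFields.Balaban3D.Carriers.StepSeries S (SU 2) ↥(Summit.QuantumFields.Balaban3D.Proofs.GroupModelLieC.lieC 𝔊) (Summit.QuantumFields.Balaban3D.Carriers.nblkOf S 𝔠.lane.carrier k) k)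
      (𝔄 : ∀ S : Literature.MathematicalPhysics.QuantumFieldTheory.Balaban1985CMP102.Setting.Scales F.L, Summit.QuantumFields.YangMills.Theorems.BalabanUVNodesN08AlphaEq324RowAC.AlphaDataLTAC 𝔊 𝔠 (X S) (𝔖 S))
      (c : ∀ (S : Literature.MathematicalPhysics.QuantumFieldTheory.Balaban1985CMP102.Setting.Scales F.L) (k : ℕ), Summit.QuantumFields.Balaban3D.Carriers.Hist S.P (k + 1) → GaugeField S.P (k + 1) (SU 2) → ℕ → ℝ),
      (∀ S, (X S).av = B10RunsOfRecord.avOfPrint 2 S) ∧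
      (∀ (S : Literature.MathematicalPhysics.QuantumFieldTheory.Balaban1985CMP102.Setting.Scales F.L) k (V : GaugeField S.P (k + 1) (SU 2)), (X S).Uk k V = B10RunsOfRecord.UkA 2 (fun S => (X S).av) S (k + 1) εbg V) ∧
      𝔠.lane.F.b₀ * (𝔠.lane.F.p₀ ^ 𝔠.lane.F.p₀ * Real.exp (1 - 𝔠.lane.F.p₀)) ≤ εbg ∧
      (∀ S : Literature.MathematicalPhysics.QuantumFieldTheory.Balaban1985CMP102.Theorems.Family F.L (Summit.QuantumFields.Balaban3D.Proofs.Constants.eps0Of 𝔠.gamma0), Summit.QuantumFields.YangMills.Theorems.BalabanUVNodesN08AlphaEq324RowAC.RunAlphaEq324CoreLTAtAC 𝔊 𝔠 (X S.1) (𝔖 S.1) (𝔄 S.1) (c S.1)) ∧ 0 ≤ cm ∧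
      (∀ S : Literature.MathematicalPhysics.QuantumFieldTheory.Balaban1985CMP102.Theorems.Family F.L (Summit.QuantumFields.Balaban3D.Proofs.Constants.eps0Of 𝔠.gamma0), ∀ k, 1 ≤ k → k ≤ S.1.K → ∀ h : Summit.QuantumFields.Balaban3D.Carriers.Hist S.1.P k, ∀ᵐ U ∂(fieldMeasure S.1.P k (SU 2)),
        Summit.QuantumFields.Balaban3D.Proofs.MassesAC.massRecAC 𝔠.lane.carrier.M₁ (Summit.QuantumFields.Balaban3D.Carriers.rcolOf S.1 𝔠.lane.carrier) (Summit.QuantumFields.Balaban3D.Carriers.eps1Of S.1 𝔠.lane.carrier) (Summit.QuantumFields.Balaban3D.Carriers.epsSOf S.1 𝔠.lane.carrier) (X S.1).av k h U ≤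
          Real.exp (cm * S.1.sites k + 𝔠.lane.carrier.dg * 𝔠.lane.carrier.c₁ *
            ∑ j ∈ Finset.range k, (Summit.QuantumFields.Balaban3D.Carriers.ZVol 𝔠.lane.carrier.M₁ (Summit.QuantumFields.Balaban3D.Carriers.rcolOf S.1 𝔠.lane.carrier) k h j : ℝ))))
    (h09 : ∀ (F : T4Family) {j : ℕ} {γ ε₀ ε₂₉ B₃ B₃' a₀ a₁ : ℝ} (hγ₀ : 0 < γ) (hγh : γ ≤ 1 / 2) (hε : 0 < ε₀) (hε' : 0 < ε₂₉) (hB : 0 ≤ B₃) (hB' : 0 ≤ B₃') (ha₀ : 0 < a₀) (ha₁ : 0 < a₁) {bl β' : ℝ} (hbox : BetaLowerH bl γ (betaOfRecord₁₃ F 2 (theta13OfThm1CCMWZ F 2 j γ ε₀ ε₂₉ B₃ B₃' a₀ a₁ (Efl F j γ ε₀ ε₂₉ B₃ B₃' a₀ a₁) (fun p i => Real.log (B16ZLower.zNorm (SU 2) (gOfRecord₁₃ F 2 (theta13OfThm1CCMW F 2 j γ ε₀ ε₂₉ B₃ B₃' a₀ a₁) p i ^ 2) ε))))) (hbox' : BetaUpperH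 β' γ (betaOfRecord₁₃ F 2 (theta13OfThm1CCMWZ F 2 j γ ε₀ ε₂₉ B₃ B₃' a₀ a₁ (Efl F j γ ε₀ ε₂₉ B₃ B₃' a₀ a₁) (fun p i => Real.log (B16ZLower.zNorm (SU 2) (gOfRecord₁₃ F 2 (theta13OfThm1CCMW F 2 j γ ε₀ ε₂₉ B₃ B₃' a₀ a₁) p i ^ 2) ε))))) (hl : -bl * γ ^ 2 ≤ 3) (hβ' : β' * γ ^ 2 ≤ 3 / 4),
      ∃ lam12 : ResidB12 F 2 (theta13OfThm1CCMWZ F 2 j γ ε₀ ε₂₉ B₃ B₃' a₀ a₁ (Efl F j γ ε₀ ε₂₉ B₃ B₃' a₀ a₁) (fun p i => Real.log (B16ZLower.zNorm (SU 2) (gOfRecord₁₃ F 2 (theta13OfThm1CCMW F 2 j γ ε₀ ε₂₉ B₃ B₃' a₀ a₁) p i ^ 2) ε))).τ9.M,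
      ∀ P : B12.RunParams, B12Sec2to5.Lemma4Printed (F12OfRecord₁₂ F 2 (theta13OfThm1CCMWZ F 2 j γ ε₀ ε₂₉ B₃ B₃' a₀ a₁ (Efl F j γ ε₀ ε₂₉ B₃ B₃' a₀ a₁) (fun p i => Real.log (B16ZLower.zNorm (SU 2) (gOfRecord₁₃ F 2 (theta13OfThm1CCMW F 2 j γ ε₀ ε₂₉ B₃ B₃' a₀ a₁) p i ^ 2) ε))).toStage12Params lam12 P) (lam12 P).consts)
    (h09T : ∀ (F : T4Family) {j : ℕ} {γ ε₀ ε₂₉ B₃ B₃' a₀ a₁ : ℝ} (hγ₀ : 0 < γ) (hγh : γ ≤ 1 / 2) (hε : 0 < ε₀) (hε' : 0 < ε₂₉) (hB : 0 ≤ B₃) (hB' : 0 ≤ B₃') (ha₀ : 0 < a₀) (ha₁ : 0 < a₁) {bl β' : ℝ} (hbox : BetaLowerH bl γ (betaOfRecord₁₃ F 2 (theta13OfThm1CCMWZ F 2 j γ ε₀ ε₂₉ B₃ B₃' a₀ a₁ (Efl F j γ ε₀ ε₂₉ B₃ B₃' a₀ a₁) (fun p i => Real.log (B16ZLower.zNorm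 (SU 2) (gOfRecord₁₃ F 2 (theta13OfThm1CCMW F 2 j γ ε₀ ε₂₉ B₃ B₃' a₀ a₁) p i ^ 2) ε))))) (hbox' : BetaUpperH β' γ (betaOfRecord₁₃ F 2 (theta13OfThm1CCMWZ F 2 j γ ε₀ ε₂₉ B₃ B₃' a₀ a₁ (Efl F j γ ε₀ ε₂₉ B₃ B₃' a₀ a₁) (fun p i => Real.log (B16ZLower.zNorm (SU 2) (gOfRecord₁₃ F 2 (theta13OfThm1CCMW F 2 j γ ε₀ ε₂₉ B₃ B₃' a₀ a₁) p i ^ 2) ε))))) (hl : -bl * γ ^ 2 ≤ 3) (hβ' : β' * γ ^ 2 ≤ 3 / 4)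
      (hP : (gaussPinH (Stage13HParams.ofHistoryBlind F 2 ⟨theta13OfThm1CCMWZ F 2 j γ ε₀ ε₂₉ B₃ B₃' a₀ a₁ (Efl F j γ ε₀ ε₂₉ B₃ B₃' a₀ a₁) (fun p i => Real.log (B16ZLower.zNorm (SU 2) (gOfRecord₁₃ F 2 (theta13OfThm1CCMW F 2 j γ ε₀ ε₂₉ B₃ B₃' a₀ a₁) p i ^ 2) ε)), ZrOfRecord₁₃ F 2 (theta13OfThm1CCMWZ F 2 j γ ε₀ ε₂₉ B₃ B₃' a₀ a₁ (Efl F j γ ε₀ ε₂₉ B₃ B₃' a₀ a₁) (fun p i => Real.log (B16ZLower.zNorm (SU 2) (gOfRecord₁₃ F 2 (theta13OfThm1CCMW F 2 j γ ε₀ ε₂₉ B₃ B₃' a₀ a₁) p i ^ 2) ε)))⟩)).Provisos₁₃SepCoPH F 2),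
      ∃ γ₉ : ℝ, 0 < γ₉ ∧ ∀ w : WorldP, w.C = (datumOfRecord₁₃SepCoPH F 2 (gaussPinH (Stage13HParams.ofHistoryBlind F 2 ⟨theta13OfThm1CCMWZ F 2 j γ ε₀ ε₂₉ B₃ B₃' a₀ a₁ (Efl F j γ ε₀ ε₂₉ B₃ B₃' a₀ a₁) (fun p i => Real.log (B16ZLower.zNorm (SU 2) (gOfRecord₁₃ F 2 (theta13OfThm1CCMW F 2 j γ ε₀ ε₂₉ B₃ B₃' a₀ a₁) p i ^ 2) ε)), ZrOfRecord₁₃ F 2 (theta13OfThm1CCMWZ F 2 j γ ε₀ ε₂₉ B₃ B₃' a₀ a₁ (Efl F j γ ε₀ ε₂₉ B₃ B₃' a₀ a₁) (fun p i => Real.log (B16ZLower.zNorm (SU 2) (gOfRecord₁₃ F 2 (theta13OfThm1CCMW F 2 j γ ε₀ ε₂₉ B₃ B₃' a₀ a₁) p i ^ 2) ε)))⟩)) hP).C →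
      w.γ ≤ γ₉ → ∀ P : B12.RunParams, (leavesP w P).smallCouplings → (leavesP w P).smallFieldInductive)
    (h10 : ∀ F : T4Family, ∃ lam13 : B12.RunParams → ResidB13 (stage3OfFamily F), ∀ P : B12.RunParams, B13LeafOfRecord (stage3OfFamily F) (lam13 P))
    (h11N : ∀ (F : T4Family) {j : ℕ} {γ ε₀ ε₂₉ B₃ B₃' a₀ a₁ : ℝ} (hγ₀ : 0 < γ) (hγh : γ ≤ 1 / 2) (hε : 0 < ε₀) (hε' : 0 < ε₂₉) (hB : 0 ≤ B₃) (hB' : 0 ≤ B₃') (ha₀ : 0 < a₀) (ha₁ : 0 < a₁) {bl β' : ℝ} (hbox : BetaLowerH bl γ (betaOfRecord₁₃ F 2 (theta13OfThm1CCMWZ F 2 j γ ε₀ ε₂₉ B₃ B₃' a₀ a₁ (Efl F j γ ε₀ ε₂₉ B₃ B₃' a₀ a₁) (fun p i => Real.log (B16ZLower.zNorm (SU 2) (gOfRecord₁₃ F 2 (theta13OfThm1CCMW F 2 j γ ε₀ ε₂₉ B₃ B₃' a₀ a₁) p i ^ 2) ε))))) (hbox' : BetaUpperH β' γ (betaOfRecord₁₃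 F 2 (theta13OfThm1CCMWZ F 2 j γ ε₀ ε₂₉ B₃ B₃' a₀ a₁ (Efl F j γ ε₀ ε₂₉ B₃ B₃' a₀ a₁) (fun p i => Real.log (B16ZLower.zNorm (SU 2) (gOfRecord₁₃ F 2 (theta13OfThm1CCMW F 2 j γ ε₀ ε₂₉ B₃ B₃' a₀ a₁) p i ^ 2) ε))))) (hl : -bl * γ ^ 2 ≤ 3) (hβ' : β' * γ ^ 2 ≤ 3 / 4),
      ∃ σ : (P : B12.RunParams) → Sect3Supplier (gaussPinH (Stage13HParams.ofHistoryBlind F 2 ⟨theta13OfThm1CCMWZ F 2 j γ ε₀ ε₂₉ B₃ B₃' a₀ a₁ (Efl F j γ ε₀ ε₂₉ B₃ B₃' a₀ a₁) (fun p i => Real.log (B16ZLower.zNorm (SU 2) (gOfRecord₁₃ F 2 (theta13OfThm1CCMW F 2 j γ ε₀ ε₂₉ B₃ B₃' a₀ a₁) p i ^ 2) ε)), ZrOfRecord₁₃ F 2 (theta13OfThm1CCMWZ F 2 j γ ε₀ ε₂₉ B₃ B₃' a₀ a₁ (Efl F j γ ε₀ ε₂₉ B₃ B₃' a₀ a₁)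 (fun p i => Real.log (B16ZLower.zNorm (SU 2) (gOfRecord₁₃ F 2 (theta13OfThm1CCMW F 2 j γ ε₀ ε₂₉ B₃ B₃' a₀ a₁) p i ^ 2) ε)))⟩)) P,
        (∀ P : B12.RunParams, Step.InInterval γ P.K (gOfRecord₁₃ F 2 (theta13OfThm1CCMWZ F 2 j γ ε₀ ε₂₉ B₃ B₃' a₀ a₁ (Efl F j γ ε₀ ε₂₉ B₃ B₃' a₀ a₁) (fun p i => Real.log (B16ZLower.zNorm (SU 2) (gOfRecord₁₃ F 2 (theta13OfThm1CCMW F 2 j γ ε₀ ε₂₉ B₃ B₃' a₀ a₁) p i ^ 2) ε))) P) → SupplierObligations (gaussPinH (Stage13HParams.ofHistoryBlind F 2 ⟨theta13OfThm1CCMWZ F 2 j γ ε₀ ε₂₉ B₃ B₃' a₀ a₁ (Efl F j γ ε₀ ε₂₉ B₃ B₃' a₀ a₁) (fun p i => Real.log (B16ZLower.zNorm (SU 2) (gOfRecord₁₃ F 2 (theta13OfThm1CCMW F 2 j γ ε₀ ε₂₉ B₃ B₃' a₀ a₁) p i ^ 2) ε)), ZrOfRecord₁₃ F 2 (theta13OfThm1CCMWZ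 F 2 j γ ε₀ ε₂₉ B₃ B₃' a₀ a₁ (Efl F j γ ε₀ ε₂₉ B₃ B₃' a₀ a₁) (fun p i => Real.log (B16ZLower.zNorm (SU 2) (gOfRecord₁₃ F 2 (theta13OfThm1CCMW F 2 j γ ε₀ ε₂₉ B₃ B₃' a₀ a₁) p i ^ 2) ε)))⟩)) P (σ P)) ∧
        (∀ P : B12.RunParams, Step.InInterval γ P.K (gOfRecord₁₃ F 2 (theta13OfThm1CCMWZ F 2 j γ ε₀ ε₂₉ B₃ B₃' a₀ a₁ (Efl F j γ ε₀ ε₂₉ B₃ B₃' a₀ a₁) (fun p i => Real.log (B16ZLower.zNorm (SU 2) (gOfRecord₁₃ F 2 (theta13OfThm1CCMW F 2 j γ ε₀ ε₂₉ B₃ B₃' a₀ a₁) p i ^ 2) ε))) P) → OperandRowsAlongChain (gaussPinH (Stage13HParams.ofHistoryBlind F 2 ⟨theta13OfThm1CCMWZ F 2 j γ ε₀ ε₂₉ B₃ B₃' a₀ a₁ (Efl F j γ ε₀ ε₂₉ B₃ B₃' a₀ a₁) (fun p i => Real.log (B16ZLower.zNorm (SU 2) (gOfRecord₁₃ F 2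 (theta13OfThm1CCMW F 2 j γ ε₀ ε₂₉ B₃ B₃' a₀ a₁) p i ^ 2) ε)), ZrOfRecord₁₃ F 2 (theta13OfThm1CCMWZ F 2 j γ ε₀ ε₂₉ B₃ B₃' a₀ a₁ (Efl F j γ ε₀ ε₂₉ B₃ B₃' a₀ a₁) (fun p i => Real.log (B16ZLower.zNorm (SU 2) (gOfRecord₁₃ F 2 (theta13OfThm1CCMW F 2 j γ ε₀ ε₂₉ B₃ B₃' a₀ a₁) p i ^ 2) ε)))⟩)) P (σ P)))
    (hEfl : ∀ (F : T4Family) (j : ℕ) (γ ε₀ ε₂₉ B₃ B₃' a₀ a₁ : ℝ), ∃ CE : ℝ, 0 ≤ CE ∧ ∀ (P : B12.RunParams) (i : ℕ), i < P.K → |Efl F j γ ε₀ ε₂₉ B₃ B₃' a₀ a₁ P i| ≤ CE * sitesCard (F.P P.K) (i + 1))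
    (h13pos : ∀ (F : T4Family) {j : ℕ} {γ ε₀ ε₂₉ B₃ B₃' a₀ a₁ : ℝ} (hγ₀ : 0 < γ) (hγh : γ ≤ 1 / 2) (hε : 0 < ε₀) (hε' : 0 < ε₂₉) (hB : 0 ≤ B₃) (hB' : 0 ≤ B₃') (ha₀ : 0 < a₀) (ha₁ : 0 < a₁) {bl β' : ℝ} (hbox : BetaLowerH bl γ (betaOfRecord₁₃ F 2 (theta13OfThm1CCMWZ F 2 j γ ε₀ ε₂₉ B₃ B₃' a₀ a₁ (Efl F j γ ε₀ ε₂₉ B₃ B₃' a₀ a₁) (fun p i => Real.log (B16ZLower.zNorm (SU 2) (gOfRecord₁₃ F 2 (theta13OfThm1CCMW F 2 j γ ε₀ ε₂₉ B₃ B₃' a₀ a₁) p i ^ 2) ε))))) (hbox' : BetaUpperH β' γ (betaOfRecord₁₃ F 2 (theta13OfThm1CCMWZ F 2 j γ ε₀ ε₂₉ B₃ B₃' a₀ a₁ (Efl F j γ ε₀ ε₂₉ B₃ B₃' a₀ a₁) (fun p i => Real.log (B16ZLower.zNorm (SU 2) (gOfRecord₁₃ F 2 (theta13OfThm1CCMW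 F 2 j γ ε₀ ε₂₉ B₃ B₃' a₀ a₁) p i ^ 2) ε))))) (hl : -bl * γ ^ 2 ≤ 3) (hβ' : β' * γ ^ 2 ≤ 3 / 4)
      (hP : (gaussPinH (Stage13HParams.ofHistoryBlind F 2 ⟨theta13OfThm1CCMWZ F 2 j γ ε₀ ε₂₉ B₃ B₃' a₀ a₁ (Efl F j γ ε₀ ε₂₉ B₃ B₃' a₀ a₁) (fun p i => Real.log (B16ZLower.zNorm (SU 2) (gOfRecord₁₃ F 2 (theta13OfThm1CCMW F 2 j γ ε₀ ε₂₉ B₃ B₃' a₀ a₁) p i ^ 2) ε)), ZrOfRecord₁₃ F 2 (theta13OfThm1CCMWZ F 2 j γ ε₀ ε₂₉ B₃ B₃' a₀ a₁ (Efl F j γ ε₀ ε₂₉ B₃ B₃' a₀ a₁) (fun p i => Real.log (B16ZLower.zNorm (SU 2) (gOfRecord₁₃ F 2 (theta13OfThm1CCMW F 2 j γ ε₀ ε₂₉ B₃ B₃' a₀ a₁) p i ^ 2) ε)))⟩)).Provisos₁₃SepCoPH F 2),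
      ∃ γ₁₃ : ℝ, 0 < γ₁₃ ∧ ∃ em ep : ℝ → ℝ,
        (∀ P : B12.RunParams, ((datumOfRecord₁₃SepCoPH F 2 (gaussPinH (Stage13HParams.ofHistoryBlind F 2 ⟨theta13OfThm1CCMWZ F 2 j γ ε₀ ε₂₉ B₃ B₃' a₀ a₁ (Efl F j γ ε₀ ε₂₉ B₃ B₃' a₀ a₁) (fun p i => Real.log (B16ZLower.zNorm (SU 2) (gOfRecord₁₃ F 2 (theta13OfThm1CCMW F 2 j γ ε₀ ε₂₉ B₃ B₃' a₀ a₁) p i ^ 2) ε)), ZrOfRecord₁₃ F 2 (theta13OfThm1CCMWZ F 2 j γ ε₀ ε₂₉ B₃ B₃' a₀ a₁ (Efl F j γ ε₀ ε₂₉ B₃ B₃' a₀ a₁) (fun p i => Real.log (B16ZLower.zNorm (SU 2) (gOfRecord₁₃ F 2 (theta13OfThm1CCMW F 2 j γ ε₀ ε₂₉ B₃ B₃' a₀ a₁) p i ^ 2) ε)))⟩)) hP).C P).flow.InInterval γ₁₃ P.K → ∀ k, k + 1 ≤ P.K → SLaw₁₃CoPH F 2 (gaussPinH (Stage13HParams.ofHistoryBlind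 F 2 ⟨theta13OfThm1CCMWZ F 2 j γ ε₀ ε₂₉ B₃ B₃' a₀ a₁ (Efl F j γ ε₀ ε₂₉ B₃ B₃' a₀ a₁) (fun p i => Real.log (B16ZLower.zNorm (SU 2) (gOfRecord₁₃ F 2 (theta13OfThm1CCMW F 2 j γ ε₀ ε₂₉ B₃ B₃' a₀ a₁) p i ^ 2) ε)), ZrOfRecord₁₃ F 2 (theta13OfThm1CCMWZ F 2 j γ ε₀ ε₂₉ B₃ B₃' a₀ a₁ (Efl F j γ ε₀ ε₂₉ B₃ B₃' a₀ a₁) (fun p i => Real.log (B16ZLower.zNorm (SU 2) (gOfRecord₁₃ F 2 (theta13OfThm1CCMW F 2 j γ ε₀ ε₂₉ B₃ B₃' a₀ a₁) p i ^ 2) ε)))⟩)) P (k + 1) →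
      ∀ᵐ U ∂(fieldMeasure (F.P P.K) (k + 1) (SU 2)),
        chiβOfRecord₁₃ F 2 (theta13OfThm1CCMWZ F 2 j γ ε₀ ε₂₉ B₃ B₃' a₀ a₁ (Efl F j γ ε₀ ε₂₉ B₃ B₃' a₀ a₁) (fun p i => Real.log (B16ZLower.zNorm (SU 2) (gOfRecord₁₃ F 2 (theta13OfThm1CCMW F 2 j γ ε₀ ε₂₉ B₃ B₃' a₀ a₁) p i ^ 2) ε))) P.K (gOfRecord₁₃ F 2 (theta13OfThm1CCMWZ F 2 j γ ε₀ ε₂₉ B₃ B₃' a₀ a₁ (Efl F j γ ε₀ ε₂₉ B₃ B₃' a₀ a₁) (fun p i => Real.log (B16ZLower.zNorm (SU 2) (gOfRecord₁₃ F 2 (theta13OfThm1CCMW F 2 j γ ε₀ ε₂₉ B₃ B₃' a₀ a₁) p i ^ 2) ε))) P) (k + 1) U *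
              Real.exp (-(1 / (gOfRecord₁₃ F 2 (theta13OfThm1CCMWZ F 2 j γ ε₀ ε₂₉ B₃ B₃' a₀ a₁ (Efl F j γ ε₀ ε₂₉ B₃ B₃' a₀ a₁) (fun p i => Real.log (B16ZLower.zNorm (SU 2) (gOfRecord₁₃ F 2 (theta13OfThm1CCMW F 2 j γ ε₀ ε₂₉ B₃ B₃' a₀ a₁) p i ^ 2) ε))) P (k + 1)) ^ 2 * wilsonBGOfRecord F 2 (theta13OfThm1CCMWZ F 2 j γ ε₀ ε₂₉ B₃ B₃' a₀ a₁ (Efl F j γ ε₀ ε₂₉ B₃ B₃' a₀ a₁) (fun p i => Real.log (B16ZLower.zNorm (SU 2) (gOfRecord₁₃ F 2 (theta13OfThm1CCMW F 2 j γ ε₀ ε₂₉ B₃ B₃' a₀ a₁) p i ^ 2) ε))).εbg P (k + 1) U)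
                - em (gOfRecord₁₃ F 2 (theta13OfThm1CCMWZ F 2 j γ ε₀ ε₂₉ B₃ B₃' a₀ a₁ (Efl F j γ ε₀ ε₂₉ B₃ B₃' a₀ a₁) (fun p i => Real.log (B16ZLower.zNorm (SU 2) (gOfRecord₁₃ F 2 (theta13OfThm1CCMW F 2 j γ ε₀ ε₂₉ B₃ B₃' a₀ a₁) p i ^ 2) ε))) P (k + 1)) * (Fintype.card (Literature.MathematicalPhysics.QuantumFieldTheory.Balaban1983to89.Site (F.P P.K) (k + 1)) : ℝ)) ≤ densOfRecord₁₃ F 2 (theta13OfThm1CCMWZ F 2 j γ ε₀ ε₂₉ B₃ B₃' a₀ a₁ (Efl F j γ ε₀ ε₂₉ B₃ B₃' a₀ a₁) (fun p i => Real.log (B16ZLower.zNorm (SU 2) (gOfRecord₁₃ F 2 (theta13OfThm1CCMW F 2 j γ ε₀ ε₂₉ B₃ B₃' a₀ a₁) p i ^ 2) ε))) P (k + 1) U ∧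
          densOfRecord₁₃ F 2 (theta13OfThm1CCMWZ F 2 j γ ε₀ ε₂₉ B₃ B₃' a₀ a₁ (Efl F j γ ε₀ ε₂₉ B₃ B₃' a₀ a₁) (fun p i => Real.log (B16ZLower.zNorm (SU 2) (gOfRecord₁₃ F 2 (theta13OfThm1CCMW F 2 j γ ε₀ ε₂₉ B₃ B₃' a₀ a₁) p i ^ 2) ε))) P (k + 1) U ≤ Real.exp (ep (gOfRecord₁₃ F 2 (theta13OfThm1CCMWZ F 2 j γ ε₀ ε₂₉ B₃ B₃' a₀ a₁ (Efl F j γ ε₀ ε₂₉ B₃ B₃' a₀ a₁) (fun p i => Real.log (B16ZLower.zNorm (SU 2) (gOfRecord₁₃ F 2 (theta13OfThm1CCMW F 2 j γ ε₀ ε₂₉ B₃ B₃' a₀ a₁) p i ^ 2) ε))) P (k + 1)) * (Fintype.card (Literature.MathematicalPhysics.QuantumFieldTheory.Balaban1983to89.Site (F.P P.K) (k + 1)) : ℝ))))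
    (hrowsR : ∀ (F : T4Family) {j : ℕ} {γ ε₀ ε₂₉ B₃ B₃' a₀ a₁ : ℝ} (hγ₀ : 0 < γ) (hγh : γ ≤ 1 / 2) (hε : 0 < ε₀) (hε' : 0 < ε₂₉) (hB : 0 ≤ B₃) (hB' : 0 ≤ B₃') (ha₀ : 0 < a₀) (ha₁ : 0 < a₁) {bl β' : ℝ} (hbox : BetaLowerH bl γ (betaOfRecord₁₃ F 2 (theta13OfThm1CCMWZ F 2 j γ ε₀ ε₂₉ B₃ B₃' a₀ a₁ (Efl F j γ ε₀ ε₂₉ B₃ B₃' a₀ a₁) (fun p i => Real.log (B16ZLower.zNorm (SU 2) (gOfRecord₁₃ F 2 (theta13OfThm1CCMW F 2 j γ ε₀ ε₂₉ B₃ B₃' a₀ a₁) p i ^ 2) ε))))) (hbox' : BetaUpperH β' γ (betaOfRecord₁₃ F 2 (theta13OfThm1CCMWZ F 2 j γ ε₀ ε₂₉ B₃ B₃' a₀ a₁ (Efl F j γ ε₀ ε₂₉ B₃ B₃' a₀ a₁) (fun p i => Real.log (B16ZLower.zNorm (SU 2) (gOfRecord₁₃ F 2 (theta13OfThm1CCMW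 F 2 j γ ε₀ ε₂₉ B₃ B₃' a₀ a₁) p i ^ 2) ε))))) (hl : -bl * γ ^ 2 ≤ 3) (hβ' : β' * γ ^ 2 ≤ 3 / 4),
      ∃ (b : ℕ → ℝ) (r γ₀ M : ℝ), 0 < γ₀ ∧
        (∀ (n : ℕ) (gs : ℕ → ℝ), RGEqH n (betaOfRecord₁₃ F 2 (theta13OfThm1CCMWZ F 2 j γ ε₀ ε₂₉ B₃ B₃' a₀ a₁ (Efl F j γ ε₀ ε₂₉ B₃ B₃' a₀ a₁) (fun p i => Real.log (B16ZLower.zNorm (SU 2) (gOfRecord₁₃ F 2 (theta13OfThm1CCMW F 2 j γ ε₀ ε₂₉ B₃ B₃' a₀ a₁) p i ^ 2) ε)))) gs → Step.InInterval γ₀ n gs → ∀ k, k ≤ n → |betaOfRecord₁₃ F 2 (theta13OfThm1CCMWZ F 2 j γ ε₀ ε₂₉ B₃ B₃' a₀ a₁ (Efl F j γ ε₀ ε₂₉ B₃ B₃' a₀ a₁) (fun p i => Real.log (B16ZLower.zNorm (SU 2) (gOfRecord₁₃ F 2 (theta13OfThm1CCMW F 2 j γ ε₀ ε₂₉ B₃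 B₃' a₀ a₁) p i ^ 2) ε))) k (prefixOf gs k) - b k| ≤ r) ∧
        (∀ (n : ℕ) (gs : ℕ → ℝ), RGEqH n (betaOfRecord₁₃ F 2 (theta13OfThm1CCMWZ F 2 j γ ε₀ ε₂₉ B₃ B₃' a₀ a₁ (Efl F j γ ε₀ ε₂₉ B₃ B₃' a₀ a₁) (fun p i => Real.log (B16ZLower.zNorm (SU 2) (gOfRecord₁₃ F 2 (theta13OfThm1CCMW F 2 j γ ε₀ ε₂₉ B₃ B₃' a₀ a₁) p i ^ 2) ε)))) gs → Step.InInterval γ₀ n gs → ∀ k, k ≤ n → -M ≤ ∑ j ∈ Finset.Ico k n, betaOfRecord₁₃ F 2 (theta13OfThm1CCMWZ F 2 j γ ε₀ ε₂₉ B₃ B₃' a₀ a₁ (Efl F j γ ε₀ ε₂₉ B₃ B₃' a₀ a₁) (fun p i => Real.log (B16ZLower.zNorm (SU 2) (gOfRecord₁₃ F 2 (theta13OfThm1CCMW F 2 j γ ε₀ ε₂₉ B₃ B₃' a₀ a₁) p i ^ 2) ε))) j (prefixOf gs j)) ∧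
        ∀ k : ℕ, ContinuousOn (fun x : ℝ => betaOfRecord₁₃ F 2 (theta13OfThm1CCMWZ F 2 j γ ε₀ ε₂₉ B₃ B₃' a₀ a₁ (Efl F j γ ε₀ ε₂₉ B₃ B₃' a₀ a₁) (fun p i => Real.log (B16ZLower.zNorm (SU 2) (gOfRecord₁₃ F 2 (theta13OfThm1CCMW F 2 j γ ε₀ ε₂₉ B₃ B₃' a₀ a₁) p i ^ 2) ε))) k (clampPrefix (betaOfRecord₁₃ F 2 (theta13OfThm1CCMWZ F 2 j γ ε₀ ε₂₉ B₃ B₃' a₀ a₁ (Efl F j γ ε₀ ε₂₉ B₃ B₃' a₀ a₁) (fun p i => Real.log (B16ZLower.zNorm (SU 2) (gOfRecord₁₃ F 2 (theta13OfThm1CCMW F 2 j γ ε₀ ε₂₉ B₃ B₃' a₀ a₁) p i ^ 2) ε)))) γ₀ k x))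
          {x : ℝ | 0 < x ∧ x ≤ γ₀ ∧ ∀ j', j' ≤ k → 1 / γ₀ ^ 2 ≤ Y (betaOfRecord₁₃ F 2 (theta13OfThm1CCMWZ F 2 j γ ε₀ ε₂₉ B₃ B₃' a₀ a₁ (Efl F j γ ε₀ ε₂₉ B₃ B₃' a₀ a₁) (fun p i => Real.log (B16ZLower.zNorm (SU 2) (gOfRecord₁₃ F 2 (theta13OfThm1CCMW F 2 j γ ε₀ ε₂₉ B₃ B₃' a₀ a₁) p i ^ 2) ε)))) γ₀ j' x}) :
    Summit.QuantumFields.YangMills.Theses.BalabanUVNodes.StabilityBRunRowsAtRecordR13SepCoPHV := by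
  -- NODE N07's leaf from its six remaining printed parts through NODE 00's Sect.-E presentation BY NAME (print's letters `L := F.L`, `η i := (F.P i.K).eta i.k`)
  have h07 : ∀ F : T4Family, ∃ ζ : ResidZ F 2, B11Leaf (Z11OfRecord F 2 ζ) := fun F => by
    obtain ⟨β, iβ, iL, iη, ζ, E, βr, O₁, O₂, e₅, a, hC₄, ha₃, hα, laws, leaves, plaws, hB₀, hB₁, hB₃, hC₁, hB₀B₁, hc₁, hO₁, hO₂, he₅, ha, hbg,
      p2, p3, p5, p8, sF, p9⟩ := hN07 F
    exact ⟨ζ.withSectE E, b11Leaf_Z11OfRecord_withSectE_of_parts ζ E hC₄ ha₃ hα βr laws leaves plaws hB₀ hB₁ hB₃ hC₁ hB₀B₁ hc₁ hO₁ hO₂ he₅ ha hbg p2 p3 p5 p8 sF p9⟩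
  -- NODE N08's slot from its (α)-AC residual through dag-n08-w4's slot theorem BY NAME (`N := 2`, `L := F.L`)
  have h08 : ∀ F : T4Family, PrintedUV3V 2 F.L := fun F => by
    obtain ⟨𝔊, 𝔠, εbg, cm, X, 𝔖, 𝔄, c, hav, hUk, hε, R, hcm, hmass⟩ := hN08 F
    exact Summit.QuantumFields.YangMills.Theorems.BalabanUVNodesN08AlphaEq324RowACReMassedZSlot.printedUV3V_at_slotOfRecord_of_coreLTAtAC_of_massBoundZAE_of_consts (𝔄 := 𝔄) (c := c) hav hUk hε R hcm hmass
  -- NODE N06's leaf at every door, from dag-n06-d's certificate BY NAME at the door witness's Stage-11 view (its Stage-3 dictionary IS `stage3OfFamily F`, `rfl`; its run-indexed weight binder is not read)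
  have h06 : ∀ (F : T4Family) {j : ℕ} {γ ε₀ ε₂₉ B₃ B₃' a₀ a₁ : ℝ}, 0 < γ → γ ≤ 1 / 2 → 0 < ε₀ → 0 < ε₂₉ → 0 ≤ B₃ → 0 ≤ B₃' → 0 < a₀ → 0 < a₁ →
      ∃ (M : ℕ) (ops : OpsY 2 (theta13OfThm1CCMWZ F 2 j γ ε₀ ε₂₉ B₃ B₃' a₀ a₁ (Efl F j γ ε₀ ε₂₉ B₃ B₃' a₀ a₁) (fun p i => Real.log (B16ZLower.zNorm (SU 2) (gOfRecord₁₃ F 2 (theta13OfThm1CCMW F 2 j γ ε₀ ε₂₉ B₃ B₃' a₀ a₁) p i ^ 2) ε))).toStage3Params M), B9LeafX (Y9OfRecordP 2 (theta13OfThm1CCMWZ F 2 j γ ε₀ ε₂₉ B₃ B₃' a₀ a₁ (Efl F j γ ε₀ ε₂₉ B₃ B₃' a₀ a₁) (fun p i => Real.log (B16ZLower.zNorm (SU 2) (gOfRecord₁₃ F 2 (theta13OfThm1CCMW F 2 j γ ε₀ ε₂₉ B₃ B₃' a₀ a₁) p i ^ 2) ε))).toStage3Params M ops) := by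
    intro F j γ ε₀ ε₂₉ B₃ B₃' a₀ a₁ dγ₀ dγh dε dε' dB dB' da₀ da₁
    exact ⟨Mstar F, _, @b9LeafXP10_opsYNuOfRecordV6E_pairOY 2 _ F ((theta13OfThm1CCMWZ F 2 j γ ε₀ ε₂₉ B₃ B₃' a₀ a₁ (Efl F j γ ε₀ ε₂₉ B₃ B₃' a₀ a₁) (fun p i => Real.log (B16ZLower.zNorm (SU 2) (gOfRecord₁₃ F 2 (theta13OfThm1CCMW F 2 j γ ε₀ ε₂₉ B₃ B₃' a₀ a₁) p i ^ 2) ε))).toStage12Params.toStage11 F 2 ⟨0, 0, 0⟩) ((admissible_theta13OfThm1CCMWZ_of_le_half F 2 (Efl F j γ ε₀ ε₂₉ B₃ B₃' a₀ a₁) (fun p i => Real.log (B16ZLower.zNorm (SU 2) (gOfRecord₁₃ F 2 (theta13OfThm1CCMW F 2 j γ ε₀ ε₂₉ B₃ B₃' a₀ a₁) p i ^ 2) ε)) (j := j) dγ₀ dγh dε dε' dB dB' da₀ da₁).toStage12.toStage11 ⟨0, 0, 0⟩) (Mstar F) (𝔯 F) (𝔢₀ F) (𝔴 F) (𝔈 F)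 (instN06_1 F) (instN06_2 F) (instN06_3 F) (bI F) (hβI F) (hlev F) (hβ1 F) (hbI0 F) (hB F) (α' F) (r39 F) (δ39 F) (B39 F) (a39 F) (M39 F) (hα'0 F) (hα'1 F) (hr39 F) (hrδ39 F) (hB39 F) (ha39 F) (hM39 F) (h348 F) (hEK39 F) (hPD F) (ιA F) (AA F) (instN06_4 F) (instN06_5 F) (p F) (q F) (hp F) (hq F) (p3 F) (q3 F) (hp3 F) (hq3 F) (pM F) (qM F) (hpM F) (hqM F) (H F) (hM₀ F) (hM₀' F) (rd F) (𝔭 F) (h𝔭 F) (bHX F) (hbHX F) (SH F) (S3 F) (SI F) (hrd F) (hrdAg F) (h36 F) (h36H F) (hM1mix F) (ha1mix F) (hBMmix F) (hδmix F) (hM1fac F) (ha1fac F) (hδfac F) (hθfac F) (hcntH F) (hcnt3 F) (hcntI F) (hMw F) (hNMw F) (hM3 F) (hρ3 F) (hNc F) (hN' F) (hCℓ F) (hKc F) (hθ₀ F) (𝔬A F) (rdA F) (𝔭A F) (h𝔭A F) (𝔡A F) (𝔩A F) (bHXA F) (κA F) (SHA F) (S3A F) (SIA F) (SMA F) (S2A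 F) (hbHXA F) (hstA F) (hκA F) (hrdA F) (hlocA F) (h36A F) (hGsqA F) (h36HA F) (h36A2 F) (hcntHA F) (hcnt3A F) (hcntIA F) (hcntMA F) (hcnt2A F) (hE37 F) (hE310 F) (hblkA F) (hblkYA F) (hGcoA F) (hDcoA F) (hDscoA F) (hLcoA F) (h𝔡Ad F) (h𝔡As F) (hGsqAS F) (𝔬12 F) (bH13 F) (δ12₀ F) (δK12 F) (σ12 F) (ρ12 F) (a12 F) (M12 F) (B12₃ F) (δ12₃ F) (ρ13 F) (α12 F) (ρf12 F) (Bq12 F) (hρf12 F) (hρf1 F) (hρf2 F) (hBq12 F) (hB12₃ F) (hσ12 F) (hρ12 F) (hρS12 F) (hρδ12 F) (hρ₃12 F) (ha12 F) (hM12 F) (hα12 F) (hα12' F) (hδ₃₀ F) (hδ12₀ F) (t12 F) (δT12 F) (ρS F) (σS F) (ht12 F) (hσS F) (hρST F) (hρS₀ F) (hρS₃ F) (hδKS F) (hσSK F) (bXH F) (w13 F) (wX F) (hw13₀ F) (hw13₁ F) (hwX₀ F) (hwX₁ F) (hbH13 F) (hbXH F) (hρ13 F) (hρ13ρ F) (hσρ13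 F) (B13₄ F) (θV13 F) (Br13 F) (Bx13 F) (Bd13 F) (Bd2₁₃ F) (hθV13 F) (hB13₄ F) (hBr13 F) (hBx13 F) (hBd13 F) (hBd2₁₃ F) (hta₂ F) (htb₂ F) (tJ F) (δB F) (rT F) (ha1J F) (htJ F) (hrTP F) (hrTB F) (hδT12 F) (hδTr F) (hta₂R F) (htb₂R F) (ϑF F) (hϑF F) (sch F) (hsch0 F) (hsch1 F) (hwsch F) (δ45 F) (hδ45
      F) (BZ F) (hBZ F) (h45X F) (hlettersH12 F) (hpinE F) (hpinH F) (hpinK F) (hblk12 F) (hblkW12 F) (hblkY12 F) (hG0co12 F) (hGco12 F) (hG1co12 F) (hGGco12 F) (hDco12 F) (hDsco12 F) (hblkZ12 F) (hHm12 F) (hH1m12 F) (hS0co12 F) (hTpico12 F) (hT2co12 F) (hQco12 F) (hQsco12 F) (hCco12 F) (hC1co12 F) (hDvco12 F) (hDvsco12 F) (hRco12 F) (hΔ2 F) (θ₂ F) (δ₂ F) (hθ₂ F) (hrT4 F) (hrT2 F) (hδ₃T F) (hD2sup F) (hpXDv F) (hpXQs F) (δ45Y F) (hδ45Y F) (BiY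 F) (hBiY F) (αW F) (σW F) (δFW F) (hαW0 F) (hαW1 F) (hσW F) (hδFW F) (hδFP F) (hbudW F) (hδ3W F) (hwschX F) (δ45W F) (hδ45W F) (B45W F) (hB45W F) (δhW F) (hδhW F) (BhW F) (hBhW F) (hp45W F) (hpDGW F) (CP F) (hCPge F) (hBxW F) (h45Y F) (hLL2 F) (hLIM F) (hZ F) (hdgQs F) (hdgQsd F) (hpQd F) (s44 F) (hs440 F) (hs441 F) (hws44 F) (δ44 F) (hδ44 F) (Bi44 F) (hBi44 F) (hB12₃d F) (hB12₃p F) (h44m F) (hZ8 F) (hwX44 F) (B44G F) (δ44G F) (hB44G F) (hδ44G F) (h44G F) (hB₃wG F) (θK F) (δKG F) (B₀G F) (δ₀G F) (ρG F) (BHG F) (BhG F) (θHG F) (hθK F) (hθHG F) (hB₀G F) (hBhG F) (hBHG F) (hρG F) (hρSG F) (hρδG F) (hqG F) (hwBG F) (hB₃g F) (hδ₃g F) (hG0P F) (B43 F) (δ43 F) (hB43 F) (h43Gp F) (ρrg F) (hρrg0 F) (hbudrg F) (hbud43 F) (hδ₃rg F) (hbud43T F) (hB₃rg F) (E14₁ F)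 (E14₂ F) (T14₁ F) (T14₂ F) (X14₁ F) (M14₁ F) (X14₂ F) (M14₂ F) (diam14 F) (r14 F) (hr14 F) (near14₁ F) (first14₁ F) (chain14₁ F) (near14₂ F) (first14₂ F) (chain14₂ F) (h14₁ F) (h14₂ F) (W14₁ F) (W14₂ F) (hW14₁ F) (hW14₂ F) (hcnt14₁ F) (hcnt14₂ F) (hexp14 F) (a₀E F) (δ₁E F) (B₁E F) (ha₀E F) (hδ₁E F) (hB₁E F) (hE F)⟩
  refine N24_stabilityBRunRowsAtRecordR13SepCoPHV_byName_of_openStubsGridG_of_childrenSplitSlot8N11OperandRowsThm1AEPos_atGaussPinPrintedZ_pinYP_of_runRowsCont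
    (fun θ₃ lam8 => ∃ (P : ℕ) (c₁ : ℝ) (ρ₀ : ℕ) (ax : ∀ i : IdxB8SubDPer θ₃ P, (famB8OfRecordPer θ₃ (lam8.cutSubBP₅κPer P M₁ R c₁ ρ₀).β (lam8.cutSubBP₅κPer P M₁ R c₁ ρ₀).len P i).Cfg → (famB8OfRecordPer θ₃ (lam8.cutSubBP₅κPer P M₁ R c₁ ρ₀).β (lam8.cutSubBP₅κPer P M₁ R c₁ ρ₀).len P i).Pert → (famB8OfRecordPer θ₃ (lam8.cutSubBP₅κPer P M₁ R c₁ ρ₀).β (lam8.cutSubBP₅κPer P M₁ R c₁ ρ₀).len P i).Pert), (0 < P ∧ M₁ * θ₃.L ∣ P) ∧ 0 < c₁ ∧ 1 ≤ ρ₀ ∧ B8LeafOfRecordSubBP₂DPerκ θ₃ P M₁ R ⟨lam8.cutSubBP₅κPer P M₁ R c₁ ρ₀, ax⟩)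
    ε hεz Efl h1G3 h3A'G3 (fun F {j} {γ} {ε₀} {ε₂₉} {B₃} {B₃'} {a₀} {a₁} hγ₀ hγh hε hε' hB hB' ha₀ ha₁ {bl} {β'} hbox hbox' hl hβ' => ?_)
    (fun F {j} {γ} {ε₀} {ε₂₉} {B₃} {B₃'} {a₀} {a₁} hγ₀ hγh hε hε' hB hB' ha₀ ha₁ {bl} {β'} _ _ _ _ => h06 F hγ₀ hγh hε hε' hB hB' ha₀ ha₁) h07 h08 h09 h09T (fun F {j} {γ} {ε₀} {ε₂₉} {B₃} {B₃'} {a₀} {a₁} _ _ _ _ _ _ _ _ {bl} {β'} _ _ _ _ => h10 F) h11N hEfl h13pos hrowsR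
  -- the Stage-3 view of the printed-z member IS the family dictionary (`rfl`); ζ-L's door at `stage3OfFamily F`
  haveI : FiniteDimensional ℝ (stage3OfFamily F).𝔸 :=
    -- RE-KEY-NEUTRAL (director-ym №262, FLAG №14 T0 (β)): the by-name lemma of `Node00/Record12NumericsFamilyFiniteDim` (p692370), any `(stage3OfFamily F).𝔸`.
    Literature.MathematicalPhysics.QuantumFieldTheory.Balaban1983to89.Node00.finiteDimensional_𝔸_stage3OfFamily F
  -- print's trace state on the record algebra `(stage3OfFamily F).𝔸 = M₂(ℂ)` BY NAME (NODE 00 `Record12NumericsFamilyTraceState`): `τ := tr`, `C_τ := 2`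
  obtain ⟨τ, Cτ, hτp, hτt, hτs, hCτ⟩ := Literature.MathematicalPhysics.QuantumFieldTheory.Balaban1983to89.Node00.exists_traceState_stage3OfFamily F
  obtain ⟨β, len, B₀'H, B₂', BG, BR, cL, hβ, hlen, hB₀'H, hB₂', hBG, hBR, hcL, hLet, SLetUB⟩ := hN06 F
  -- dag-n06-b's theorem is UNIFORM in the base letters `ops₀` and the block parameter `M`: chosen here (`ops₀ := 0`, `M := 1`), off the display
  let ops₀ : ℝ → ZdIdx (stage3OfFamily F).D (stage3OfFamily F).L → ℕ → OpsZd (stage3OfFamily F).D (stage3OfFamily F).𝔸 :=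
    fun _ _ _ => ⟨fun _ _ _ _ => 0, fun _ _ _ _ => 0, fun _ _ _ _ => 0, fun _ _ _ _ => 0⟩
  haveI : NeZero (M₁ * (stage3OfFamily F).L) := ⟨Nat.pos_iff_ne_zero.mp (Nat.mul_pos hM₁ (by have := F.hL11; show 0 < F.L; omega))⟩
  -- N06's five binders with ONE constant set over all members, from dag-n06-b's η-free ∃∀ theorem (road (i): the η-scaling of the record)
  obtain ⟨aI, haI, aT, haT, B₀, hB₀, Cβ, hCβ, cS, hcS, cSβ, hcSβ, hB⟩ :=
    Literature.MathematicalPhysics.QuantumFieldTheory.Balaban1983to89.B9Thm33BindersUniformZdPerNestedEta.IdxB8SubDPerκ.binders_uniform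
      (P := M₁ * (stage3OfFamily F).L) (Mκ := M₁) (Rκ := R) τ hτp hτt hτs (by show 2 ≤ 4; norm_num) hCτ ops₀ 1 hβ hlen
  -- ζ-L's door with `a_S := a_T`, `C_β ↦ max C_β 1` (dag-n05-d's two glue lines), the Hölder binder weakened by `holderAtIH2Per_anti`
  exact exists_residB8_slot8κ'_of_bindersLettersPer_doorL (stage3OfFamily F) (by show 2 ≤ 4; norm_num) (by have := F.hL11; show 5 ≤ F.L; omega) M₁ R hM₁
    τ hτp hτt hτs hCτ ops₀ le_rfl haI haT haT hB₀ (lt_max_of_lt_right one_pos) hcS hcSβ hB₀'H hB₂' hBG hBR hcL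
    (fun a m hm => (hB a m hm).1) (fun a m hm => (hB a m hm).2.1) (fun a m hm => holderAtIH2Per_anti (ha := le_rfl) (hC := le_max_left Cβ 1) (h := (hB a m hm).2.2.1))
    (fun a m hm => (hB a m hm).2.2.2.1) (fun a m hm => (hB a m hm).2.2.2.2) hLet SLetUB

end Summit.QuantumFields.YangMills.BalabanUVNodes.N24K1FaceTrN06OYN07N08JunctionLSlot8KappaPrimeAtGaussPinPrintedZYP

end
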